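import Mathlib
import HarnessLib
import Literature.Combinatorics.Additive.KempermanStructures

/-!
# Near and fringed `R`-sequences (Boothby–DeVos–Montejano §7, complete: Definitions 7.1, 7.2,
# Lemmas 7.3, 7.4, 7.5 (Sequence Stability) and 7.6)

Topic `Literature/Combinatorics/Additive`.  Cell `mm-stpp` (D-0046), seat `mm-stpp-lit` (gen 13);
continuation of `CriticalTrios.lean` (S87: trios, `third`, `trioDeficiency`, `IsMaximalTrio`,
`IsSubgroupCarrier`, Kneser for trios) and `KempermanStructures.lean` (S89: `rseq`,
`IsCyclicQuotGen`, the period `exists_minimal_nsmul_mem`, pure/impure beats and chords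
`IsPureChordAt` / `IsImpureChordAt`, `Similar`, `IsPureChord` / `IsImpureChord`).

SOURCE.  T. Boothby, M. DeVos, A. Montejano, *A new proof of Kemperman's theorem*, Integers 15
(2015) #A5 = arXiv:1301.0095, §7 "Near Sequences" [cite: BoothbyDevosMontejano2013, §7].  For a
FINITE abelian group `G`, a subgroup carrier `H : Finset G` and `r : G` standing for the coset
`R = r + H`, this file types

* **Definition 7.1** `IsNearSeq H r A` ("`A + H` is an `R`-sequence and `|(A + H) ∖ A| < |H|`")
  and **Definition 7.2** `IsFringedSeq H r A` ("`A + H` is an `R`-sequence with head `S` and tail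
  `T`, and `A ∖ S` or `A ∖ T` is `H`-stable"); "proper" (`|G ∖ A| ≥ 2|H|`) and "nontrivial"
  (`|A| > |H|`) are written out as the inequalities `2 * #H ≤ #Aᶜ`, `#H < #A` where they occur;
  `rseq_isNearSeq`, `rseq_isFringedSeq`, `IsNearSeq.vadd`, `sdiff_add_eq_of_stable`;
* the coset-index calculus below the period `t` (`exists_index_lt`, `index_eq_of_mem`,
  `neg_mem_coset`, `mem_rseq_r_iff`, `mem_rseq_zero_iff`, `union_rseq_r`, `rseq_ne_univ_of_lt`,
  `compl_neg_rseq` : `\overline{−(c + [0,L)R)} = (r − c) + [0, t − L)R`);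
* complements on chords in normal position used by §§7–8: the PERIOD BOUND
  `IsImpureChordAt.add_le_period` (`m + n ≤ t` for the lengths of `H ∪ A`, `H ∪ B`),
  `IsImpureChordAt.third_sdiff_eq` (`third A B ∖ H = r + [0, t − m − n + 1)R`), the ROTATIONS
  `IsImpureChordAt.rotate` (for a maximal impure chord `(B, C, A)` is again an impure chord in
  normal position) and `IsPureChordAt.rotate`, `IsPureChordAt.swap`, `add_eq_union_of_union_eq_rseq`;
* **Lemma 7.6**: "Let `(A,B,C)` be a critical trio of which `(A*,B*,C*)` is a maximal critical
  supertrio.  If `(A*,B*,C*)` is a pure or impure chord, and `A` is finite, then `A` is a proper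
  near sequence" — PROVED, following the printed proof: `card_sdiff_lt_trioDeficiency`
  (`|A* ∖ A| < δ(A*,B*,C*)`), `card_le_card_inter_coset` / `meets_of_card_sdiff_lt` /
  `add_eq_add_of_meets` (a `K`-stable `A*`, `K ≤ H`, with `< |K|` holes has `A + H = A* + H`), then
  `IsPureChordAt.isNearSeq_of_subtrio` (`δ* = |H|`, `A*` an `R`-sequence) and
  `IsImpureChordAt.isNearSeq_of_subtrio` (`K = stab A*`, `δ* = |K|` by Thm 3.5,
  `K ≤ stab(A* + H) = H` by `addStab_rseq`), for the first member in normal position; for ALL THREE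
  members (`…isNearSeq_of_subtrio₃`, through `swap`/`rotate`); and AS PRINTED, the chord given up to
  similarity (`isNearSeq_of_subtrio_of_isPureChord`, `isNearSeq_of_subtrio_of_isImpureChord`, via
  the transport lemma `Similar.forall_subtrio_isNearSeq`).
* **Lemma 7.3**: "Let `(A,B)` be a nontrivial critical pair, and assume that `A` is a nontrivial
  near `R`-sequence for `R ∈ G/H`, and that `B` is not contained in any `H`-coset.  If there exists
  an `R`-sequence `B*` with `B ⊆ B*` and `A + B* ≠ G`, then `A + B` is a fringed `R`-sequence" —
  PROVED in the printed normal position (`A + H = H ∪ … ∪ ℓR`, `B* = H ∪ … ∪ mR` with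
  `B ∩ H ≠ ∅ ≠ B ∩ mR`; "not in one coset" = `m ≥ 1`, "`A + B* ≠ G`" = `ℓ + m + 1 < t`), following the
  printed proof: `card_add_add_hull_le` (purification to the hull, "`(A, B + H)` is critical"),
  **Claim 1** `forall_inter_coset_nonempty_of_critical` (every `B_i ≠ ∅`; the integer step
  `eq_range_of_card_range_add_lt` is done by a direct count instead of Nathanson's Lemma 1.3),
  **Claim 2** `head_or_tail_full_of_middle_full` (Kneser on the end cosets `A₀ + B₀`, `A_ℓ + B_m`,
  proper stabilizers have index ≥ 2), and the induction on `|B|` with **Claim 3** and the final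
  count in `head_or_tail_full_of_critical` (conclusion in the concrete form "all of `R,…,(ℓ+m)R` or
  all of `H,…,(ℓ+m−1)R` lie in `A + B`"), whence `isFringedSeq_add_of_critical`, and AS PRINTED
  (arbitrary position: `IsNearSeq H r A` with `|A| > |H|`, `B` in no `H`-coset, `B ⊆ B* = rseq H r b n`
  with `A + B* ≠ univ`) `isFringedSeq_add_of_critical_of_isNearSeq`, by the paper's own reduction
  "by shifting `A` and `B` … replacing `B*` with a smaller `R`-sequence" (`IsFringedSeq.vadd`,
  `vadd_add_vadd_eq`), and with the concrete output of its proof (`hull_and_full_of_critical`: the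
  hull `B + H` and the full cosets of `A + B`); helpers
  `card_add_two_mul_le_of_subset_rseq`, `addStab_subset_of_subset_coset`,
  `two_mul_card_le_of_ssubset`, `inter_coset_nonempty_of_add_eq`, `isFringedSeq_of_tail_full`,
  `isFringedSeq_of_head_full`, `add_eq_biUnion_filter`, `card_biUnion_coset`,
  `biUnion_coset_add_biUnion_coset`.

DEVIATIONS.  Finite `G` (so "`A` is finite" is automatic); the standing assumption of §7 "`R`
generates `G/H`" is not part of `IsNearSeq`/`IsFringedSeq` but a separate hypothesis
(`IsCyclicQuotGen H r`, supplied by the chord in Lemma 7.6); an `R`-sequence `A + H` is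
`rseq H r a n` with `n ≥ 1` TERMS (head `a + H`, tail `a + (n−1)•r + H`); the maximality hypothesis
of Lemma 7.6 is needed only in the impure case (a pure chord is maximal by
`IsPureChordAt.isMaximalTrio`); the impure case identifies `K = stab A*` and uses `δ* = |K|`
(Thm 3.5 of the source via S87) exactly as printed, and "A* is a proper fringed `R`-sequence" is
replaced by the explicit coset bookkeeping `m + n ≤ t`.

In Lemma 7.3 "nontrivial near `R`-sequence" is `IsNearSeq H r A ∧ |H| < |A|`, "`B` is not contained
in any `H`-coset" is `∀ c, ¬ B ⊆ c +ᵥ H`, and the `R`-sequence `B*` is given as `rseq H r b n`.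
In Lemma 7.4, `A` is taken in normal position (`A + H = rseq H r 0 (ℓ+1)`), "every supertrio
`(A,B*,C*)` equals `(A,B,C)`" is `C = third A B ∧ B = third A C`, "proper" is `2|H| ≤ |G ∖ A|`; the
conclusion is proved in the symmetric form "`B` and `C` fringed" (`isFringedSeq_of_maximal_critical`)
and as printed "`B` and `\overline{C}` fringed" (`isFringedSeq_and_compl_of_maximal_critical`).

* Sequence calculus for §§7–8: `neg_rseq`, `compl_rseq`, `mem_rseq_iff_index`,
  `IsFringedSeq.normal_form` (a witness with `n ≤ t`), `full_cosets_of_fringed`,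
  `isFringedSeq_of_tail_full'`/`_of_head_full'` (arbitrary head), `IsFringedSeq.neg`,
  `IsFringedSeq.compl`, `coset_subset_add_of_tail_full`/`_of_head_full` (a near sequence plus a
  fringed set), `coset_subset_of_maximal_tail`/`_head` ("the maximality of `B` implies that `B` is
  fringed"), `third_coset_eq` (`third A (s + H)` is an `R`-sequence of `t − ℓ − 1` cosets),
  `exists_closure` (the `A`-closure `C'' = third A B'`, `B'' = third A C''`), `partialCosets` with
  `card_partialCosets_union_lt` / `partialCosets_inter_subset`.
* **Lemma 7.4**: "Let `(A,B,C)` be a nontrivial critical trio … every supertrio `(A,B*,C*)` has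
  `(A,B,C) = (A,B*,C*)` … `A` a nontrivial proper near `R`-sequence.  If neither `B` nor `C` is
  contained in an `H`-coset, then `B` and `\overline{C}` are fringed `R`-sequences" — PROVED
  following the printed proof: the double-extremal counterexample becomes a strong induction on
  `l74Measure` (`|G| − |B| − |C|` first, then the number of partial cosets of `B` and `C`,
  `l74Measure_lt`); Claim 4 = the exits `l74_of_subset_rseq` (Lemma 7.3 ⇒ `A + B` fringed ⇒ `B`
  fringed by maximality ⇒ `C = \overline{−(A+B)}` fringed); Claim 5, the partial coset `S` of `B`,
  the purified trio `(A, B ∪ S, C ∩ third A S)` and its `A`-closure `(A,B'',C'')`, the case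
  `C'' ⊆ T` (every coset `U ⊆ third(A+T)` meets `B` via Lemma 6.2, then the trio
  `(A, B ∩ third(A+T), C ∪ T)`, its closure and the induction hypothesis, contradicting Claim 4)
  and the case `C''` in no coset (induction hypothesis, `B''` fringed, contradicting Claim 4) are the
  body of `l74_main`; `|C| > |H|` w.l.o.g. by the symmetry `(B,C) ↦ (C,B)` in
  `isFringedSeq_of_maximal_critical`.

* **Lemma 7.5 (Sequence Stability)**: "Let `(A,B,C)` be a maximal critical trio with
  `[A] = [B] = [C] = G`.  If `A` is a proper near sequence, then `(A,B,C)` is either a pure or an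
  impure chord" — PROVED as printed (`isPureChord_or_isImpureChord_of_near`, conclusion
  `IsPureChord H (A,B,C) ∨ IsImpureChord H (A,B,C)` of S89): Lemma 7.4 gives `B` fringed; "by
  maximality `A` is also fringed" (`coset_subset_left_of_maximal_tail/_head`); "again using
  maximality" is the core case `pureChordAt_or_impureChordAt` (both sets basic and tail-full: a pure
  chord in normal position when `H ⊆ A + B` — then `A`, `B`, `C` are full `R`-sequences by three
  applications of `compl_neg_rseq` — and an impure chord in normal position otherwise), reached by
  translating `B` to head `H` (`Similar.translate₃`) and, when the full cosets sit on the head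
  side, by passing to the generator `−R` (`IsCyclicQuotGen.neg`).  "`[B] = [C] = G`" is used only
  as "`B`, `C` lie in no `H`-coset"; `A` nontrivial (`ℓ ≥ 1`) replaces "`[A] = G`".

NOT FORMALIZED here: §8 (Claims 6–12: the minimal counterexample over all finite abelian groups,
passing to `G ⧸ stab` and to subgroups) and Theorem 4.5 itself.  §7 is complete.  Everything here
is PROVED (0 named facts).
Census-silent for the cell `mm-stpp` (LIT-INDEX §11 (b)).

## References
* T. Boothby, M. DeVos, A. Montejano, *A new proof of Kemperman's theorem*, Integers 15 (2015)
  #A5, arXiv:1301.0095, §7 (Definitions 7.1, 7.2, Lemmas 7.3, 7.4, 7.5, 7.6 with their proofs) —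
  held `paper:arxiv-1301.0095`, chunks p0009–p0010 read 2026-08-28
  [cite: BoothbyDevosMontejano2013, Def 7.1; Def 7.2; Lemma 7.3; Lemma 7.4; Lemma 7.5; Lemma 7.6].
* J. H. B. Kemperman, *On small sumsets in an abelian group*, Acta Math. 103 (1960) 63–88 (not
  held; cited through the source).
-/

namespace Literature.Combinatorics.Additive

open Finset Grynkiewicz
open scoped Pointwise

variable {G : Type*} [AddCommGroup G] [DecidableEq G]

/-! ## Definitions 7.1 and 7.2 -/

/-- **Definition 7.1.**  "We say that `A ⊆ G` is a NEAR `R`-SEQUENCE if `A + H` is an `R`-sequence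
and `|(A + H) ∖ A| < |H|`" (for the finite subgroup `H < G` and the coset `R = r + H`; the
standing assumption "`R` generates `G/H`" of §7 is kept as a separate hypothesis `IsCyclicQuotGen H r`
where it is used).  `A + H = rseq H r a n` with `n ≥ 1` terms. [cite: BoothbyDevosMontejano2013, Def 7.1] -/
def IsNearSeq (H : Finset G) (r : G) (A : Finset G) : Prop :=
  (∃ a : G, ∃ n : ℕ, 1 ≤ n ∧ A + H = rseq H r a n) ∧ #((A + H) \ A) < #H

/-- **Definition 7.2.**  "We say that `A ⊆ G` is a FRINGED `R`-SEQUENCE if `A + H` is an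
`R`-sequence, and if `A + H` has head `S` and tail `T`, then either `A ∖ S` or `A ∖ T` is
`H`-stable."  Here `A + H = rseq H r a n` (`n ≥ 1` terms) has head `S = a + H` and tail
`T = a + (n−1)•r + H`. [cite: BoothbyDevosMontejano2013, Def 7.2] -/
def IsFringedSeq (H : Finset G) (r : G) (A : Finset G) : Prop :=
  ∃ a : G, ∃ n : ℕ, 1 ≤ n ∧ A + H = rseq H r a n ∧
    (A \ (a +ᵥ H) + H = A \ (a +ᵥ H) ∨
      A \ ((a + (n - 1) • r) +ᵥ H) + H = A \ ((a + (n - 1) • r) +ᵥ H))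

section Defs

variable {H A : Finset G} {r a : G} {n : ℕ}

/-- Unfolding lemma. [cite: BoothbyDevosMontejano2013, Def 7.1] -/
theorem isNearSeq_iff : IsNearSeq H r A ↔
    (∃ a : G, ∃ n : ℕ, 1 ≤ n ∧ A + H = rseq H r a n) ∧ #((A + H) \ A) < #H := Iff.rfl

/-- Unfolding lemma. [cite: BoothbyDevosMontejano2013, Def 7.2] -/
theorem isFringedSeq_iff : IsFringedSeq H r A ↔
    ∃ a : G, ∃ n : ℕ, 1 ≤ n ∧ A + H = rseq H r a n ∧
      (A \ (a +ᵥ H) + H = A \ (a +ᵥ H) ∨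
        A \ ((a + (n - 1) • r) +ᵥ H) + H = A \ ((a + (n - 1) • r) +ᵥ H)) := Iff.rfl

/-- An `R`-sequence is a near `R`-sequence. [cite: BoothbyDevosMontejano2013, Def 7.1] -/
theorem rseq_isNearSeq (hH : IsSubgroupCarrier H) (r a : G) (hn : 1 ≤ n) :
    IsNearSeq H r (rseq H r a n) := by
  refine ⟨⟨a, n, hn, rseq_add hH r a n⟩, ?_⟩
  rw [rseq_add hH, sdiff_self, bot_eq_empty, card_empty]
  exact hH.nonempty.card_pos

/-- The difference of two `H`-stable sets is `H`-stable. [cite: BoothbyDevosMontejano2013, §7] -/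
theorem sdiff_add_eq_of_stable (hH : IsSubgroupCarrier H) {P Q : Finset G} (hP : P + H = P)
    (hQ : Q + H = Q) : P \ Q + H = P \ Q := by
  refine Subset.antisymm ?_ (hH.subset_add _)
  intro x hx
  obtain ⟨p, hp, h, hh, rfl⟩ := mem_add.1 hx
  rw [mem_sdiff] at hp ⊢
  refine ⟨by rw [← hP]; exact add_mem_add hp.1 hh, fun hq => hp.2 ?_⟩
  have : p + h + -h ∈ Q + H := add_mem_add hq (hH.neg_mem hh)
  rwa [add_neg_cancel_right, hQ] at this

/-- An `R`-sequence is a fringed `R`-sequence (it is `H`-stable, so `A ∖ S` is).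
[cite: BoothbyDevosMontejano2013, Def 7.2] -/
theorem rseq_isFringedSeq (hH : IsSubgroupCarrier H) (r a : G) (hn : 1 ≤ n) :
    IsFringedSeq H r (rseq H r a n) :=
  ⟨a, n, hn, rseq_add hH r a n,
    Or.inl (sdiff_add_eq_of_stable hH (rseq_add hH r a n) (hH.coset_add a))⟩

/-- Near `R`-sequences are preserved by translation. [cite: BoothbyDevosMontejano2013, §7] -/
theorem IsNearSeq.vadd (h : IsNearSeq H r A) (g : G) : IsNearSeq H r (g +ᵥ A) := by
  obtain ⟨⟨a, n, hn, hA⟩, hlt⟩ := h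
  have e : (g +ᵥ A) + H = g +ᵥ (A + H) := vadd_add_assoc g A H
  refine ⟨⟨g + a, n, hn, by rw [e, hA, vadd_rseq]⟩, ?_⟩
  rw [e, ← vadd_finset_sdiff, card_vadd_finset]
  exact hlt

end Defs

/-! ## Coset indices below the period -/

section Index

variable {H A B : Finset G} {r x : G} {i j k L m n t : ℕ}

/-- With `t•r ∈ H` and `R = r + H` generating `G/H`, every point lies in a coset `j•r + H`,
`j < t`. [cite: BoothbyDevosMontejano2013, §4] -/
theorem exists_index_lt (hH : IsSubgroupCarrier H) (hgen : IsCyclicQuotGen H r) (ht : 0 < t)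
    (htH : t • r ∈ H) (x : G) : ∃ j : ℕ, j < t ∧ x ∈ (j • r) +ᵥ H := by
  obtain ⟨i, hi⟩ := hgen x
  refine ⟨i % t, Nat.mod_lt i ht, ?_⟩
  rw [hH.mem_coset_iff] at hi ⊢
  have hi' : i • r = (i % t) • r + (t * (i / t)) • r := by rw [← add_nsmul, Nat.mod_add_div]
  have e : x - (i % t) • r = (x - i • r) + (t * (i / t)) • r := by rw [hi']; abel
  rw [e]; exact hH.add_mem hi (hH.mul_nsmul_mem htH _)

/-- A point outside `H` has positive coset index. [cite: BoothbyDevosMontejano2013, §4] -/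
theorem index_pos_of_not_mem (hH : IsSubgroupCarrier H) (hx : x ∈ (j • r) +ᵥ H) (hxH : x ∉ H) :
    0 < j := by
  rcases Nat.eq_zero_or_pos j with rfl | h
  · rw [zero_nsmul] at hx
    exact (hxH (by rwa [hH.mem_coset_iff, sub_zero] at hx)).elim
  · exact h

/-- Coset indices below the period are unique. [cite: BoothbyDevosMontejano2013, §4] -/
theorem index_eq_of_mem (hH : IsSubgroupCarrier H) (hmin : ∀ s : ℕ, 0 < s → s < t → s • r ∉ H)
    (hi : i < t) (hj : j < t) (hx : x ∈ (i • r) +ᵥ H) (hx' : x ∈ (j • r) +ᵥ H) : i = j := by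
  by_contra hne
  rcases Nat.lt_or_gt_of_ne hne with hlt | hlt
  · have := disjoint_coset_of_lt hH hmin 0 hlt hj
    rw [zero_add, zero_add] at this
    exact disjoint_left.1 this hx hx'
  · have := disjoint_coset_of_lt hH hmin 0 hlt hi
    rw [zero_add, zero_add] at this
    exact disjoint_left.1 this hx' hx

/-- Negation on cosets: `x ∈ j•r + H`, `j ≤ t` ⇒ `−x ∈ (t − j)•r + H`. [cite: BoothbyDevosMontejano2013, §4] -/
theorem neg_mem_coset (hH : IsSubgroupCarrier H) (htH : t • r ∈ H) (hjt : j ≤ t)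
    (hx : x ∈ (j • r) +ᵥ H) : -x ∈ ((t - j) • r) +ᵥ H := by
  rw [hH.mem_coset_iff] at hx ⊢
  have e1 : (t - j) • r + j • r = t • r := by rw [← add_nsmul, Nat.sub_add_cancel hjt]
  have e : -x - (t - j) • r = -(x - j • r) - t • r := by rw [← e1]; abel
  rw [e]; exact hH.sub_mem (hH.neg_mem hx) htH

/-- Membership of a point of coset index `k` (`1 ≤ k < t`) in `rseq H r r L` (the cosets
`r + H, …, L•r + H`, `L < t`): iff `k ≤ L`. [cite: BoothbyDevosMontejano2013, §4] -/
theorem mem_rseq_r_iff (hH : IsSubgroupCarrier H) (hmin : ∀ s : ℕ, 0 < s → s < t → s • r ∉ H)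
    (hk1 : 1 ≤ k) (hkt : k < t) (hLt : L < t) (hx : x ∈ (k • r) +ᵥ H) :
    x ∈ rseq H r r L ↔ k ≤ L := by
  rw [mem_rseq]
  constructor
  · rintro ⟨i, hi, hxi⟩
    have e : r + i • r = (i + 1) • r := by rw [add_nsmul, one_nsmul, add_comm]
    rw [e] at hxi
    have := index_eq_of_mem hH hmin hkt (by omega) hx hxi
    omega
  · intro hkL
    refine ⟨k - 1, by omega, ?_⟩
    have e : r + (k - 1) • r = k • r := by
      rw [add_comm, ← succ_nsmul, Nat.sub_add_cancel hk1]
    rw [e]; exact hx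

/-- Membership of a point of coset index `k < t` in the basic sequence `rseq H r 0 L` (`L ≤ t`): iff
`k < L`. [cite: BoothbyDevosMontejano2013, §4] -/
theorem mem_rseq_zero_iff (hH : IsSubgroupCarrier H) (hmin : ∀ s : ℕ, 0 < s → s < t → s • r ∉ H)
    (hkt : k < t) (hLt : L ≤ t) (hx : x ∈ (k • r) +ᵥ H) :
    x ∈ rseq H r 0 L ↔ k < L := by
  rw [mem_rseq]
  constructor
  · rintro ⟨i, hi, hxi⟩
    rw [zero_add] at hxi
    have := index_eq_of_mem hH hmin hkt (by omega) hx hxi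
    omega
  · intro hkL
    exact ⟨k, hkL, by rwa [zero_add]⟩

/-- `H ∪ (r + H) ∪ … ∪ (L•r + H)` is the basic sequence with `L + 1` terms.
[cite: BoothbyDevosMontejano2013, §4] -/
theorem union_rseq_r (H : Finset G) (r : G) (L : ℕ) : H ∪ rseq H r r L = rseq H r 0 (L + 1) := by
  ext x
  rw [mem_union, mem_rseq, mem_rseq]
  constructor
  · rintro (hx | ⟨i, hi, hx⟩)
    · exact ⟨0, by omega, by rwa [zero_add, zero_nsmul, zero_vadd]⟩
    · refine ⟨i + 1, by omega, ?_⟩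
      rwa [zero_add, add_nsmul, one_nsmul, add_comm]
  · rintro ⟨i, hi, hx⟩
    rw [zero_add] at hx
    rcases Nat.eq_zero_or_pos i with rfl | hpos
    · left; rwa [zero_nsmul, zero_vadd] at hx
    · right
      refine ⟨i - 1, by omega, ?_⟩
      have e : r + (i - 1) • r = i • r := by
        rw [add_comm, ← succ_nsmul, Nat.sub_add_cancel hpos]
      rwa [e]

variable [Fintype G]

/-- A basic sequence with fewer than `t` terms is not all of `G`. [cite: BoothbyDevosMontejano2013, §4] -/
theorem rseq_ne_univ_of_lt (hH : IsSubgroupCarrier H) (hgen : IsCyclicQuotGen H r) (ht : 0 < t)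
    (htH : t • r ∈ H) (hmin : ∀ s : ℕ, 0 < s → s < t → s • r ∉ H) (a : G) (hmt : m < t) :
    rseq H r a m ≠ univ := by
  intro hu
  have h1 := card_rseq hH hmin a hmt.le
  rw [hu, card_univ, card_univ_eq_of_minimal hH hgen ht htH hmin] at h1
  have := Nat.eq_of_mul_eq_mul_right hH.nonempty.card_pos h1
  omega

/-- The complement of the negative of an `R`-sequence of length `1 ≤ L < t` is the `R`-sequence of
the remaining `t − L` cosets: `\overline{−(c + [0,L)R)} = (r − c) + [0, t−L)R`.
[cite: BoothbyDevosMontejano2013, §4] -/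
theorem compl_neg_rseq (hH : IsSubgroupCarrier H) (hgen : IsCyclicQuotGen H r) (ht : 0 < t)
    (htH : t • r ∈ H) (hmin : ∀ s : ℕ, 0 < s → s < t → s • r ∉ H) (c : G) (hL1 : 1 ≤ L)
    (hLt : L < t) : (-(rseq H r c L))ᶜ = rseq H r (r - c) (t - L) := by
  ext x
  rw [mem_compl, mem_neg']
  -- write `−x − c ∈ j•r + H`, `j < t`
  obtain ⟨j, hjt, hj⟩ := exists_index_lt hH hgen ht htH (-x - c)
  have hc : rseq H r c L = c +ᵥ rseq H r 0 L := by rw [vadd_rseq, add_zero]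
  have hrc : rseq H r (r - c) (t - L) = (-c) +ᵥ rseq H r r (t - L) := by
    rw [vadd_rseq, neg_add_eq_sub]
  have key1 : -x ∈ rseq H r c L ↔ j < L := by
    rw [hc, mem_vadd_finset]
    constructor
    · rintro ⟨y, hy, hxy⟩
      have : y = -x - c := by rw [← hxy]; abel_nf; rw [vadd_eq_add]; abel
      rw [this] at hy
      exact (mem_rseq_zero_iff hH hmin hjt hLt.le hj).1 hy
    · intro hjL
      exact ⟨-x - c, (mem_rseq_zero_iff hH hmin hjt hLt.le hj).2 hjL, by rw [vadd_eq_add]; abel⟩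
  have key2 : x ∈ rseq H r (r - c) (t - L) ↔ L ≤ j := by
    rw [hrc, mem_vadd_finset]
    -- `x + c = −(−x − c)` has index `t − j` (or `0` if `j = 0`)
    have hxc : x + c = -(-x - c) := by abel
    constructor
    · rintro ⟨y, hy, hxy⟩
      have hy' : y = x + c := by rw [← hxy, vadd_eq_add]; abel
      rw [hy', hxc] at hy
      rcases Nat.eq_zero_or_pos j with hj0 | hj0
      · -- then `−x − c ∈ H`, so `x + c ∈ H`, not in `rseq r (t − L)` (indices ≥ 1)
        exfalso
        rw [hj0, zero_nsmul] at hj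
        have hH' : -(-x - c) ∈ H := hH.neg_mem (by rwa [hH.mem_coset_iff, sub_zero] at hj)
        rw [mem_rseq] at hy
        obtain ⟨i, hi, hyi⟩ := hy
        have e : r + i • r = (i + 1) • r := by rw [add_nsmul, one_nsmul, add_comm]
        rw [e] at hyi
        exact not_mem_of_mem_coset hH hmin (by omega) (by omega) hyi hH'
      · have hneg := neg_mem_coset hH htH hjt.le hj
        have := (mem_rseq_r_iff hH hmin (by omega) (by omega) (by omega) hneg).1 hy
        omega
    · intro hLj
      refine ⟨x + c, ?_, by rw [vadd_eq_add]; abel⟩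
      rw [hxc]
      have hneg := neg_mem_coset hH htH hjt.le hj
      exact (mem_rseq_r_iff hH hmin (by omega) (by omega) (by omega) hneg).2 (by omega)
  rw [key1, key2, not_lt]

end Index

/-! ## Few holes: when a subset of a stable set is still a near sequence -/

section Holes

variable {H K A As B Bs C Cs : Finset G} {r x : G}

/-- If `K ≤ H` and `P` is `K`-stable, each `H`-coset met by `P` carries at least `|K|` points of
`P`. [cite: BoothbyDevosMontejano2013, §7] -/
theorem card_le_card_inter_coset (hH : IsSubgroupCarrier H) (hK : IsSubgroupCarrier K)
    (hKH : K ⊆ H) {P : Finset G} (hP : P + K = P) {p x : G} (hp : p ∈ P) (hpx : p ∈ x +ᵥ H) :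
    #K ≤ #(P ∩ (x +ᵥ H)) := by
  have h1 : p +ᵥ K ⊆ P := hK.coset_subset_of_stable hP hp
  have h2 : p +ᵥ K ⊆ x +ᵥ H := by
    intro y hy
    rw [hK.mem_coset_iff] at hy
    rw [hH.mem_coset_iff] at hpx ⊢
    have e : y - x = (y - p) + (p - x) := by abel
    rw [e]; exact hH.add_mem (hKH hy) hpx
  calc #K = #(p +ᵥ K) := (card_vadd_finset _ _).symm
    _ ≤ _ := card_le_card (subset_inter h1 h2)

/-- If `A ⊆ A*` meets every `H`-coset met by `A*`, then `A + H = A* + H`.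
[cite: BoothbyDevosMontejano2013, §7] -/
theorem add_eq_add_of_meets (hH : IsSubgroupCarrier H) (hA : A ⊆ As)
    (hmeet : ∀ x ∈ As, ((x +ᵥ H) ∩ A).Nonempty) : A + H = As + H := by
  refine Subset.antisymm (add_subset_add_right hA) ?_
  intro y hy
  obtain ⟨x, hx, h, hh, rfl⟩ := mem_add.1 hy
  obtain ⟨a, ha⟩ := hmeet x hx
  rw [mem_inter, hH.mem_coset_iff] at ha
  refine mem_add.2 ⟨a, ha.2, x + h - a, ?_, by abel⟩
  have e : x + h - a = h - (a - x) := by abel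
  rw [e]; exact hH.sub_mem hh ha.1

/-- "Since `(A,B,C)` is critical, we must have `|A* ∖ A| < |K|` … it follows immediately that `A`
is a near `R`-sequence": a `K`-stable `A*` (`K ≤ H`) with fewer than `|K|` holes `A* ∖ A` has
`A` meeting every `H`-coset of `A*`. [cite: BoothbyDevosMontejano2013, Lemma 7.6] -/
theorem meets_of_card_sdiff_lt (hH : IsSubgroupCarrier H) (hK : IsSubgroupCarrier K) (hKH : K ⊆ H)
    (hP : As + K = As) (hlt : #(As \ A) < #K) :
    ∀ x ∈ As, ((x +ᵥ H) ∩ A).Nonempty := by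
  intro x hx
  have hc := card_le_card_inter_coset hH hK hKH hP hx (hH.mem_coset_self x)
  by_contra hem
  rw [not_nonempty_iff_eq_empty] at hem
  have hsub : As ∩ (x +ᵥ H) ⊆ As \ A := by
    intro y hy
    rw [mem_inter] at hy
    refine mem_sdiff.2 ⟨hy.1, fun hyA => ?_⟩
    have : y ∈ (x +ᵥ H) ∩ A := mem_inter.2 ⟨hy.2, hyA⟩
    rw [hem] at this
    simp at this
  have := card_le_card hsub
  omega

variable [Fintype G]

omit [AddCommGroup G] in
/-- Criticality bookkeeping: for a critical subtrio `(A,B,C) ⊆ (A*,B*,C*)`,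
`|A* ∖ A| < δ(A*,B*,C*)`. [cite: BoothbyDevosMontejano2013, Lemma 7.6] -/
theorem card_sdiff_lt_trioDeficiency (hA : A ⊆ As) (hB : B ⊆ Bs) (hC : C ⊆ Cs)
    (hδ : 0 < trioDeficiency A B C) : (#(As \ A) : ℤ) < trioDeficiency As Bs Cs := by
  have h1 := card_sdiff_add_card_eq_card hA
  have h2 := card_le_card hB
  have h3 := card_le_card hC
  unfold trioDeficiency at *
  omega

omit [AddCommGroup G] [DecidableEq G] in
/-- Deficiency is monotone along supertrios. [cite: BoothbyDevosMontejano2013, §3] -/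
theorem trioDeficiency_mono (hA : A ⊆ As) (hB : B ⊆ Bs) (hC : C ⊆ Cs) :
    trioDeficiency A B C ≤ trioDeficiency As Bs Cs := by
  have h1 := card_le_card hA
  have h2 := card_le_card hB
  have h3 := card_le_card hC
  unfold trioDeficiency
  omega

end Holes

/-! ## More on chords in normal position: the period bound, the third set, rotations -/

section Chords

variable [Fintype G] {H A B C : Finset G} {r : G} {m n t : ℕ}

omit [Fintype G] in
/-- In an impure chord `A* + H = H ∪ A*` (`A*` meets `H` and lies in the `H`-stable `H ∪ A*`).
[cite: BoothbyDevosMontejano2013, Def 4.4] -/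
theorem add_eq_union_of_union_eq_rseq (hH : IsSubgroupCarrier H) (hHA : H ∪ A = rseq H r 0 m)
    (hA0 : (A ∩ H).Nonempty) : A + H = H ∪ A := by
  refine Subset.antisymm ?_ ?_
  · calc A + H ⊆ (H ∪ A) + H := add_subset_add_right subset_union_right
      _ = H ∪ A := by rw [hHA, rseq_add hH]
  · obtain ⟨a, ha⟩ := hA0
    rw [mem_inter] at ha
    refine union_subset (fun h hh => mem_add.2 ⟨a, ha.1, h - a, hH.sub_mem hh ha.2, by abel⟩)
      (hH.subset_add A)

/-- THE PERIOD BOUND of an impure chord: `m + n ≤ t` (the lengths of `H ∪ A`, `H ∪ B` against the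
period `t = [G : H]`): a point of `C ∖ H = third A B ∖ H` has index `j ≥ 1` with `−j ≡ t − j`
outside the indices `1, …, m + n − 2` of `(A + B) ∖ H`. [cite: BoothbyDevosMontejano2013, Def 4.4] -/
theorem IsImpureChordAt.add_le_period (hH : IsSubgroupCarrier H) (h : IsImpureChordAt H r A B C)
    (hHA : H ∪ A = rseq H r 0 m) (hHB : H ∪ B = rseq H r 0 n) (hm : 2 ≤ m) (hn : 2 ≤ n)
    (ht : 0 < t) (htH : t • r ∈ H) (hmin : ∀ s : ℕ, 0 < s → s < t → s • r ∉ H) : m + n ≤ t := by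
  have hlt := h.add_sub_two_lt hH hHA hHB hm ht htH hmin
  have hAB := h.add_sdiff_eq hH hHA hHB hm hn hmin hlt
  obtain ⟨hgen, -, -, hCH, hCne, -, -, -⟩ := h
  obtain ⟨c, hc⟩ := hCne
  rw [hCH, mem_sdiff, mem_third] at hc
  obtain ⟨j, hjt, hj⟩ := exists_index_lt hH hgen ht htH c
  have hj0 : 0 < j := index_pos_of_not_mem hH hj hc.2
  have hneg := neg_mem_coset hH htH hjt.le hj
  have hnot : -c ∉ rseq H r r (m + n - 2) := fun h' => by
    rw [← hAB, mem_sdiff] at h'; exact hc.1 h'.1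
  rw [mem_rseq_r_iff hH hmin (by omega) (by omega) hlt hneg] at hnot
  omega

/-- The third set of an impure chord outside `H`: `third A B ∖ H = r + [0, t − m − n + 1)R` (the
cosets of index `1, …, t − (m + n − 1)`). [cite: BoothbyDevosMontejano2013, Def 4.4] -/
theorem IsImpureChordAt.third_sdiff_eq (hH : IsSubgroupCarrier H) (h : IsImpureChordAt H r A B C)
    (hHA : H ∪ A = rseq H r 0 m) (hHB : H ∪ B = rseq H r 0 n) (hm : 2 ≤ m) (hn : 2 ≤ n)
    (ht : 0 < t) (htH : t • r ∈ H) (hmin : ∀ s : ℕ, 0 < s → s < t → s • r ∉ H) :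
    third A B \ H = rseq H r r (t - (m + n - 1)) := by
  have hlt := h.add_sub_two_lt hH hHA hHB hm ht htH hmin
  have hAB := h.add_sdiff_eq hH hHA hHB hm hn hmin hlt
  have hle := h.add_le_period hH hHA hHB hm hn ht htH hmin
  obtain ⟨hgen, -, -, -, -, -, -, -⟩ := h
  ext x
  rw [mem_sdiff, mem_third]
  constructor
  · rintro ⟨hx, hxH⟩
    obtain ⟨j, hjt, hj⟩ := exists_index_lt hH hgen ht htH x
    have hj0 : 0 < j := index_pos_of_not_mem hH hj hxH
    have hneg := neg_mem_coset hH htH hjt.le hj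
    have hnot : -x ∉ rseq H r r (m + n - 2) := fun h' => by
      rw [← hAB, mem_sdiff] at h'; exact hx h'.1
    rw [mem_rseq_r_iff hH hmin (by omega) (by omega) hlt hneg] at hnot
    exact (mem_rseq_r_iff hH hmin hj0 hjt (by omega) hj).2 (by omega)
  · intro hx
    have hx' := hx
    rw [mem_rseq] at hx'
    obtain ⟨i, hi, hxi⟩ := hx'
    have e : r + i • r = (i + 1) • r := by rw [add_nsmul, one_nsmul, add_comm]
    rw [e] at hxi
    have hxH : x ∉ H := not_mem_of_mem_coset hH hmin (by omega) (by omega) hxi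
    refine ⟨fun hneg => ?_, hxH⟩
    have hnxH : -x ∉ H := fun h' => hxH (by simpa using hH.neg_mem h')
    have h1 : -x ∈ rseq H r r (m + n - 2) := by rw [← hAB]; exact mem_sdiff.2 ⟨hneg, hnxH⟩
    have hnx := neg_mem_coset hH htH (by omega : i + 1 ≤ t) hxi
    rw [mem_rseq_r_iff hH hmin (by omega) (by omega) hlt hnx] at h1
    omega

/-- ROTATION of a MAXIMAL impure chord in normal position: `(B, C, A)` is again an impure chord in
normal position for the same `H`, `r` (`H ∪ C` is the basic sequence of length `t − m − n + 2 ≥ 2`,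
`A ∖ H = third B C ∖ H ∋ r`). [cite: BoothbyDevosMontejano2013, Def 4.4] -/
theorem IsImpureChordAt.rotate (hH : IsSubgroupCarrier H) (h : IsImpureChordAt H r A B C)
    (hmax : IsMaximalTrio A B C) : IsImpureChordAt H r B C A := by
  obtain ⟨t, ht, htH, hmin⟩ := exists_minimal_nsmul_mem hH r
  obtain ⟨hgen, ⟨m, hm, hHA⟩, ⟨n, hn, hHB⟩, hCH, -, hA0, hB0, hC0⟩ := id h
  have hle := h.add_le_period hH hHA hHB hm hn ht htH hmin
  have hC' : C \ H = rseq H r r (t - (m + n - 1)) := by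
    rw [hCH]; exact h.third_sdiff_eq hH hHA hHB hm hn ht htH hmin
  obtain ⟨-, -, eA⟩ := isMaximalTrio_iff.1 hmax
  refine ⟨hgen, ⟨n, hn, hHB⟩, ⟨t - (m + n - 1) + 1, by omega, ?_⟩, by rw [← eA], ?_, hB0, hC0, hA0⟩
  · rw [← union_sdiff_self_eq_union, hC', union_rseq_r]
  · have h1t : 1 < t := by omega
    refine ⟨r, mem_sdiff.2 ⟨?_, by have := hmin 1 one_pos h1t; rwa [one_nsmul] at this⟩⟩
    have := coset_subset_of_union_eq_rseq hH hmin hHA (j := 1) one_pos (by omega) h1t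
    rw [one_nsmul] at this
    exact this (hH.mem_coset_self r)

/-- The pure-chord predicate is symmetric in `A`, `B`. [cite: BoothbyDevosMontejano2013, Def 4.2] -/
theorem IsPureChordAt.swap (h : IsPureChordAt H r A B C) : IsPureChordAt H r B A C := by
  obtain ⟨hgen, hA, hB, hCeq, hCcos⟩ := h
  exact ⟨hgen, hB, hA, by rw [hCeq, third_comm], hCcos⟩

/-- ROTATION of a pure chord in normal position: `(B, C, A)` is again a pure chord (`C = third A B`
is the `R`-sequence of the `t − m − n + 1 ≥ 2` cosets complementary to `−(A + B)`, and
`A = third B C` by maximality). [cite: BoothbyDevosMontejano2013, Def 4.2] -/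
theorem IsPureChordAt.rotate (hH : IsSubgroupCarrier H) (h : IsPureChordAt H r A B C) :
    IsPureChordAt H r B C A := by
  obtain ⟨hmax, -⟩ := h.isMaximalTrio hH
  have hgen := h.1
  have hCeq := h.2.2.2.1
  have hCcos := h.2.2.2.2
  obtain ⟨a, b, m, n, hm, hn, hA, hB, hsum, hABne, hAc, -, -⟩ := h.card_eq hH
  obtain ⟨t, ht, htH, hmin⟩ := exists_minimal_nsmul_mem hH r
  have hlt : m + n - 1 < t := lt_of_rseq_ne_univ hH hgen ht htH (hsum ▸ hABne)
  obtain ⟨-, -, eA⟩ := isMaximalTrio_iff.1 hmax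
  have hC : C = rseq H r (r - (a + b)) (t - (m + n - 1)) := by
    rw [hCeq, third, hsum]
    exact compl_neg_rseq hH hgen ht htH hmin (a + b) (by omega) hlt
  refine ⟨hgen, ⟨b, n, hn, hB⟩, ⟨r - (a + b), t - (m + n - 1), ?_, hC⟩, by rw [← eA], ?_⟩
  · -- length ≥ 2: `C` is not inside one coset
    by_contra hlt2
    have h1 : t - (m + n - 1) = 1 := by omega
    rw [h1, rseq_one] at hC
    exact hCcos _ hC.le
  · -- `A = rseq a m`, `m ≥ 2`, has `m|H| > |H|` points
    intro c hc
    have h1 := card_le_card hc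
    rw [card_vadd_finset, hAc] at h1
    have h2 : 2 * #H ≤ m * #H := Nat.mul_le_mul_right _ hm
    have := hH.nonempty.card_pos
    omega

end Chords

/-! ## Lemma 7.6: critical subtrios of chords consist of proper near sequences -/

section NearOfChord

variable [Fintype G] {H A B C As Bs Cs : Finset G} {r : G}

/-- **Lemma 7.6, pure-chord case, first member.**  "If `(A*,B*,C*)` is a pure chord relative to
`H ≤ G` then `δ(A*,B*,C*) = |H|` and since `(A,B,C)` is critical, we must have `|A* ∖ A| < |H|`.
Since `A*` is finite, it is a proper `R`-sequence … and it follows immediately that `A` is a [proper]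
near `R`-sequence."  (Normal position; PROPER = `|G ∖ A| ≥ 2|H|`.)
[cite: BoothbyDevosMontejano2013, Lemma 7.6] -/
theorem IsPureChordAt.isNearSeq_of_subtrio (hH : IsSubgroupCarrier H)
    (h : IsPureChordAt H r As Bs Cs) (hA : A ⊆ As) (hB : B ⊆ Bs) (hC : C ⊆ Cs)
    (hδ : 0 < trioDeficiency A B C) : IsNearSeq H r A ∧ 2 * #H ≤ #Aᶜ := by
  have hgen := h.1
  obtain ⟨a, b, m, n, hm, hn, hAs, -, hsum, hABne, hAc, -, -⟩ := h.card_eq hH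
  have hδs := h.trioDeficiency_eq hH
  have hlt' := card_sdiff_lt_trioDeficiency hA hB hC hδ
  rw [hδs] at hlt'
  have hlt : #(As \ A) < #H := by exact_mod_cast hlt'
  have hst : As + H = As := by rw [hAs]; exact rseq_add hH r a m
  have hmeet := meets_of_card_sdiff_lt hH hH Subset.rfl hst hlt
  have hAH : A + H = As := by rw [add_eq_add_of_meets hH hA hmeet, hst]
  refine ⟨⟨⟨a, m, by omega, by rw [hAH, hAs]⟩, by rw [hAH]; exact hlt⟩, ?_⟩
  obtain ⟨t, ht, htH, hmin⟩ := exists_minimal_nsmul_mem hH r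
  have hlt2 : m + n - 1 < t := lt_of_rseq_ne_univ hH hgen ht htH (hsum ▸ hABne)
  have huniv := card_univ_eq_of_minimal hH hgen ht htH hmin
  have h1 := card_le_card hA
  have h2 : 2 * #H ≤ (t - m) * #H := Nat.mul_le_mul_right _ (by omega)
  rw [Nat.sub_mul] at h2
  rw [card_compl, huniv]
  omega

/-- **Lemma 7.6, impure-chord case, first member.**  "Next suppose that `(A*,B*,C*)` is an impure
chord relative to `H ≤ G`.  In this case, there exists a subgroup `K < H` so that
`K = stab(A*) = stab(B*) = stab(C*)`.  Now since `(A,B,C)` is critical, it follows that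
`|A* ∖ A| < |K|`.  Since `A*` is a proper fringed `R`-sequence … we again find that `A` is a proper
near `R`-sequence."  (Normal position, `(A*,B*,C*)` maximal; `K = stab A*` has `δ(A*,B*,C*) = |K|`
by Thm 3.5, `K ≤ stab(A* + H) = H` by `addStab_rseq`, and every `H`-coset of `A* + H = H ∪ A*`
carries `≥ |K| > |A* ∖ A|` points of `A*`.) [cite: BoothbyDevosMontejano2013, Lemma 7.6] -/
theorem IsImpureChordAt.isNearSeq_of_subtrio (hH : IsSubgroupCarrier H)
    (h : IsImpureChordAt H r As Bs Cs) (hmax : IsMaximalTrio As Bs Cs) (hA : A ⊆ As)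
    (hB : B ⊆ Bs) (hC : C ⊆ Cs) (hδ : 0 < trioDeficiency A B C) :
    IsNearSeq H r A ∧ 2 * #H ≤ #Aᶜ := by
  obtain ⟨t, ht, htH, hmin⟩ := exists_minimal_nsmul_mem hH r
  obtain ⟨hgen, ⟨m, hm, hHA⟩, ⟨n, hn, hHB⟩, -, -, hA0, hB0, -⟩ := id h
  have hAsne : As.Nonempty := hA0.mono inter_subset_left
  have hBsne : Bs.Nonempty := hB0.mono inter_subset_left
  have hδs : 0 < trioDeficiency As Bs Cs := lt_of_lt_of_le hδ (trioDeficiency_mono hA hB hC)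
  set K := As.addStab with hKdef
  have hK : IsSubgroupCarrier K := IsSubgroupCarrier.of_addStab hAsne
  have hδK : trioDeficiency As Bs Cs = #K := hmax.trioDeficiency_eq_card_addStab' hAsne hBsne hδs
  have hst : As + K = As := add_addStab As
  have hlt' := card_sdiff_lt_trioDeficiency hA hB hC hδ
  rw [hδK] at hlt'
  have hlt : #(As \ A) < #K := by exact_mod_cast hlt'
  have hle := h.add_le_period hH hHA hHB hm hn ht htH hmin
  have hAsH : As + H = H ∪ As := add_eq_union_of_union_eq_rseq hH hHA hA0
  have hne : rseq H r 0 m ≠ univ := rseq_ne_univ_of_lt hH hgen ht htH hmin 0 (by omega)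
  have hKH : K ⊆ H := by
    intro k hk
    have hk' : k +ᵥ As = As := (mem_addStab hAsne).1 hk
    have : k ∈ (As + H).addStab := by
      rw [mem_addStab (hAsne.add hH.nonempty), ← vadd_add_assoc, hk']
    rwa [hAsH, hHA, addStab_rseq hH hgen (by omega) hne] at this
  have hmeet := meets_of_card_sdiff_lt hH hK hKH hst hlt
  have hAH : A + H = H ∪ As := by rw [add_eq_add_of_meets hH hA hmeet, hAsH]
  obtain ⟨a₀, ha₀⟩ := hA0
  rw [mem_inter] at ha₀
  have hKc : #K ≤ #(As ∩ H) := by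
    have := card_le_card_inter_coset hH hK hKH hst (x := 0) ha₀.1 (by rw [zero_vadd]; exact ha₀.2)
    rwa [zero_vadd] at this
  have hsub : A ⊆ H ∪ As := hA.trans subset_union_right
  have e1 := card_sdiff_add_card_eq_card hsub
  have e2 := card_union_add_card_inter H As
  have e3 := card_sdiff_add_card_eq_card hA
  rw [inter_comm] at e2
  refine ⟨⟨⟨0, m, by omega, by rw [hAH, hHA]⟩, ?_⟩, ?_⟩
  · rw [hAH]; omega
  · have huniv := card_univ_eq_of_minimal hH hgen ht htH hmin
    have hHAs : #(H ∪ As) = m * #H := by rw [hHA]; exact card_rseq hH hmin 0 (by omega)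
    have h1 : #A ≤ #(H ∪ As) := card_le_card hsub
    have h2 : 2 * #H ≤ (t - m) * #H := Nat.mul_le_mul_right _ (by omega)
    rw [Nat.sub_mul] at h2
    rw [card_compl, huniv]
    omega

/-- **Lemma 7.6 (pure chord), all three members** — "every finite set among `(A,B,C)` must be a
near sequence" (§7, introduction): for a critical subtrio `(A,B,C)` of a pure chord `(A*,B*,C*)`
in normal position, each of `A`, `B`, `C` is a proper near `R`-sequence (via `swap`/`rotate`).
[cite: BoothbyDevosMontejano2013, Lemma 7.6] -/
theorem IsPureChordAt.isNearSeq_of_subtrio₃ (hH : IsSubgroupCarrier H)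
    (h : IsPureChordAt H r As Bs Cs) (hA : A ⊆ As) (hB : B ⊆ Bs) (hC : C ⊆ Cs)
    (hδ : 0 < trioDeficiency A B C) :
    (IsNearSeq H r A ∧ 2 * #H ≤ #Aᶜ) ∧ (IsNearSeq H r B ∧ 2 * #H ≤ #Bᶜ) ∧
      (IsNearSeq H r C ∧ 2 * #H ≤ #Cᶜ) :=
  ⟨h.isNearSeq_of_subtrio hH hA hB hC hδ,
    h.swap.isNearSeq_of_subtrio hH hB hA hC (by rwa [trioDeficiency_swap]),
    ((h.rotate hH).rotate hH).isNearSeq_of_subtrio hH hC hA hB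
      (by rw [trioDeficiency_rotate, trioDeficiency_rotate]; exact hδ)⟩

/-- **Lemma 7.6 (impure chord), all three members**: for a critical subtrio `(A,B,C)` of a MAXIMAL
impure chord `(A*,B*,C*)` in normal position, each of `A`, `B`, `C` is a proper near `R`-sequence.
[cite: BoothbyDevosMontejano2013, Lemma 7.6] -/
theorem IsImpureChordAt.isNearSeq_of_subtrio₃ (hH : IsSubgroupCarrier H)
    (h : IsImpureChordAt H r As Bs Cs) (hmax : IsMaximalTrio As Bs Cs) (hA : A ⊆ As)
    (hB : B ⊆ Bs) (hC : C ⊆ Cs) (hδ : 0 < trioDeficiency A B C) :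
    (IsNearSeq H r A ∧ 2 * #H ≤ #Aᶜ) ∧ (IsNearSeq H r B ∧ 2 * #H ≤ #Bᶜ) ∧
      (IsNearSeq H r C ∧ 2 * #H ≤ #Cᶜ) :=
  ⟨h.isNearSeq_of_subtrio hH hmax hA hB hC hδ,
    h.swap.isNearSeq_of_subtrio hH hmax.swap hB hA hC (by rwa [trioDeficiency_swap]),
    ((h.rotate hH hmax).rotate hH hmax.rotate).isNearSeq_of_subtrio hH hmax.rotate.rotate hC hA hB
      (by rw [trioDeficiency_rotate, trioDeficiency_rotate]; exact hδ)⟩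

/-- Transport of the conclusion of Lemma 7.6 along SIMILARITY: if every critical subtrio of `T` has
its three members proper near `R`-sequences, the same holds for every trio similar to `T`
(permutations permute the members; a translate of a near sequence is a near sequence).
[cite: BoothbyDevosMontejano2013, §4; Lemma 7.6] -/
theorem Similar.forall_subtrio_isNearSeq {T U : Finset G × Finset G × Finset G} (hTU : Similar T U)
    (hT : ∀ A B C : Finset G, A ⊆ T.1 → B ⊆ T.2.1 → C ⊆ T.2.2 → 0 < trioDeficiency A B C →
      (IsNearSeq H r A ∧ 2 * #H ≤ #Aᶜ) ∧ (IsNearSeq H r B ∧ 2 * #H ≤ #Bᶜ) ∧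
        (IsNearSeq H r C ∧ 2 * #H ≤ #Cᶜ)) :
    ∀ A B C : Finset G, A ⊆ U.1 → B ⊆ U.2.1 → C ⊆ U.2.2 → 0 < trioDeficiency A B C →
      (IsNearSeq H r A ∧ 2 * #H ≤ #Aᶜ) ∧ (IsNearSeq H r B ∧ 2 * #H ≤ #Bᶜ) ∧
        (IsNearSeq H r C ∧ 2 * #H ≤ #Cᶜ) := by
  induction hTU with
  | refl => exact hT
  | rotate _ ih =>
    intro A B C hA hB hC hδ
    obtain ⟨h3, h1, h2⟩ := ih C A B hC hA hB
      (by rw [trioDeficiency_rotate, trioDeficiency_rotate]; exact hδ)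
    exact ⟨h1, h2, h3⟩
  | swap _ ih =>
    intro A B C hA hB hC hδ
    obtain ⟨h2, h1, h3⟩ := ih B A C hB hA hC (by rwa [trioDeficiency_swap])
    exact ⟨h1, h2, h3⟩
  | translate g _ ih =>
    intro A B C hA hB hC hδ
    have hA' : -g +ᵥ A ⊆ _ := (vadd_finset_subset_vadd_finset hA).trans (by rw [neg_vadd_vadd])
    have hB' : g +ᵥ B ⊆ _ := (vadd_finset_subset_vadd_finset hB).trans (by rw [vadd_neg_vadd])
    have hδ' : 0 < trioDeficiency (-g +ᵥ A) (g +ᵥ B) C := by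
      have := trioDeficiency_translate A B C (-g) g 0
      rw [zero_vadd] at this
      rwa [this]
    obtain ⟨⟨h1, h1'⟩, ⟨h2, h2'⟩, h3⟩ := ih _ _ C hA' hB' hC hδ'
    refine ⟨⟨?_, ?_⟩, ⟨?_, ?_⟩, h3⟩
    · have := h1.vadd g; rwa [vadd_neg_vadd] at this
    · rwa [card_compl, card_vadd_finset, ← card_compl] at h1'
    · have := h2.vadd (-g); rwa [neg_vadd_vadd] at this
    · rwa [card_compl, card_vadd_finset, ← card_compl] at h2'

/-- **Lemma 7.6 (pure chord)** as printed, the chord given up to similarity: "Let `(A,B,C)` be a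
critical trio of which `(A*,B*,C*)` is a maximal critical supertrio.  If `(A*,B*,C*)` is a pure
… chord, and `A` is finite, then `A` is a proper near sequence" — for the generator `R = r + H` of
the chord, and likewise for `B` and `C`. [cite: BoothbyDevosMontejano2013, Lemma 7.6] -/
theorem isNearSeq_of_subtrio_of_isPureChord (hH : IsSubgroupCarrier H)
    (hstar : IsPureChord H (As, Bs, Cs)) (hA : A ⊆ As) (hB : B ⊆ Bs) (hC : C ⊆ Cs)
    (hδ : 0 < trioDeficiency A B C) :
    ∃ r : G, IsCyclicQuotGen H r ∧ (IsNearSeq H r A ∧ 2 * #H ≤ #Aᶜ) ∧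
      (IsNearSeq H r B ∧ 2 * #H ≤ #Bᶜ) ∧ (IsNearSeq H r C ∧ 2 * #H ≤ #Cᶜ) := by
  obtain ⟨r, A₀, B₀, C₀, h₀, hsim⟩ := hstar
  exact ⟨r, h₀.1, hsim.forall_subtrio_isNearSeq
    (fun A B C hA hB hC hδ => h₀.isNearSeq_of_subtrio₃ hH hA hB hC hδ) A B C hA hB hC hδ⟩

/-- **Lemma 7.6 (impure chord)** as printed, the chord given up to similarity (and maximal, as in
the lemma's hypothesis "maximal critical supertrio"): each member of a critical subtrio is a
proper near `R`-sequence for the chord's generator `R = r + H`.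
[cite: BoothbyDevosMontejano2013, Lemma 7.6] -/
theorem isNearSeq_of_subtrio_of_isImpureChord (hH : IsSubgroupCarrier H)
    (hstar : IsImpureChord H (As, Bs, Cs)) (hmax : IsMaximalTrio As Bs Cs) (hA : A ⊆ As)
    (hB : B ⊆ Bs) (hC : C ⊆ Cs) (hδ : 0 < trioDeficiency A B C) :
    ∃ r : G, IsCyclicQuotGen H r ∧ (IsNearSeq H r A ∧ 2 * #H ≤ #Aᶜ) ∧
      (IsNearSeq H r B ∧ 2 * #H ≤ #Bᶜ) ∧ (IsNearSeq H r C ∧ 2 * #H ≤ #Cᶜ) := by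
  obtain ⟨r, A₀, B₀, C₀, h₀, hsim⟩ := hstar
  have hmax₀ : IsMaximalTrio A₀ B₀ C₀ := hsim.isMaximalTrio_iff.2 hmax
  exact ⟨r, h₀.1, hsim.forall_subtrio_isNearSeq
    (fun A B C hA hB hC hδ => h₀.isNearSeq_of_subtrio₃ hH hmax₀ hA hB hC hδ) A B C hA hB hC hδ⟩

end NearOfChord

/-! ## Lemma 7.3, Claim 1: a critical partner of a near sequence meets every coset of its hull -/

section Claim1

variable [Fintype G] {H A B : Finset G} {r : G} {ℓ m t : ℕ}

/-- PURIFICATION TO THE HULL: if `(A,H)` is critical then `δ(A, B + H) ≥ δ(A,B)`, i.e.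
`|B| + |A + (B + H)| ≤ |A + B| + |B + H|` ("it follows from repeatedly applying our purification
lemma to `H`-cosets `R ∈ G/H` for which `∅ ≠ R ∩ B ≠ R` that `(A, B + H)` is critical").
[cite: BoothbyDevosMontejano2013, Lemma 7.3 (proof, Claim 1)] -/
theorem card_add_add_hull_le (hA : A.Nonempty) (hH : IsSubgroupCarrier H)
    (hcritH : #(A + H) < #A + #H) (B : Finset G) :
    #B + #(A + (B + H)) ≤ #(A + B) + #(B + H) := by
  -- strong induction on the number of holes `|(B + H) ∖ B|`
  suffices h : ∀ n : ℕ, ∀ B : Finset G, #((B + H) \ B) = n →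
      #B + #(A + (B + H)) ≤ #(A + B) + #(B + H) from h _ B rfl
  intro n
  induction n using Nat.strong_induction_on with
  | _ n ih =>
    intro B hn
    rcases ((B + H) \ B).eq_empty_or_nonempty with h0 | ⟨x, hx⟩
    · have hBH : B + H = B :=
        Subset.antisymm (fun y hy => by
          by_contra hyB
          have : y ∈ (B + H) \ B := mem_sdiff.2 ⟨hy, hyB⟩
          rw [h0] at this; simp at this) (hH.subset_add B)
      rw [hBH]; omega
    · rw [mem_sdiff] at hx
      obtain ⟨b, hb, h, hh, rfl⟩ := mem_add.1 hx.1
      have hRB : (B ∩ (b +ᵥ H)).Nonempty := ⟨b, mem_inter.2 ⟨hb, hH.mem_coset_self b⟩⟩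
      have hpur := card_add_union_coset_le hA hH hcritH b hRB
      have hRsub : b +ᵥ H ⊆ B + H := by
        intro y hy
        rw [hH.mem_coset_iff] at hy
        exact mem_add.2 ⟨b, hb, y - b, hy, by abel⟩
      have hB'H : (B ∪ (b +ᵥ H)) + H = B + H := by
        rw [union_add, hH.coset_add]
        exact union_eq_left.2 hRsub
      have hxR : b + h ∈ b +ᵥ H := by
        rw [hH.mem_coset_iff, add_sub_cancel_left]; exact hh
      have hlt : #(((B ∪ (b +ᵥ H)) + H) \ (B ∪ (b +ᵥ H))) < n := by
        rw [hB'H, ← hn]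
        refine card_lt_card ⟨fun y hy => ?_, fun hsub => ?_⟩
        · rw [mem_sdiff] at hy ⊢
          exact ⟨hy.1, fun hyB => hy.2 (mem_union_left _ hyB)⟩
        · have := hsub (mem_sdiff.2 hx)
          rw [mem_sdiff] at this
          exact this.2 (mem_union_right _ hxR)
      have hih := ih _ hlt (B ∪ (b +ᵥ H)) rfl
      rw [hB'H] at hih
      omega

omit [Fintype G] in
/-- The hull `B + H` of a set `B` inside the basic sequence `rseq H r 0 (m+1)` is the union of the
cosets `j•r + H`, `j ≤ m`, met by `B`. [cite: BoothbyDevosMontejano2013, Lemma 7.3 (proof, Claim 1)] -/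
theorem add_eq_biUnion_filter (hH : IsSubgroupCarrier H) (hB : B ⊆ rseq H r 0 (m + 1)) :
    B + H = ((range (m + 1)).filter fun j => (B ∩ ((j • r) +ᵥ H)).Nonempty).biUnion
      fun j => (j • r) +ᵥ H := by
  ext x
  rw [mem_biUnion]
  constructor
  · intro hx
    obtain ⟨b, hb, h, hh, rfl⟩ := mem_add.1 hx
    have hb' := hB hb
    rw [mem_rseq] at hb'
    obtain ⟨j, hj, hbj⟩ := hb'
    rw [zero_add] at hbj
    refine ⟨j, mem_filter.2 ⟨mem_range.2 hj, b, mem_inter.2 ⟨hb, hbj⟩⟩, ?_⟩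
    rw [hH.mem_coset_iff] at hbj ⊢
    have e : b + h - j • r = (b - j • r) + h := by abel
    rw [e]; exact hH.add_mem hbj hh
  · rintro ⟨j, hj, hxj⟩
    rw [mem_filter] at hj
    obtain ⟨b, hb⟩ := hj.2
    rw [mem_inter] at hb
    rw [hH.mem_coset_iff] at hxj
    have hb2 := (hH.mem_coset_iff).1 hb.2
    refine mem_add.2 ⟨b, hb.1, x - b, ?_, by abel⟩
    have e : x - b = (x - j • r) - (b - j • r) := by abel
    rw [e]; exact hH.sub_mem hxj hb2

omit [Fintype G] in
/-- A union of cosets with distinct indices below the period has `|J|·|H|` elements.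
[cite: BoothbyDevosMontejano2013, §4] -/
theorem card_biUnion_coset (hH : IsSubgroupCarrier H) (hmin : ∀ s : ℕ, 0 < s → s < t → s • r ∉ H)
    {J : Finset ℕ} (hJ : ∀ j ∈ J, j < t) :
    #(J.biUnion fun j => (j • r) +ᵥ H) = #J * #H := by
  rw [card_biUnion]
  · simp [card_vadd_finset, sum_const, smul_eq_mul]
  · intro i hi j hj hij
    rcases Nat.lt_or_gt_of_ne hij with hlt | hlt
    · have := disjoint_coset_of_lt hH hmin 0 hlt (hJ j hj)
      rwa [zero_add, zero_add] at this
    · have := disjoint_coset_of_lt hH hmin 0 hlt (hJ i hi)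
      rw [zero_add, zero_add] at this
      exact this.symm

omit [Fintype G] in
/-- Sum of two unions of cosets: `(⋃_{i ∈ I} iR) + (⋃_{j ∈ J} jR) = ⋃_{s ∈ I + J} sR`.
[cite: BoothbyDevosMontejano2013, Lemma 7.3 (proof, Claim 1)] -/
theorem biUnion_coset_add_biUnion_coset (hH : IsSubgroupCarrier H) (I J : Finset ℕ) :
    (I.biUnion fun i => (i • r) +ᵥ H) + (J.biUnion fun j => (j • r) +ᵥ H) =
      (I + J).biUnion fun s => (s • r) +ᵥ H := by
  ext x
  simp only [mem_add, mem_biUnion]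
  constructor
  · rintro ⟨y, ⟨i, hi, hy⟩, z, ⟨j, hj, hz⟩, rfl⟩
    refine ⟨i + j, ⟨i, hi, j, hj, rfl⟩, ?_⟩
    rw [hH.mem_coset_iff] at hy hz ⊢
    have e : y + z - (i + j) • r = (y - i • r) + (z - j • r) := by rw [add_nsmul]; abel
    rw [e]; exact hH.add_mem hy hz
  · rintro ⟨s, ⟨i, hi, j, hj, rfl⟩, hx⟩
    refine ⟨i • r, ⟨i, hi, hH.mem_coset_self _⟩, x - i • r, ⟨j, hj, ?_⟩, by abel⟩
    rw [hH.mem_coset_iff] at hx ⊢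
    have e : x - i • r - j • r = x - (i + j) • r := by rw [add_nsmul]; abel
    rw [e]; exact hx

/-- The integer-interval step ("It follows, e.g. from Lemma 1.3 of Nathanson, that `B̃` is the
interval `{0, 1, …, m}`"): if `J ⊆ [0, m]` contains `0` and `m` and
`|[0, ℓ] + J| < (ℓ + 1) + |J|` with `ℓ ≥ 1`, then `J = [0, m]`.  (Direct count instead of the
structure theorem: `J`, `m + [1, ℓ]` and one point `j₁ + 1 ∉ J` are disjoint inside `[0,ℓ] + J`.)
[cite: BoothbyDevosMontejano2013, Lemma 7.3 (proof, Claim 1)] -/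
theorem eq_range_of_card_range_add_lt {J : Finset ℕ} (hℓ : 1 ≤ ℓ) (hJ : J ⊆ range (m + 1))
    (h0 : 0 ∈ J) (hm : m ∈ J) (hlt : #(range (ℓ + 1) + J) < ℓ + 1 + #J) : J = range (m + 1) := by
  by_contra hne
  -- a point `j₁ ∈ J` with `j₁ + 1 ≤ m`, `j₁ + 1 ∉ J`
  obtain ⟨j₀, hj₀m, hj₀J⟩ : ∃ j₀, j₀ < m + 1 ∧ j₀ ∉ J := by
    by_contra hall
    push Not at hall
    exact hne (Subset.antisymm hJ fun j hj => hall j (mem_range.1 hj))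
  set J' := J.filter (fun j => j < j₀) with hJ'def
  have hJ'ne : J'.Nonempty := ⟨0, mem_filter.2 ⟨h0, Nat.pos_of_ne_zero (by rintro rfl; exact hj₀J h0)⟩⟩
  set j₁ := J'.max' hJ'ne with hj₁def
  have hj₁J' : j₁ ∈ J' := max'_mem _ _
  rw [mem_filter] at hj₁J'
  have hj₁1J : j₁ + 1 ∉ J := by
    intro hmem
    rcases Nat.lt_or_ge (j₁ + 1) j₀ with hlt1 | hge
    · have : j₁ + 1 ≤ j₁ := le_max' _ _ (mem_filter.2 ⟨hmem, hlt1⟩)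
      omega
    · have : j₁ + 1 = j₀ := by omega
      rw [this] at hmem; exact hj₀J hmem
  have hj₁m : j₁ + 1 ≤ m := by
    have : j₀ ≤ m := by omega
    omega
  -- three disjoint pieces of `range (ℓ+1) + J`
  set I := range (ℓ + 1) with hIdef
  set K := (range ℓ).image (fun i => m + 1 + i) with hKdef
  have hJsub : J ⊆ I + J := fun j hj => mem_add.2 ⟨0, mem_range.2 (by omega), j, hj, zero_add j⟩
  have hKsub : K ⊆ I + J := by
    intro x hx
    rw [hKdef, mem_image] at hx
    obtain ⟨i, hi, rfl⟩ := hx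
    rw [mem_range] at hi
    exact mem_add.2 ⟨i + 1, mem_range.2 (by omega), m, hm, by omega⟩
  have hpt : j₁ + 1 ∈ I + J := mem_add.2 ⟨1, mem_range.2 (by omega), j₁, hj₁J'.1, by omega⟩
  have hKcard : #K = ℓ := by
    rw [hKdef, card_image_of_injective _ (fun a b hab => by simpa using hab), card_range]
  have hJK : Disjoint J K := by
    rw [disjoint_left]
    intro x hxJ hxK
    have h1 := mem_range.1 (hJ hxJ)
    rw [hKdef, mem_image] at hxK
    obtain ⟨i, -, rfl⟩ := hxK
    omega
  have hptJK : j₁ + 1 ∉ J ∪ K := by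
    rw [mem_union, not_or]
    refine ⟨hj₁1J, fun hK => ?_⟩
    rw [hKdef, mem_image] at hK
    obtain ⟨i, -, hi⟩ := hK
    omega
  have hsub : insert (j₁ + 1) (J ∪ K) ⊆ I + J :=
    insert_subset hpt (union_subset hJsub hKsub)
  have := card_le_card hsub
  rw [card_insert_of_notMem hptJK, card_union_of_disjoint hJK, hKcard] at this
  omega

/-- **Lemma 7.3, Claim 1** (normal position).  "`B_i ≠ ∅` for `0 ≤ i ≤ m`": let `(A,B)` be a
critical pair, `A + H = H ∪ R ∪ … ∪ ℓR` the hull of the near `R`-sequence `A` (`|(A + H) ∖ A| < |H|`,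
`ℓ ≥ 1`), `B ⊆ B* = H ∪ R ∪ … ∪ mR` with `B ∩ H ≠ ∅ ≠ B ∩ mR`, the cosets `0, …, ℓ + m` distinct
(`ℓ + m < t`, which `A + B* ≠ G` gives); then `B` meets every coset `iR`, `i ≤ m`.  Proof as printed:
purification gives `(A, B + H)` hence `(A + H, B + H)` critical; with `Ã = [0, ℓ]` and
`B̃ = {i : iR ∩ B ≠ ∅}` this reads `|Ã + B̃| < |Ã| + |B̃|`, forcing `B̃ = [0, m]`.
[cite: BoothbyDevosMontejano2013, Lemma 7.3 (proof, Claim 1)] -/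
theorem forall_inter_coset_nonempty_of_critical (hH : IsSubgroupCarrier H)
    (hmin : ∀ s : ℕ, 0 < s → s < t → s • r ∉ H) (hAH : A + H = rseq H r 0 (ℓ + 1))
    (hnear : #((A + H) \ A) < #H) (hℓ : 1 ≤ ℓ) (hB : B ⊆ rseq H r 0 (m + 1))
    (hB0 : (B ∩ H).Nonempty) (hBm : (B ∩ ((m • r) +ᵥ H)).Nonempty) (hlmt : ℓ + m < t)
    (hcrit : #(A + B) < #A + #B) : ∀ i ≤ m, (B ∩ ((i • r) +ᵥ H)).Nonempty := by
  have hHpos := hH.nonempty.card_pos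
  have hA : A.Nonempty := by
    rw [nonempty_iff_ne_empty]; rintro rfl
    rw [empty_add] at hAH
    exact (rseq_nonempty hH r 0 (by omega : 1 ≤ ℓ + 1)).ne_empty hAH.symm
  -- `(A, H)` critical
  have hcritH : #(A + H) < #A + #H := by
    have := card_sdiff_add_card_eq_card (hH.subset_add A); omega
  -- `(A, B + H)` critical, hence `(A + H, B + H)` critical
  have hpur := card_add_add_hull_le hA hH hcritH B
  have hsum : (A + H) + (B + H) = A + (B + H) := by
    rw [add_add_add_comm, hH.add_self, add_assoc]
  -- sorry-free bookkeeping with the index sets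
  set J := (range (m + 1)).filter fun j => (B ∩ ((j • r) +ᵥ H)).Nonempty with hJdef
  have hJt : ∀ j ∈ J, j < t := fun j hj => by
    have := mem_range.1 (mem_filter.1 hj).1; omega
  have hBH : B + H = J.biUnion fun j => (j • r) +ᵥ H := add_eq_biUnion_filter hH hB
  have hcardBH : #(B + H) = #J * #H := by rw [hBH]; exact card_biUnion_coset hH hmin hJt
  have hAH' : A + H = (range (ℓ + 1)).biUnion fun i => (i • r) +ᵥ H := by
    rw [hAH, rseq]; simp only [zero_add]
  have hcardAH : #(A + H) = (ℓ + 1) * #H := by rw [hAH]; exact card_rseq hH hmin 0 (by omega)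
  have hIJt : ∀ s ∈ range (ℓ + 1) + J, s < t := by
    intro s hs
    obtain ⟨i, hi, j, hj, rfl⟩ := mem_add.1 hs
    have := mem_range.1 hi
    have := mem_range.1 (mem_filter.1 hj).1
    omega
  have hcardsum : #(A + (B + H)) = #(range (ℓ + 1) + J) * #H := by
    rw [← hsum, hAH', hBH, biUnion_coset_add_biUnion_coset hH]
    exact card_biUnion_coset hH hmin hIJt
  have hAle : #A ≤ (ℓ + 1) * #H := by
    rw [← hcardAH]; exact card_le_card (hH.subset_add A)
  -- `|Ã + B̃| < |Ã| + |B̃|`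
  have hlt : #(range (ℓ + 1) + J) < ℓ + 1 + #J := by
    have h1 : #(range (ℓ + 1) + J) * #H < (ℓ + 1 + #J) * #H := by
      rw [add_mul]; rw [← hcardsum, ← hcardBH]; omega
    exact Nat.lt_of_mul_lt_mul_right h1
  have h0 : 0 ∈ J := mem_filter.2 ⟨mem_range.2 (by omega), by rwa [zero_nsmul, zero_vadd]⟩
  have hm : m ∈ J := mem_filter.2 ⟨mem_range.2 (by omega), hBm⟩
  have hJsub : J ⊆ range (m + 1) := fun j hj => (mem_filter.1 hj).1
  have hJeq : J = range (m + 1) := eq_range_of_card_range_add_lt hℓ hJsub h0 hm hlt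
  intro i hi
  have : i ∈ J := by rw [hJeq]; exact mem_range.2 (by omega)
  exact (mem_filter.1 this).2

end Claim1

/-! ## Lemma 7.3, Claim 2: if the middle cosets are full, `A + B` is fringed -/

section Claim2

variable {H K A B X S : Finset G} {r x : G} {i j L ℓ m t : ℕ}

/-- A set inside a basic sequence of `L + 1` cosets has at most `(L − 1)|H|` points outside two given
cosets `iR ≠ jR`: `|X| + 2|H| ≤ |X ∩ iR| + |X ∩ jR| + (L + 1)|H|`. [cite: BoothbyDevosMontejano2013, Lemma 7.3 (proof)] -/
theorem card_add_two_mul_le_of_subset_rseq (hH : IsSubgroupCarrier H)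
    (hmin : ∀ s : ℕ, 0 < s → s < t → s • r ∉ H) (hX : X ⊆ rseq H r 0 (L + 1)) (hij : i < j)
    (hj : j ≤ L) (hLt : L < t) :
    #X + 2 * #H ≤ #(X ∩ ((i • r) +ᵥ H)) + #(X ∩ ((j • r) +ᵥ H)) + (L + 1) * #H := by
  have hci : (i • r) +ᵥ H ⊆ rseq H r 0 (L + 1) :=
    coset_subset_rseq H r 0 (i := i) (by omega) |>.trans' (by rw [zero_add])
  have hcj : (j • r) +ᵥ H ⊆ rseq H r 0 (L + 1) :=
    coset_subset_rseq H r 0 (i := j) (by omega) |>.trans' (by rw [zero_add])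
  have hdis : Disjoint ((i • r) +ᵥ H) ((j • r) +ᵥ H) := by
    have := disjoint_coset_of_lt hH hmin 0 hij (by omega)
    rwa [zero_add, zero_add] at this
  have hU : #(((i • r) +ᵥ H) ∪ ((j • r) +ᵥ H)) = 2 * #H := by
    rw [card_union_of_disjoint hdis, card_vadd_finset, card_vadd_finset]; ring
  have hR : #(rseq H r 0 (L + 1)) = (L + 1) * #H := card_rseq hH hmin 0 (by omega)
  have hrest : #(rseq H r 0 (L + 1) \ (((i • r) +ᵥ H) ∪ ((j • r) +ᵥ H))) + 2 * #H =
      (L + 1) * #H := by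
    rw [← hU, ← hR]; exact card_sdiff_add_card_eq_card (union_subset hci hcj)
  have hsub : X ⊆ (X ∩ ((i • r) +ᵥ H)) ∪ (X ∩ ((j • r) +ᵥ H)) ∪
      (rseq H r 0 (L + 1) \ (((i • r) +ᵥ H) ∪ ((j • r) +ᵥ H))) := by
    intro y hy
    by_cases h1 : y ∈ (i • r) +ᵥ H
    · exact mem_union_left _ (mem_union_left _ (mem_inter.2 ⟨hy, h1⟩))
    by_cases h2 : y ∈ (j • r) +ᵥ H
    · exact mem_union_left _ (mem_union_right _ (mem_inter.2 ⟨hy, h2⟩))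
    · exact mem_union_right _ (mem_sdiff.2 ⟨hX hy, by rw [mem_union, not_or]; exact ⟨h1, h2⟩⟩)
  have := (card_le_card hsub).trans ((card_union_le _ _).trans
    (Nat.add_le_add_right (card_union_le _ _) _))
  omega

/-- The stabilizer of a nonempty subset of one `H`-coset lies in `H`. [cite: BoothbyDevosMontejano2013, Lemma 7.3 (proof, Claim 2)] -/
theorem addStab_subset_of_subset_coset (hH : IsSubgroupCarrier H) (hS : S ⊆ x +ᵥ H)
    (hSne : S.Nonempty) : S.addStab ⊆ H := by
  intro k hk
  obtain ⟨s, hs⟩ := id hSne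
  have hks : k + s ∈ S := by
    rw [← (mem_addStab hSne).1 hk]; exact vadd_mem_vadd_finset hs
  have h1 := (hH.mem_coset_iff).1 (hS hks)
  have h2 := (hH.mem_coset_iff).1 (hS hs)
  have e : k = (k + s - x) - (s - x) := by abel
  rw [e]; exact hH.sub_mem h1 h2

/-- A proper subgroup carrier has index at least two: `2|K| ≤ |H|`. [cite: BoothbyDevosMontejano2013, Lemma 7.3 (proof, Claim 2)] -/
theorem two_mul_card_le_of_ssubset {K : Finset G} (hK : IsSubgroupCarrier K)
    (hH : IsSubgroupCarrier H) (hKH : K ⊆ H) (hne : K ≠ H) : 2 * #K ≤ #H := by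
  obtain ⟨c, hc⟩ := hK.card_dvd_of_subset hH hKH
  have hKpos := hK.nonempty.card_pos
  have hHpos := hH.nonempty.card_pos
  rcases Nat.lt_or_ge c 2 with hlt | hge
  · exfalso
    interval_cases c
    · rw [hc, mul_zero] at hHpos; exact lt_irrefl 0 hHpos
    · exact hne (eq_of_subset_of_card_le hKH (by rw [hc, mul_one]))
  · rw [hc]; calc 2 * #K = #K * 2 := mul_comm _ _
      _ ≤ #K * c := Nat.mul_le_mul_left _ hge

/-- Each coset of the hull of `A` meets `A`: `A + H = H ∪ … ∪ L R ⇒ A ∩ iR ≠ ∅` (`i ≤ L`).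
[cite: BoothbyDevosMontejano2013, Lemma 7.3 (proof)] -/
theorem inter_coset_nonempty_of_add_eq (hH : IsSubgroupCarrier H)
    (hAH : A + H = rseq H r 0 (L + 1)) (hi : i ≤ L) : (A ∩ ((i • r) +ᵥ H)).Nonempty := by
  have : i • r ∈ A + H := by
    rw [hAH]; exact coset_subset_rseq H r 0 (by omega : i < L + 1) (by rw [zero_add]; exact hH.mem_coset_self _)
  obtain ⟨a, ha, h, hh, hah⟩ := mem_add.1 this
  refine ⟨a, mem_inter.2 ⟨ha, ?_⟩⟩
  rw [hH.mem_coset_iff]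
  have e : a - i • r = -h := by rw [← hah]; abel
  rw [e]; exact hH.neg_mem hh

/-- A set whose hull is `H ∪ R ∪ … ∪ LR` and which contains the cosets `R, …, LR` is a fringed
`R`-sequence (`A ∖ S` is `H`-stable for the head `S = H`). [cite: BoothbyDevosMontejano2013, Def 7.2] -/
theorem isFringedSeq_of_tail_full (hH : IsSubgroupCarrier H)
    (hmin : ∀ s : ℕ, 0 < s → s < t → s • r ∉ H) (hSH : S + H = rseq H r 0 (L + 1)) (hLt : L < t)
    (hfull : ∀ s : ℕ, 1 ≤ s → s ≤ L → (s • r) +ᵥ H ⊆ S) : IsFringedSeq H r S := by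
  refine ⟨0, L + 1, by omega, hSH, Or.inl ?_⟩
  rw [zero_vadd]
  refine Subset.antisymm ?_ (hH.subset_add _)
  intro y hy
  obtain ⟨x, hx, h, hh, rfl⟩ := mem_add.1 hy
  rw [mem_sdiff] at hx ⊢
  have hx' : x ∈ rseq H r 0 (L + 1) := by rw [← hSH]; exact hH.subset_add S hx.1
  rw [mem_rseq] at hx'
  obtain ⟨s, hs, hxs⟩ := hx'
  rw [zero_add] at hxs
  have hs0 : 0 < s := index_pos_of_not_mem hH hxs hx.2
  have hxh : x + h ∈ (s • r) +ᵥ H := by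
    rw [hH.mem_coset_iff] at hxs ⊢
    have e : x + h - s • r = (x - s • r) + h := by abel
    rw [e]; exact hH.add_mem hxs hh
  exact ⟨hfull s hs0 (by omega) hxh, not_mem_of_mem_coset hH hmin hs0 (by omega) hxh⟩

/-- A set whose hull is `H ∪ R ∪ … ∪ LR` and which contains the cosets `H, R, …, (L−1)R` is a
fringed `R`-sequence (`A ∖ T` is `H`-stable for the tail `T = LR`). [cite: BoothbyDevosMontejano2013, Def 7.2] -/
theorem isFringedSeq_of_head_full (hH : IsSubgroupCarrier H)
    (hmin : ∀ s : ℕ, 0 < s → s < t → s • r ∉ H) (hSH : S + H = rseq H r 0 (L + 1)) (hLt : L < t)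
    (hfull : ∀ s : ℕ, s + 1 ≤ L → (s • r) +ᵥ H ⊆ S) : IsFringedSeq H r S := by
  refine ⟨0, L + 1, by omega, hSH, Or.inr ?_⟩
  rw [Nat.add_sub_cancel, zero_add]
  refine Subset.antisymm ?_ (hH.subset_add _)
  intro y hy
  obtain ⟨x, hx, h, hh, rfl⟩ := mem_add.1 hy
  rw [mem_sdiff] at hx ⊢
  have hx' : x ∈ rseq H r 0 (L + 1) := by rw [← hSH]; exact hH.subset_add S hx.1
  rw [mem_rseq] at hx'
  obtain ⟨s, hs, hxs⟩ := hx'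
  rw [zero_add] at hxs
  have hsL : s ≠ L := by rintro rfl; exact hx.2 hxs
  have hxh : x + h ∈ (s • r) +ᵥ H := by
    rw [hH.mem_coset_iff] at hxs ⊢
    have e : x + h - s • r = (x - s • r) + h := by abel
    rw [e]; exact hH.add_mem hxs hh
  refine ⟨hfull s (by omega) hxh, fun hL => hsL ?_⟩
  exact index_eq_of_mem hH hmin (by omega) hLt hxh hL

/-- **Lemma 7.3, Claim 2** (normal position, in contrapositive form).  "`A + B` does not contain
`⋃_{i=1}^{ℓ+m−1} iR`" when `A + B` is not fringed: i.e. if the middle cosets `R, …, (ℓ+m−1)R` lie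
in `A + B` then `A + B` contains all of `R, …, (ℓ+m)R` or all of `H, …, (ℓ+m−1)R`.  Proof as printed:
otherwise `K₀ = stab(A₀ + B₀)` and `K₁ = stab(A_ℓ + B_m)` are proper subgroups of `H`, and Kneser's
theorem on the two end cosets gives `|A + B| ≥ |A| + |B|`.
[cite: BoothbyDevosMontejano2013, Lemma 7.3 (proof, Claim 2)] -/
theorem head_or_tail_full_of_middle_full (hH : IsSubgroupCarrier H)
    (hmin : ∀ s : ℕ, 0 < s → s < t → s • r ∉ H) (hAH : A + H = rseq H r 0 (ℓ + 1)) (hℓ : 1 ≤ ℓ)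
    (hB : B ⊆ rseq H r 0 (m + 1)) (hB0 : (B ∩ H).Nonempty)
    (hBm : (B ∩ ((m • r) +ᵥ H)).Nonempty) (hm : 1 ≤ m) (hlmt : ℓ + m < t)
    (hcrit : #(A + B) < #A + #B)
    (hmid : ∀ s : ℕ, 1 ≤ s → s + 1 ≤ ℓ + m → (s • r) +ᵥ H ⊆ A + B) :
    (∀ s : ℕ, 1 ≤ s → s ≤ ℓ + m → (s • r) +ᵥ H ⊆ A + B) ∨
      (∀ s : ℕ, s + 1 ≤ ℓ + m → (s • r) +ᵥ H ⊆ A + B) := by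
  by_cases h0 : H ⊆ A + B
  · right
    intro s hs
    rcases Nat.eq_zero_or_pos s with rfl | hpos
    · rwa [zero_nsmul, zero_vadd]
    · exact hmid s hpos hs
  by_cases h1 : ((ℓ + m) • r) +ᵥ H ⊆ A + B
  · left
    intro s hs hsle
    rcases Nat.lt_or_ge s (ℓ + m) with hlt | hge
    · exact hmid s hs hlt
    · have : s = ℓ + m := by omega
      rw [this]; exact h1
  exfalso
  have hHpos := hH.nonempty.card_pos
  have hA : A ⊆ rseq H r 0 (ℓ + 1) := by rw [← hAH]; exact hH.subset_add A
  -- the end pieces `A₀ = A ∩ H`, `B₀ = B ∩ H`, `A₁ = A ∩ ℓR`, `B₁ = B ∩ mR`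
  have hA₀ne : (A ∩ H).Nonempty := by
    have := inter_coset_nonempty_of_add_eq hH hAH (i := 0) (by omega)
    rwa [zero_nsmul, zero_vadd] at this
  have hA₁ne : (A ∩ ((ℓ • r) +ᵥ H)).Nonempty := inter_coset_nonempty_of_add_eq hH hAH le_rfl
  have hP₀ne : (A ∩ H + B ∩ H).Nonempty := hA₀ne.add hB0
  have hP₁ne : (A ∩ ((ℓ • r) +ᵥ H) + B ∩ ((m • r) +ᵥ H)).Nonempty := hA₁ne.add hBm
  -- `K₀ = stab(A₀ + B₀)`, `K₁ = stab(A₁ + B₁)` are proper subgroups of `H`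
  have hK₀c : IsSubgroupCarrier (A ∩ H + B ∩ H).addStab := IsSubgroupCarrier.of_addStab hP₀ne
  have hK₁c : IsSubgroupCarrier (A ∩ ((ℓ • r) +ᵥ H) + B ∩ ((m • r) +ᵥ H)).addStab :=
    IsSubgroupCarrier.of_addStab hP₁ne
  have hP₀H : A ∩ H + B ∩ H ⊆ (0 : G) +ᵥ H := by
    rw [zero_vadd]
    intro y hy
    obtain ⟨a, ha, b, hb, rfl⟩ := mem_add.1 hy
    exact hH.add_mem (mem_inter.1 ha).2 (mem_inter.1 hb).2
  have hP₁H : A ∩ ((ℓ • r) +ᵥ H) + B ∩ ((m • r) +ᵥ H) ⊆ ((ℓ + m) • r) +ᵥ H := by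
    have := hH.add_subset_coset (A := A ∩ ((ℓ • r) +ᵥ H)) (B := B ∩ ((m • r) +ᵥ H))
      (a₀ := ℓ • r) (b := m • r) inter_subset_right inter_subset_right
    rwa [← add_nsmul] at this
  have hK₀H := addStab_subset_of_subset_coset hH hP₀H hP₀ne
  have hK₁H := addStab_subset_of_subset_coset hH hP₁H hP₁ne
  have hK₀ne : (A ∩ H + B ∩ H).addStab ≠ H := by
    intro hKeq
    apply h0
    have hst : A ∩ H + B ∩ H + H = A ∩ H + B ∩ H := by
      nth_rw 3 [← hKeq]; exact add_addStab (A ∩ H + B ∩ H)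
    have := hH.eq_coset_of_stable hst hP₀ne hP₀H
    rw [zero_vadd] at this
    rw [← this]
    exact add_subset_add inter_subset_left inter_subset_left
  have hK₁ne : (A ∩ ((ℓ • r) +ᵥ H) + B ∩ ((m • r) +ᵥ H)).addStab ≠ H := by
    intro hKeq
    apply h1
    have hst : A ∩ ((ℓ • r) +ᵥ H) + B ∩ ((m • r) +ᵥ H) + H =
        A ∩ ((ℓ • r) +ᵥ H) + B ∩ ((m • r) +ᵥ H) := by
      nth_rw 3 [← hKeq]; exact add_addStab _
    rw [← hH.eq_coset_of_stable hst hP₁ne hP₁H]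
    exact add_subset_add inter_subset_left inter_subset_left
  have hK₀2 := two_mul_card_le_of_ssubset hK₀c hH hK₀H hK₀ne
  have hK₁2 := two_mul_card_le_of_ssubset hK₁c hH hK₁H hK₁ne
  -- Kneser on the end cosets
  have hkn₀ := card_add_card_le_card_add_add_card_addStab (A ∩ H) (B ∩ H) hA₀ne hB0
  have hkn₁ := card_add_card_le_card_add_add_card_addStab (A ∩ ((ℓ • r) +ᵥ H))
    (B ∩ ((m • r) +ᵥ H)) hA₁ne hBm
  -- `|A + B| ≥ |A₀ + B₀| + (ℓ + m − 1)|H| + |A₁ + B₁|`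
  have hmidsub : rseq H r r (ℓ + m - 1) ⊆ A + B := by
    intro y hy
    rw [mem_rseq] at hy
    obtain ⟨i, hi, hyi⟩ := hy
    have e : r + i • r = (i + 1) • r := by rw [add_nsmul, one_nsmul, add_comm]
    rw [e] at hyi
    exact hmid (i + 1) (by omega) (by omega) hyi
  have hmidcard : #(rseq H r r (ℓ + m - 1)) = (ℓ + m - 1) * #H := card_rseq hH hmin r (by omega)
  have hd1 : Disjoint (A ∩ H + B ∩ H) (rseq H r r (ℓ + m - 1)) := by
    rw [disjoint_left]; intro y hy hy'
    rw [mem_rseq] at hy'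
    obtain ⟨i, hi, hyi⟩ := hy'
    have e : r + i • r = (i + 1) • r := by rw [add_nsmul, one_nsmul, add_comm]
    rw [e] at hyi
    have := hP₀H hy; rw [zero_vadd] at this
    exact not_mem_of_mem_coset hH hmin (by omega) (by omega) hyi this
  have hd2 : Disjoint (A ∩ H + B ∩ H ∪ rseq H r r (ℓ + m - 1))
      (A ∩ ((ℓ • r) +ᵥ H) + B ∩ ((m • r) +ᵥ H)) := by
    rw [disjoint_left]; intro y hy hy1
    have hy1' := hP₁H hy1
    rcases mem_union.1 hy with hy0 | hy'
    · have := hP₀H hy0; rw [zero_vadd] at this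
      exact not_mem_of_mem_coset hH hmin (by omega) hlmt hy1' this
    · rw [mem_rseq] at hy'
      obtain ⟨i, hi, hyi⟩ := hy'
      have e : r + i • r = (i + 1) • r := by rw [add_nsmul, one_nsmul, add_comm]
      rw [e] at hyi
      have := index_eq_of_mem hH hmin (by omega) hlmt hyi hy1'
      omega
  have hsub : (A ∩ H + B ∩ H ∪ rseq H r r (ℓ + m - 1)) ∪
      (A ∩ ((ℓ • r) +ᵥ H) + B ∩ ((m • r) +ᵥ H)) ⊆ A + B :=
    union_subset (union_subset (add_subset_add inter_subset_left inter_subset_left) hmidsub)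
      (add_subset_add inter_subset_left inter_subset_left)
  have hAB := card_le_card hsub
  rw [card_union_of_disjoint hd2, card_union_of_disjoint hd1, hmidcard] at hAB
  -- `|A| ≤ |A₀| + |A₁| + (ℓ − 1)|H|`, `|B| ≤ |B₀| + |B₁| + (m − 1)|H|`
  have hAc := card_add_two_mul_le_of_subset_rseq hH hmin hA (i := 0) (j := ℓ) (by omega) le_rfl
    (by omega)
  have hBc := card_add_two_mul_le_of_subset_rseq hH hmin hB (i := 0) (j := m) (by omega) le_rfl
    (by omega)
  rw [zero_nsmul, zero_vadd] at hAc hBc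
  have e1 : (ℓ + m - 1) * #H + 3 * #H = (ℓ + 1) * #H + (m + 1) * #H := by
    rw [← add_mul, ← add_mul]; congr 1; omega
  omega

end Claim2

/-! ## Lemma 7.3 -/

section Lemma73

variable [Fintype G] {H A : Finset G} {r : G} {ℓ t : ℕ}

/-- **Lemma 7.3** (normal position, concrete form).  For a critical pair `(A, B)` with `A` a
nontrivial near `R`-sequence (`A + H = H ∪ R ∪ … ∪ ℓR`, `|(A + H) ∖ A| < |H|`, `ℓ ≥ 1`), `B` inside the
`R`-sequence `B* = H ∪ … ∪ mR` meeting its head and tail, not inside one coset (`m ≥ 1`), and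
`A + B* ≠ G` (`ℓ + m + 1 < t`): `A + B` contains all of `R, …, (ℓ+m)R` or all of `H, …, (ℓ+m−1)R` —
i.e. `A + B` is a fringed `R`-sequence (`isFringedSeq_add_of_critical`).  Proof as printed, by
induction on `|B|`: Claim 1 (`forall_inter_coset_nonempty_of_critical`), Claim 2
(`head_or_tail_full_of_middle_full`), Claim 3 (`m = 1`, from the induction hypothesis applied to
`B ∖ B_m` and `B ∖ B₀`), and the final count with the purifications `(A, B ∪ R)`, `(A, B ∪ H)` and a
point `z ∈ iR ∖ (A + B)`. [cite: BoothbyDevosMontejano2013, Lemma 7.3] -/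
theorem head_or_tail_full_of_critical (hH : IsSubgroupCarrier H)
    (hmin : ∀ s : ℕ, 0 < s → s < t → s • r ∉ H) (hAH : A + H = rseq H r 0 (ℓ + 1))
    (hnear : #((A + H) \ A) < #H) (hℓ : 1 ≤ ℓ) :
    ∀ (B : Finset G) (m : ℕ), B ⊆ rseq H r 0 (m + 1) → (B ∩ H).Nonempty →
      (B ∩ ((m • r) +ᵥ H)).Nonempty → 1 ≤ m → ℓ + m + 1 < t → #(A + B) < #A + #B →
      (∀ s : ℕ, 1 ≤ s → s ≤ ℓ + m → (s • r) +ᵥ H ⊆ A + B) ∨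
        (∀ s : ℕ, s + 1 ≤ ℓ + m → (s • r) +ᵥ H ⊆ A + B) := by
  suffices h : ∀ n : ℕ, ∀ (B : Finset G) (m : ℕ), #B = n → B ⊆ rseq H r 0 (m + 1) →
      (B ∩ H).Nonempty → (B ∩ ((m • r) +ᵥ H)).Nonempty → 1 ≤ m → ℓ + m + 1 < t →
      #(A + B) < #A + #B →
      (∀ s : ℕ, 1 ≤ s → s ≤ ℓ + m → (s • r) +ᵥ H ⊆ A + B) ∨
        (∀ s : ℕ, s + 1 ≤ ℓ + m → (s • r) +ᵥ H ⊆ A + B) from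
    fun B m => h _ B m rfl
  have hHpos := hH.nonempty.card_pos
  have hA : A.Nonempty := by
    rw [nonempty_iff_ne_empty]; rintro rfl
    rw [empty_add] at hAH
    exact (rseq_nonempty hH r 0 (by omega : 1 ≤ ℓ + 1)).ne_empty hAH.symm
  have hAsub : A ⊆ rseq H r 0 (ℓ + 1) := by rw [← hAH]; exact hH.subset_add A
  have hcritH : #(A + H) < #A + #H := by
    have := card_sdiff_add_card_eq_card (hH.subset_add A); omega
  have hAℓ : (A ∩ ((ℓ • r) +ᵥ H)).Nonempty := inter_coset_nonempty_of_add_eq hH hAH le_rfl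
  have hA0 : (A ∩ H).Nonempty := by
    have := inter_coset_nonempty_of_add_eq hH hAH (i := 0) (by omega)
    rwa [zero_nsmul, zero_vadd] at this
  have hsucc : ∀ i : ℕ, r + i • r = (i + 1) • r := fun i => by
    rw [add_nsmul, one_nsmul, add_comm]
  intro n
  induction n using Nat.strong_induction_on with
  | _ n ih =>
  intro B m hn hB hB0 hBm hm hlmt hcrit
  -- Claim 1
  have hBi := forall_inter_coset_nonempty_of_critical hH hmin hAH hnear hℓ hB hB0 hBm
    (by omega) hcrit
  by_cases hmid : ∀ s : ℕ, 1 ≤ s → s + 1 ≤ ℓ + m → (s • r) +ᵥ H ⊆ A + B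
  · -- Claim 2
    exact head_or_tail_full_of_middle_full hH hmin hAH hℓ hB hB0 hBm hm (by omega) hcrit hmid
  exfalso
  have hP0sub : A ∩ H + B ∩ H ⊆ H := fun y hy => by
    obtain ⟨a, ha, b, hb, rfl⟩ := mem_add.1 hy
    exact hH.add_mem (mem_inter.1 ha).2 (mem_inter.1 hb).2
  rcases Nat.lt_or_ge m 2 with hm1 | hm2
  · ---------------------------------------------------------------- `m = 1`: the final count
    obtain rfl : m = 1 := by omega
    push Not at hmid
    obtain ⟨s, hs1, hs2, hns⟩ := hmid
    rw [not_subset] at hns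
    obtain ⟨z, hz, hzAB⟩ := hns
    have hB1 : (B ∩ (r +ᵥ H)).Nonempty := by rwa [one_nsmul] at hBm
    -- (1) purification with `R = r + H`
    have hpur1 := card_add_union_coset_le hA hH hcritH r hB1
    have hBR : #(B ∪ (r +ᵥ H)) ≤ #(B ∩ H) + #H := by
      have hsub : B ∪ (r +ᵥ H) ⊆ (B ∩ H) ∪ (r +ᵥ H) := by
        intro b hb
        rcases mem_union.1 hb with hbB | hbR
        · have hb' := hB hbB
          rw [mem_rseq] at hb'
          obtain ⟨j, hj, hbj⟩ := hb'
          rw [zero_add] at hbj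
          rcases Nat.eq_zero_or_pos j with rfl | hjpos
          · rw [zero_nsmul, zero_vadd] at hbj; exact mem_union_left _ (mem_inter.2 ⟨hbB, hbj⟩)
          · have : j = 1 := by omega
            rw [this, one_nsmul] at hbj; exact mem_union_right _ hbj
        · exact mem_union_right _ hbR
      exact (card_le_card hsub).trans ((card_union_le _ _).trans (by rw [card_vadd_finset]))
    have hAR : A + (r +ᵥ H) = rseq H r r (ℓ + 1) := by
      rw [Grynkiewicz.add_vadd_finset, hAH, vadd_rseq, add_zero]
    have hP1 : #(A ∩ H + B ∩ H) + (ℓ + 1) * #H ≤ #(A + (B ∪ (r +ᵥ H))) := by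
      have hd : Disjoint (A ∩ H + B ∩ H) (rseq H r r (ℓ + 1)) := by
        rw [disjoint_left]; intro y hy hy'
        rw [mem_rseq] at hy'; obtain ⟨i, hi, hyi⟩ := hy'
        rw [hsucc] at hyi
        exact not_mem_of_mem_coset hH hmin (by omega) (by omega) hyi (hP0sub hy)
      have hsub : (A ∩ H + B ∩ H) ∪ rseq H r r (ℓ + 1) ⊆ A + (B ∪ (r +ᵥ H)) :=
        union_subset (add_subset_add inter_subset_left (inter_subset_left.trans subset_union_left))
          (by rw [← hAR]; exact add_subset_add_left subset_union_right)
      have := card_le_card hsub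
      rwa [card_union_of_disjoint hd, card_rseq hH hmin r (by omega)] at this
    -- (2) purification with `R = H`
    have hpur2 := card_add_union_coset_le hA hH hcritH (0 : G) (B := B) (by rwa [zero_vadd])
    rw [zero_vadd] at hpur2
    have hend1 : A ∩ ((ℓ • r) +ᵥ H) + B ∩ (r +ᵥ H) ⊆ ((ℓ + 1) • r) +ᵥ H := by
      have := hH.add_subset_coset (A := A ∩ ((ℓ • r) +ᵥ H)) (B := B ∩ (r +ᵥ H))
        (a₀ := ℓ • r) (b := r) inter_subset_right inter_subset_right
      rwa [← succ_nsmul] at this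
    have hBH' : #(B ∪ H) ≤ #H + #(B ∩ (r +ᵥ H)) := by
      have hsub : B ∪ H ⊆ H ∪ (B ∩ (r +ᵥ H)) := by
        intro b hb
        rcases mem_union.1 hb with hbB | hbH
        · have hb' := hB hbB
          rw [mem_rseq] at hb'
          obtain ⟨j, hj, hbj⟩ := hb'
          rw [zero_add] at hbj
          rcases Nat.eq_zero_or_pos j with rfl | hjpos
          · rw [zero_nsmul, zero_vadd] at hbj; exact mem_union_left _ hbj
          · have : j = 1 := by omega
            rw [this, one_nsmul] at hbj; exact mem_union_right _ (mem_inter.2 ⟨hbB, hbj⟩)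
        · exact mem_union_left _ hbH
      exact (card_le_card hsub).trans (card_union_le _ _)
    have hP2 : (ℓ + 1) * #H + #(A ∩ ((ℓ • r) +ᵥ H) + B ∩ (r +ᵥ H)) ≤ #(A + (B ∪ H)) := by
      have hd : Disjoint (rseq H r 0 (ℓ + 1)) (A ∩ ((ℓ • r) +ᵥ H) + B ∩ (r +ᵥ H)) := by
        rw [disjoint_left]; intro y hy hy'
        have := (mem_rseq_zero_iff hH hmin (k := ℓ + 1) (by omega) (by omega) (hend1 hy')).1 hy
        omega
      have hsub : rseq H r 0 (ℓ + 1) ∪ (A ∩ ((ℓ • r) +ᵥ H) + B ∩ (r +ᵥ H)) ⊆ A + (B ∪ H) :=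
        union_subset (by rw [← hAH]; exact add_subset_add_left subset_union_right)
          (add_subset_add inter_subset_left (inter_subset_left.trans subset_union_left))
      have := card_le_card hsub
      rwa [card_union_of_disjoint hd, card_rseq hH hmin 0 (by omega)] at this
    -- (3)
    have h3a : #(A ∩ H) ≤ #(A ∩ H + B ∩ H) := card_le_card_add_right hB0
    have h3b : #(A ∩ ((ℓ • r) +ᵥ H)) ≤ #(A ∩ ((ℓ • r) +ᵥ H) + B ∩ (r +ᵥ H)) :=
      card_le_card_add_right hB1
    have h3c := card_add_two_mul_le_of_subset_rseq hH hmin hAsub (i := 0) (j := ℓ) (by omega)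
      le_rfl (by omega)
    rw [zero_nsmul, zero_vadd] at h3c
    -- (5) the point `z ∈ sR ∖ (A + B)`: `B₀ ∩ (z − A_s) = ∅`, `B₁ ∩ (z − A_{s−1}) = ∅`
    have hzs := (hH.mem_coset_iff).1 hz
    have h5a : #(B ∩ H) + #(A ∩ ((s • r) +ᵥ H)) ≤ #H := by
      have hd : Disjoint (B ∩ H) ((A ∩ ((s • r) +ᵥ H)).image fun a => z - a) := by
        rw [disjoint_left]; intro b hb hb'
        rw [mem_image] at hb'; obtain ⟨a, ha, hab⟩ := hb'
        exact hzAB (mem_add.2 ⟨a, (mem_inter.1 ha).1, b, (mem_inter.1 hb).1, by rw [← hab]; abel⟩)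
      have hsub : (B ∩ H) ∪ (A ∩ ((s • r) +ᵥ H)).image (fun a => z - a) ⊆ H := by
        refine union_subset inter_subset_right fun y hy => ?_
        rw [mem_image] at hy; obtain ⟨a, ha, rfl⟩ := hy
        have h2 := (hH.mem_coset_iff).1 (mem_inter.1 ha).2
        have e : z - a = (z - s • r) - (a - s • r) := by abel
        rw [e]; exact hH.sub_mem hzs h2
      have := card_le_card hsub
      rwa [card_union_of_disjoint hd, card_image_of_injective _ (sub_right_injective)] at this
    have h5b : #(B ∩ (r +ᵥ H)) + #(A ∩ (((s - 1) • r) +ᵥ H)) ≤ #H := by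
      have hd : Disjoint (B ∩ (r +ᵥ H)) ((A ∩ (((s - 1) • r) +ᵥ H)).image fun a => z - a) := by
        rw [disjoint_left]; intro b hb hb'
        rw [mem_image] at hb'; obtain ⟨a, ha, hab⟩ := hb'
        exact hzAB (mem_add.2 ⟨a, (mem_inter.1 ha).1, b, (mem_inter.1 hb).1, by rw [← hab]; abel⟩)
      have hsub : (B ∩ (r +ᵥ H)) ∪ (A ∩ (((s - 1) • r) +ᵥ H)).image (fun a => z - a) ⊆
          r +ᵥ H := by
        refine union_subset inter_subset_right fun y hy => ?_
        rw [mem_image] at hy; obtain ⟨a, ha, rfl⟩ := hy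
        have h2 := (hH.mem_coset_iff).1 (mem_inter.1 ha).2
        rw [hH.mem_coset_iff]
        have hsr : (s - 1) • r + r = s • r := by
          rw [← succ_nsmul, Nat.sub_add_cancel hs1]
        have e : z - a - r = (z - s • r) - (a - (s - 1) • r) := by rw [← hsr]; abel
        rw [e]; exact hH.sub_mem hzs h2
      have := card_le_card hsub
      rwa [card_union_of_disjoint hd, card_image_of_injective _ (sub_right_injective),
        card_vadd_finset] at this
    have h5c := card_add_two_mul_le_of_subset_rseq hH hmin hAsub (i := s - 1) (j := s) (by omega)
      (by omega) (by omega)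
    omega
  · ---------------------------------------------------------------- Claim 3: `m ≥ 2` is absurd
    apply hmid
    intro s hs1 hs2
    -- (i) the induction hypothesis for `B' = B ∖ B_m`
    have hB'sub : B \ ((m • r) +ᵥ H) ⊆ rseq H r 0 (m - 1 + 1) := by
      intro b hb
      rw [mem_sdiff] at hb
      have hb' := hB hb.1
      rw [mem_rseq] at hb' ⊢
      obtain ⟨j, hj, hbj⟩ := hb'
      refine ⟨j, ?_, hbj⟩
      rw [zero_add] at hbj
      by_contra hjm
      have : j = m := by omega
      rw [this] at hbj; exact hb.2 hbj
    have hB'0 : (B \ ((m • r) +ᵥ H) ∩ H).Nonempty := by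
      obtain ⟨b, hb⟩ := hB0
      rw [mem_inter] at hb
      refine ⟨b, mem_inter.2 ⟨mem_sdiff.2 ⟨hb.1, fun hbm => ?_⟩, hb.2⟩⟩
      exact not_mem_of_mem_coset hH hmin (by omega) (by omega) hbm hb.2
    have hB'm : (B \ ((m • r) +ᵥ H) ∩ (((m - 1) • r) +ᵥ H)).Nonempty := by
      obtain ⟨b, hb⟩ := hBi (m - 1) (by omega)
      rw [mem_inter] at hb
      refine ⟨b, mem_inter.2 ⟨mem_sdiff.2 ⟨hb.1, fun hbm => ?_⟩, hb.2⟩⟩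
      have := index_eq_of_mem hH hmin (i := m - 1) (j := m) (by omega) (by omega) hb.2 hbm
      omega
    have hB'card : #(B \ ((m • r) +ᵥ H)) + #(B ∩ ((m • r) +ᵥ H)) = #B :=
      card_sdiff_add_card_inter _ _
    have hAB'sub : A + B \ ((m • r) +ᵥ H) ⊆ rseq H r 0 (ℓ + m) := by
      have := add_subset_add hAsub hB'sub
      rw [rseq_add_rseq hH r 0 0 (by omega) (by omega), add_zero,
        show ℓ + 1 + (m - 1 + 1) - 1 = ℓ + m by omega] at this
      exact this
    have hend : A ∩ ((ℓ • r) +ᵥ H) + B ∩ ((m • r) +ᵥ H) ⊆ ((ℓ + m) • r) +ᵥ H := by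
      have := hH.add_subset_coset (A := A ∩ ((ℓ • r) +ᵥ H)) (B := B ∩ ((m • r) +ᵥ H))
        (a₀ := ℓ • r) (b := m • r) inter_subset_right inter_subset_right
      rwa [← add_nsmul] at this
    have hdisj : Disjoint (A + B \ ((m • r) +ᵥ H)) (A ∩ ((ℓ • r) +ᵥ H) + B ∩ ((m • r) +ᵥ H)) := by
      rw [disjoint_left]; intro y hy hy'
      have := (mem_rseq_zero_iff hH hmin (k := ℓ + m) (by omega) (by omega) (hend hy')).1
        (hAB'sub hy)
      omega
    have hboth : (A + B \ ((m • r) +ᵥ H)) ∪ (A ∩ ((ℓ • r) +ᵥ H) + B ∩ ((m • r) +ᵥ H)) ⊆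
        A + B :=
      union_subset (add_subset_add_left sdiff_subset)
        (add_subset_add inter_subset_left inter_subset_left)
    have hcardAB := card_le_card hboth
    rw [card_union_of_disjoint hdisj] at hcardAB
    have hendcard : #(B ∩ ((m • r) +ᵥ H)) ≤ #(A ∩ ((ℓ • r) +ᵥ H) + B ∩ ((m • r) +ᵥ H)) :=
      card_le_card_add_left hAℓ
    have hcrit' : #(A + B \ ((m • r) +ᵥ H)) < #A + #(B \ ((m • r) +ᵥ H)) := by omega
    have hlt' : #(B \ ((m • r) +ᵥ H)) < n := by rw [← hn]; have := hBm.card_pos; omega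
    have ih1 := ih _ hlt' (B \ ((m • r) +ᵥ H)) (m - 1) rfl hB'sub hB'0 hB'm (by omega)
      (by omega) hcrit'
    have hfull1 : ∀ s : ℕ, 1 ≤ s → s + 1 ≤ ℓ + (m - 1) → (s • r) +ᵥ H ⊆ A + B := by
      intro s hs1 hs2
      refine Subset.trans ?_ (add_subset_add_left (sdiff_subset : B \ ((m • r) +ᵥ H) ⊆ B))
      rcases ih1 with h | h
      · exact h s hs1 (by omega)
      · exact h s hs2
    -- (ii) the induction hypothesis for `−r + (B ∖ B₀)`
    have hB''sub : B \ H ⊆ rseq H r r m := by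
      intro b hb
      rw [mem_sdiff] at hb
      have hb' := hB hb.1
      rw [← union_rseq_r] at hb'
      rcases mem_union.1 hb' with h | h
      · exact (hb.2 h).elim
      · exact h
    have hB3sub : (-r) +ᵥ (B \ H) ⊆ rseq H r 0 (m - 1 + 1) := by
      have := vadd_finset_subset_vadd_finset (a := -r) hB''sub
      rw [vadd_rseq, neg_add_cancel] at this
      rwa [show m - 1 + 1 = m by omega]
    have hB30 : (((-r) +ᵥ (B \ H)) ∩ H).Nonempty := by
      obtain ⟨b, hb⟩ := hBi 1 (by omega)
      rw [mem_inter, one_nsmul] at hb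
      have hbH : b ∉ H :=
        not_mem_of_mem_coset hH hmin (j := 1) one_pos (by omega) (by rw [one_nsmul]; exact hb.2)
      refine ⟨-r + b, mem_inter.2 ⟨vadd_mem_vadd_finset (mem_sdiff.2 ⟨hb.1, hbH⟩), ?_⟩⟩
      have hb2 := (hH.mem_coset_iff).1 hb.2
      have e : -r + b = b - r := by abel
      rw [e]; exact hb2
    have hB3m : (((-r) +ᵥ (B \ H)) ∩ (((m - 1) • r) +ᵥ H)).Nonempty := by
      obtain ⟨b, hb⟩ := hBm
      rw [mem_inter] at hb
      have hbH : b ∉ H := not_mem_of_mem_coset hH hmin (j := m) (by omega) (by omega) hb.2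
      refine ⟨-r + b, mem_inter.2 ⟨vadd_mem_vadd_finset (mem_sdiff.2 ⟨hb.1, hbH⟩), ?_⟩⟩
      have hb2 := (hH.mem_coset_iff).1 hb.2
      rw [hH.mem_coset_iff]
      have hmr : (m - 1) • r + r = m • r := by rw [← succ_nsmul, Nat.sub_add_cancel hm]
      have e : -r + b - (m - 1) • r = b - m • r := by rw [← hmr]; abel
      rw [e]; exact hb2
    have hB''card : #(B \ H) + #(B ∩ H) = #B := card_sdiff_add_card_inter _ _
    have hvcard : #((-r) +ᵥ (B \ H)) = #(B \ H) := card_vadd_finset _ _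
    have hAB''sub : A + B \ H ⊆ rseq H r r (ℓ + m) := by
      have := add_subset_add hAsub hB''sub
      rw [rseq_add_rseq hH r 0 r (by omega) hm, zero_add,
        show ℓ + 1 + m - 1 = ℓ + m by omega] at this
      exact this
    have hdisj0 : Disjoint (A + B \ H) (A ∩ H + B ∩ H) := by
      rw [disjoint_left]; intro y hy hy'
      have h1 := hAB''sub hy
      rw [mem_rseq] at h1
      obtain ⟨i, hi, hyi⟩ := h1
      rw [hsucc] at hyi
      exact not_mem_of_mem_coset hH hmin (by omega) (by omega) hyi (hP0sub hy')
    have hboth0 : (A + B \ H) ∪ (A ∩ H + B ∩ H) ⊆ A + B :=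
      union_subset (add_subset_add_left sdiff_subset)
        (add_subset_add inter_subset_left inter_subset_left)
    have hcardAB0 := card_le_card hboth0
    rw [card_union_of_disjoint hdisj0] at hcardAB0
    have hend0card : #(B ∩ H) ≤ #(A ∩ H + B ∩ H) := card_le_card_add_left hA0
    have hAB3 : A + ((-r) +ᵥ (B \ H)) = (-r) +ᵥ (A + B \ H) :=
      Grynkiewicz.add_vadd_finset A (B \ H) (-r)
    have hcrit3 : #(A + ((-r) +ᵥ (B \ H))) < #A + #((-r) +ᵥ (B \ H)) := by
      rw [hAB3, card_vadd_finset, hvcard]; omega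
    have hlt3 : #((-r) +ᵥ (B \ H)) < n := by
      rw [← hn, hvcard]; have := hB0.card_pos; omega
    have ih2 := ih _ hlt3 ((-r) +ᵥ (B \ H)) (m - 1) rfl hB3sub hB30 hB3m (by omega) (by omega)
      hcrit3
    have hfull2 : ∀ s : ℕ, 2 ≤ s → s ≤ ℓ + (m - 1) → (s • r) +ᵥ H ⊆ A + B := by
      intro s hs1 hs2
      have h' : ((s - 1) • r) +ᵥ H ⊆ A + ((-r) +ᵥ (B \ H)) := by
        rcases ih2 with h | h
        · exact h (s - 1) (by omega) (by omega)
        · exact h (s - 1) (by omega)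
      rw [hAB3] at h'
      have h'' := vadd_finset_subset_vadd_finset (a := r) h'
      rw [vadd_neg_vadd, vadd_vadd, show r + (s - 1) • r = s • r by
        rw [add_comm, ← succ_nsmul, Nat.sub_add_cancel (by omega : 1 ≤ s)]] at h''
      exact h''.trans (add_subset_add_left (sdiff_subset : B \ H ⊆ B))
    rcases Nat.lt_or_ge s 2 with hs | hs
    · exact hfull1 s hs1 (by omega)
    · exact hfull2 s hs (by omega)

/-- **Lemma 7.3** (normal position).  "Let `(A,B)` be a nontrivial critical pair, and assume that
`A` is a nontrivial near `R`-sequence for `R ∈ G/H`, and that `B` is not contained in any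
`H`-coset.  If there exists an `R`-sequence `B*` with `B ⊆ B*` and `A + B* ≠ G`, then `A + B` is a
fringed `R`-sequence."  Here after the printed normalisation ("by shifting `A` and `B` we may assume
`A + H = ⋃_{i=0}^{ℓ} iR` and `B* = ⋃_{i=0}^{m} iR` … `B₀ ≠ ∅` and `B_m ≠ ∅`"): `m ≥ 1` says `B` is
not inside one coset and `ℓ + m + 1 < t` says `A + B* ≠ G`. [cite: BoothbyDevosMontejano2013, Lemma 7.3] -/
theorem isFringedSeq_add_of_critical (hH : IsSubgroupCarrier H)
    (hmin : ∀ s : ℕ, 0 < s → s < t → s • r ∉ H) (hAH : A + H = rseq H r 0 (ℓ + 1))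
    (hnear : #((A + H) \ A) < #H) (hℓ : 1 ≤ ℓ) {B : Finset G} {m : ℕ}
    (hB : B ⊆ rseq H r 0 (m + 1)) (hB0 : (B ∩ H).Nonempty)
    (hBm : (B ∩ ((m • r) +ᵥ H)).Nonempty) (hm : 1 ≤ m) (hlmt : ℓ + m + 1 < t)
    (hcrit : #(A + B) < #A + #B) : IsFringedSeq H r (A + B) := by
  have h := head_or_tail_full_of_critical hH hmin hAH hnear hℓ B m hB hB0 hBm hm hlmt hcrit
  -- the hull of `A + B` is `H ∪ … ∪ (ℓ + m)R`
  have hBi := forall_inter_coset_nonempty_of_critical hH hmin hAH hnear hℓ hB hB0 hBm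
    (by omega) hcrit
  have hBH : B + H = rseq H r 0 (m + 1) := by
    refine Subset.antisymm ?_ ?_
    · calc B + H ⊆ rseq H r 0 (m + 1) + H := add_subset_add_right hB
        _ = rseq H r 0 (m + 1) := rseq_add hH r 0 (m + 1)
    · intro x hx
      rw [mem_rseq] at hx
      obtain ⟨i, hi, hxi⟩ := hx
      rw [zero_add] at hxi
      obtain ⟨b, hb⟩ := hBi i (by omega)
      rw [mem_inter] at hb
      have h1 := (hH.mem_coset_iff).1 hxi
      have h2 := (hH.mem_coset_iff).1 hb.2
      refine mem_add.2 ⟨b, hb.1, x - b, ?_, by abel⟩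
      have e : x - b = (x - i • r) - (b - i • r) := by abel
      rw [e]; exact hH.sub_mem h1 h2
  have hABH : A + B + H = rseq H r 0 (ℓ + m + 1) := by
    rw [add_assoc, hBH]
    have : A + rseq H r 0 (m + 1) = (A + H) + rseq H r 0 (m + 1) := by
      rw [add_assoc, add_comm H, rseq_add hH]
    rw [this, hAH, rseq_add_rseq hH r 0 0 (by omega) (by omega), add_zero,
      show ℓ + 1 + (m + 1) - 1 = ℓ + m + 1 by omega]
  rcases h with h | h
  · exact isFringedSeq_of_tail_full hH hmin hABH (by omega) h
  · exact isFringedSeq_of_head_full hH hmin hABH (by omega) h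

end Lemma73

/-! ## Lemma 7.3 as printed (arbitrary position) -/

section Lemma73Printed

variable [Fintype G] {H A B : Finset G} {r : G}

omit [Fintype G] in
/-- Fringed `R`-sequences are preserved by translation. [cite: BoothbyDevosMontejano2013, Def 7.2] -/
theorem IsFringedSeq.vadd (h : IsFringedSeq H r A) (g : G) : IsFringedSeq H r (g +ᵥ A) := by
  obtain ⟨a, n, hn, hA, hst⟩ := h
  have e : (g +ᵥ A) + H = g +ᵥ (A + H) := vadd_add_assoc g A H
  refine ⟨g + a, n, hn, by rw [e, hA, vadd_rseq], ?_⟩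
  have e1 : (g +ᵥ A) \ ((g + a) +ᵥ H) = g +ᵥ (A \ (a +ᵥ H)) := by
    rw [add_vadd, ← vadd_finset_sdiff]
  have e2 : (g +ᵥ A) \ ((g + a + (n - 1) • r) +ᵥ H) = g +ᵥ (A \ ((a + (n - 1) • r) +ᵥ H)) := by
    rw [add_assoc, add_vadd, ← vadd_finset_sdiff]
  rcases hst with h1 | h2
  · left; rw [e1, vadd_add_assoc, h1]
  · right; rw [e2, vadd_add_assoc, h2]

omit [Fintype G] in
/-- `(g₁ + A) + (g₂ + B) = (g₁ + g₂) + (A + B)`. [cite: BoothbyDevosMontejano2013, §4] -/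
theorem vadd_add_vadd_eq (g₁ g₂ : G) (A B : Finset G) :
    (g₁ +ᵥ A) + (g₂ +ᵥ B) = (g₁ + g₂) +ᵥ (A + B) := by
  rw [vadd_add_assoc, Grynkiewicz.add_vadd_finset, vadd_vadd]

/-- **Lemma 7.3** as printed.  "Let `(A,B)` be a nontrivial critical pair, and assume that `A` is a
nontrivial near `R`-sequence for `R ∈ G/H` [generating `G/H`], and that `B` is not contained in any
`H`-coset.  If there exists an `R`-sequence `B*` with `B ⊆ B*` and `A + B* ≠ G`, then `A + B` is a
fringed `R`-sequence."  Reduced to the normal position (`head_or_tail_full_of_critical`) exactly as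
the printed proof starts: "By shifting `A` … and `B` we may assume that `A + H = ⋃_{i=0}^{ℓ} iR`
and `B* = ⋃_{i=0}^{m} iR …  By replacing `B*` with a smaller `R`-sequence, we may assume that
`B₀ ≠ ∅` and `B_m ≠ ∅`." [cite: BoothbyDevosMontejano2013, Lemma 7.3] -/
theorem isFringedSeq_add_of_critical_of_isNearSeq (hH : IsSubgroupCarrier H)
    (hgen : IsCyclicQuotGen H r) (hA : IsNearSeq H r A) (hAH : #H < #A)
    (hB : ∀ c : G, ¬ B ⊆ c +ᵥ H) {b : G} {n : ℕ} (hBs : B ⊆ rseq H r b n)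
    (hABs : A + rseq H r b n ≠ univ) (hcrit : #(A + B) < #A + #B) : IsFringedSeq H r (A + B) := by
  obtain ⟨t, ht, htH, hmin⟩ := exists_minimal_nsmul_mem hH r
  obtain ⟨⟨a, ℓ', hℓ', hAH'⟩, hnear⟩ := hA
  have hAne : A.Nonempty := card_pos.1 (by omega)
  have hBne : B.Nonempty := by
    rw [nonempty_iff_ne_empty]; rintro rfl; exact hB 0 (empty_subset _)
  -- `ℓ' ≥ 2`: a nontrivial near sequence meets at least two cosets
  have hℓ2 : 2 ≤ ℓ' := by
    by_contra hlt
    have h1 : ℓ' = 1 := by omega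
    rw [h1, rseq_one] at hAH'
    have := card_le_card (hH.subset_add A)
    rw [hAH', card_vadd_finset] at this
    omega
  -- `A + B* = rseq (a + b) (ℓ' + n − 1) ≠ G` gives `ℓ' + n − 1 < t`
  have hn1 : 1 ≤ n := by
    by_contra h0
    have : n = 0 := by omega
    rw [this, rseq_zero] at hBs
    exact hBne.ne_empty (subset_empty.1 hBs)
  have hsum : A + rseq H r b n = rseq H r (a + b) (ℓ' + n - 1) := by
    have : A + rseq H r b n = (A + H) + rseq H r b n := by
      rw [add_assoc, add_comm H, rseq_add hH]
    rw [this, hAH', rseq_add_rseq hH r a b (by omega) hn1]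
  have hlt : ℓ' + n - 1 < t := lt_of_rseq_ne_univ hH hgen ht htH (hsum ▸ hABs)
  -- the cosets of `B*` met by `B`: indices `J`, extremes `j₀ ≤ j₁`
  set J := (range n).filter fun j => (B ∩ ((b + j • r) +ᵥ H)).Nonempty with hJdef
  have hmemJ : ∀ x ∈ B, ∃ j ∈ J, x ∈ (b + j • r) +ᵥ H := by
    intro x hx
    have hx' := hBs hx
    rw [mem_rseq] at hx'
    obtain ⟨j, hj, hxj⟩ := hx'
    exact ⟨j, mem_filter.2 ⟨mem_range.2 hj, x, mem_inter.2 ⟨hx, hxj⟩⟩, hxj⟩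
  have hJne : J.Nonempty := by
    obtain ⟨x, hx⟩ := hBne
    obtain ⟨j, hj, -⟩ := hmemJ x hx
    exact ⟨j, hj⟩
  set j₀ := J.min' hJne with hj₀def
  set j₁ := J.max' hJne with hj₁def
  have hj₀J : j₀ ∈ J := min'_mem _ _
  have hj₁J : j₁ ∈ J := max'_mem _ _
  have hj₀₁ : j₀ ≤ j₁ := min'_le _ _ hj₁J
  have hj₁n : j₁ < n := mem_range.1 (mem_filter.1 hj₁J).1
  -- `m = j₁ − j₀ ≥ 1` since `B` is not inside one coset
  have hm : 1 ≤ j₁ - j₀ := by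
    by_contra h0
    have heq : j₁ = j₀ := by omega
    apply hB (b + j₀ • r)
    intro x hx
    obtain ⟨j, hj, hxj⟩ := hmemJ x hx
    have h1 : j₀ ≤ j := min'_le _ _ hj
    have h2 : j ≤ j₁ := le_max' _ _ hj
    have : j = j₀ := by omega
    rwa [this] at hxj
  -- translate: `A' = −a + A`, `B' = −(b + j₀•r) + B`
  set gA : G := -a with hgA
  set gB : G := -(b + j₀ • r) with hgB
  have hA'H : (gA +ᵥ A) + H = rseq H r 0 (ℓ' - 1 + 1) := by
    rw [vadd_add_assoc, hAH', vadd_rseq, hgA, neg_add_cancel, Nat.sub_add_cancel hℓ']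
  have hnear' : #(((gA +ᵥ A) + H) \ (gA +ᵥ A)) < #H := by
    rw [vadd_add_assoc, ← vadd_finset_sdiff, card_vadd_finset]; exact hnear
  have hB'sub : gB +ᵥ B ⊆ rseq H r 0 (j₁ - j₀ + 1) := by
    intro y hy
    rw [mem_vadd_finset] at hy
    obtain ⟨x, hx, rfl⟩ := hy
    obtain ⟨j, hj, hxj⟩ := hmemJ x hx
    have h1 : j₀ ≤ j := min'_le _ _ hj
    have h2 : j ≤ j₁ := le_max' _ _ hj
    rw [mem_rseq]
    refine ⟨j - j₀, by omega, ?_⟩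
    rw [hH.mem_coset_iff] at hxj ⊢
    have e : (gB +ᵥ x) - (0 + (j - j₀) • r) = x - (b + j • r) := by
      rw [hgB, vadd_eq_add, zero_add]
      have : j₀ • r + (j - j₀) • r = j • r := by rw [← add_nsmul, Nat.add_sub_cancel' h1]
      rw [← this]; abel
    rw [e]; exact hxj
  have hB'0 : ((gB +ᵥ B) ∩ H).Nonempty := by
    obtain ⟨x, hx⟩ := (mem_filter.1 hj₀J).2
    rw [mem_inter] at hx
    refine ⟨gB +ᵥ x, mem_inter.2 ⟨vadd_mem_vadd_finset hx.1, ?_⟩⟩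
    have := (hH.mem_coset_iff).1 hx.2
    have e : gB +ᵥ x = x - (b + j₀ • r) := by rw [hgB, vadd_eq_add]; abel
    rw [e]; exact this
  have hB'm : ((gB +ᵥ B) ∩ (((j₁ - j₀) • r) +ᵥ H)).Nonempty := by
    obtain ⟨x, hx⟩ := (mem_filter.1 hj₁J).2
    rw [mem_inter] at hx
    refine ⟨gB +ᵥ x, mem_inter.2 ⟨vadd_mem_vadd_finset hx.1, ?_⟩⟩
    have := (hH.mem_coset_iff).1 hx.2
    rw [hH.mem_coset_iff]
    have e : (gB +ᵥ x) - (j₁ - j₀) • r = x - (b + j₁ • r) := by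
      rw [hgB, vadd_eq_add]
      have : j₀ • r + (j₁ - j₀) • r = j₁ • r := by rw [← add_nsmul, Nat.add_sub_cancel' hj₀₁]
      rw [← this]; abel
    rw [e]; exact this
  have hcrit' : #((gA +ᵥ A) + (gB +ᵥ B)) < #(gA +ᵥ A) + #(gB +ᵥ B) := by
    rw [vadd_add_vadd_eq, card_vadd_finset, card_vadd_finset, card_vadd_finset]; exact hcrit
  have hfr := isFringedSeq_add_of_critical hH hmin hA'H hnear' (by omega) hB'sub hB'0 hB'm hm
    (by omega) hcrit'
  rw [vadd_add_vadd_eq] at hfr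
  have := hfr.vadd (-(gA + gB))
  rwa [neg_vadd_vadd] at this

end Lemma73Printed

/-! ## More sequence calculus: negatives and complements of (fringed) `R`-sequences -/

section SeqCalc

variable [Fintype G] {H A X : Finset G} {r x b : G} {n ℓ L t : ℕ}

omit [Fintype G] in
/-- The negative of an `R`-sequence is an `R`-sequence (read backwards):
`−(x + [0,n)R) = (−x − (n−1)r) + [0,n)R`. [cite: BoothbyDevosMontejano2013, §4] -/
theorem neg_rseq (hH : IsSubgroupCarrier H) (x : G) (n : ℕ) :
    -(rseq H r x n) = rseq H r (-x - (n - 1) • r) n := by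
  ext y
  rw [mem_neg', mem_rseq, mem_rseq]
  constructor
  · rintro ⟨i, hi, hy⟩
    refine ⟨n - 1 - i, by omega, ?_⟩
    rw [hH.mem_coset_iff] at hy ⊢
    have e1 : (n - 1 - i) • r + i • r = (n - 1) • r := by rw [← add_nsmul]; congr 1; omega
    have e : y - (-x - (n - 1) • r + (n - 1 - i) • r) = -(-y - (x + i • r)) := by
      rw [← e1]; abel
    rw [e]; exact hH.neg_mem hy
  · rintro ⟨i, hi, hy⟩
    refine ⟨n - 1 - i, by omega, ?_⟩
    rw [hH.mem_coset_iff] at hy ⊢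
    have e1 : (n - 1 - i) • r + i • r = (n - 1) • r := by rw [← add_nsmul]; congr 1; omega
    have e : -y - (x + (n - 1 - i) • r) = -(y - (-x - (n - 1) • r + i • r)) := by
      rw [← e1]; abel
    rw [e]; exact hH.neg_mem hy

omit [Fintype G] in
/-- Membership in a translated `R`-sequence by coset index: for `−x + y` of index `j < t`,
`y ∈ x + [0,n)R ↔ j < n` (`n ≤ t`). [cite: BoothbyDevosMontejano2013, §4] -/
theorem mem_rseq_iff_index (hH : IsSubgroupCarrier H) (hmin : ∀ s : ℕ, 0 < s → s < t → s • r ∉ H)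
    {j : ℕ} (hjt : j < t) (hnt : n ≤ t) {y : G} (hy : -x + y ∈ (j • r) +ᵥ H) :
    y ∈ rseq H r x n ↔ j < n := by
  have e : rseq H r x n = x +ᵥ rseq H r 0 n := by rw [vadd_rseq, add_zero]
  rw [e, ← neg_vadd_mem_iff]
  exact mem_rseq_zero_iff hH hmin hjt hnt hy

/-- The complement of an `R`-sequence of `n ≤ t` cosets is the `R`-sequence of the other `t − n`:
`\overline{x + [0,n)R} = (x + n r) + [0, t−n)R`. [cite: BoothbyDevosMontejano2013, §4] -/
theorem compl_rseq (hH : IsSubgroupCarrier H) (hgen : IsCyclicQuotGen H r) (ht : 0 < t)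
    (htH : t • r ∈ H) (hmin : ∀ s : ℕ, 0 < s → s < t → s • r ∉ H) (x : G) (hnt : n ≤ t) :
    (rseq H r x n)ᶜ = rseq H r (x + n • r) (t - n) := by
  ext y
  rw [mem_compl]
  obtain ⟨j, hjt, hj⟩ := exists_index_lt hH hgen ht htH (-x + y)
  rw [mem_rseq_iff_index hH hmin hjt hnt hj]
  have e : rseq H r (x + n • r) (t - n) = x +ᵥ rseq H r (n • r) (t - n) := by rw [vadd_rseq]
  rw [e, ← neg_vadd_mem_iff, mem_rseq]
  constructor
  · intro hjn
    refine ⟨j - n, by omega, ?_⟩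
    rwa [← add_nsmul, show n + (j - n) = j by omega]
  · rintro ⟨i, hi, hyi⟩
    rw [← add_nsmul] at hyi
    have := index_eq_of_mem hH hmin hjt (by omega) hj hyi
    omega

omit [Fintype G] in
/-- Each coset of the hull `X + H = b + [0, L+1)R` meets `X`. [cite: BoothbyDevosMontejano2013, §7] -/
theorem inter_coset_nonempty_of_add_eq' (hH : IsSubgroupCarrier H)
    (hXH : X + H = rseq H r b (L + 1)) {i : ℕ} (hi : i ≤ L) :
    (X ∩ ((b + i • r) +ᵥ H)).Nonempty := by
  have : b + i • r ∈ X + H := by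
    rw [hXH]; exact coset_subset_rseq H r b (by omega : i < L + 1) (hH.mem_coset_self _)
  obtain ⟨y, hy, h, hh, hyh⟩ := mem_add.1 this
  refine ⟨y, mem_inter.2 ⟨hy, ?_⟩⟩
  rw [hH.mem_coset_iff]
  have e : y - (b + i • r) = -h := by rw [← hyh]; abel
  rw [e]; exact hH.neg_mem hh

/-- NORMAL FORM of a fringed `R`-sequence: a witness `(b, n)` with `n ≤ t` (if the given hull has
`n > t` terms it is all of `G`, and the exceptional coset can be taken as the head of `b + [0,t)R`).
[cite: BoothbyDevosMontejano2013, Def 7.2] -/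
theorem IsFringedSeq.normal_form (hH : IsSubgroupCarrier H) (hgen : IsCyclicQuotGen H r)
    (ht : 0 < t) (htH : t • r ∈ H) (h : IsFringedSeq H r X) :
    ∃ b : G, ∃ n : ℕ, 1 ≤ n ∧ n ≤ t ∧ X + H = rseq H r b n ∧
      (X \ (b +ᵥ H) + H = X \ (b +ᵥ H) ∨
        X \ ((b + (n - 1) • r) +ᵥ H) + H = X \ ((b + (n - 1) • r) +ᵥ H)) := by
  obtain ⟨b, n, hn, hX, halt⟩ := h
  by_cases hnt : n ≤ t
  · exact ⟨b, n, hn, hnt, hX, halt⟩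
  have huniv : X + H = univ := by
    apply eq_univ_of_forall; intro y
    rw [hX]
    exact rseq_mono H r b (by omega : t ≤ n) (by rw [rseq_eq_univ hH hgen ht htH b]; exact mem_univ y)
  rcases halt with h1 | h2
  · exact ⟨b, t, ht, le_rfl, by rw [huniv, rseq_eq_univ hH hgen ht htH b], Or.inl h1⟩
  · refine ⟨b + (n - 1) • r, t, ht, le_rfl, by rw [huniv, rseq_eq_univ hH hgen ht htH], Or.inl h2⟩

omit [Fintype G] in
/-- In a fringed `R`-sequence in normal form all cosets of the hull other than the head (resp. the
tail) are full. [cite: BoothbyDevosMontejano2013, Def 7.2] -/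
theorem full_cosets_of_fringed (hH : IsSubgroupCarrier H)
    (hmin : ∀ s : ℕ, 0 < s → s < t → s • r ∉ H) (hn : 1 ≤ n) (hnt : n ≤ t)
    (hX : X + H = rseq H r b n)
    (halt : X \ (b +ᵥ H) + H = X \ (b +ᵥ H) ∨
      X \ ((b + (n - 1) • r) +ᵥ H) + H = X \ ((b + (n - 1) • r) +ᵥ H)) :
    (∀ j : ℕ, 1 ≤ j → j < n → (b + j • r) +ᵥ H ⊆ X) ∨
      (∀ j : ℕ, j + 1 < n → (b + j • r) +ᵥ H ⊆ X) := by
  obtain ⟨L, rfl⟩ : ∃ L, n = L + 1 := ⟨n - 1, by omega⟩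
  rcases halt with h1 | h2
  · left
    intro j hj1 hjn
    obtain ⟨y, hy⟩ := inter_coset_nonempty_of_add_eq' hH hX (i := j) (by omega)
    rw [mem_inter] at hy
    have hyb : y ∉ b +ᵥ H := by
      intro h'
      have := disjoint_coset_of_lt hH hmin b (i := 0) (j := j) hj1 (by omega)
      rw [zero_nsmul, add_zero] at this
      exact disjoint_left.1 this h' hy.2
    have hsub := hH.coset_subset_of_stable h1 (mem_sdiff.2 ⟨hy.1, hyb⟩)
    rw [hH.coset_eq_of_mem hy.2] at hsub
    exact hsub.trans sdiff_subset
  · right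
    intro j hjn
    rw [Nat.add_sub_cancel] at h2
    obtain ⟨y, hy⟩ := inter_coset_nonempty_of_add_eq' hH hX (i := j) (by omega)
    rw [mem_inter] at hy
    have hyb : y ∉ (b + L • r) +ᵥ H := by
      intro h'
      have := disjoint_coset_of_lt hH hmin b (i := j) (j := L) (by omega) (by omega)
      exact disjoint_left.1 this hy.2 h'
    have hsub := hH.coset_subset_of_stable h2 (mem_sdiff.2 ⟨hy.1, hyb⟩)
    rw [hH.coset_eq_of_mem hy.2] at hsub
    exact hsub.trans sdiff_subset

omit [Fintype G] in
/-- Fringed from full cosets, arbitrary head `b` (tail side full). [cite: BoothbyDevosMontejano2013, Def 7.2] -/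
theorem isFringedSeq_of_tail_full' (hH : IsSubgroupCarrier H)
    (hmin : ∀ s : ℕ, 0 < s → s < t → s • r ∉ H) (hXH : X + H = rseq H r b (L + 1)) (hLt : L < t)
    (hfull : ∀ s : ℕ, 1 ≤ s → s ≤ L → (b + s • r) +ᵥ H ⊆ X) : IsFringedSeq H r X := by
  have hX' : ((-b) +ᵥ X) + H = rseq H r 0 (L + 1) := by
    rw [vadd_add_assoc, hXH, vadd_rseq, neg_add_cancel]
  have hfull' : ∀ s : ℕ, 1 ≤ s → s ≤ L → (s • r) +ᵥ H ⊆ (-b) +ᵥ X := by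
    intro s hs1 hs2
    have := vadd_finset_subset_vadd_finset (a := -b) (hfull s hs1 hs2)
    rwa [vadd_vadd, neg_add_cancel_left] at this
  have := (isFringedSeq_of_tail_full hH hmin hX' hLt hfull').vadd b
  rwa [vadd_neg_vadd] at this

omit [Fintype G] in
/-- Fringed from full cosets, arbitrary head `b` (head side full). [cite: BoothbyDevosMontejano2013, Def 7.2] -/
theorem isFringedSeq_of_head_full' (hH : IsSubgroupCarrier H)
    (hmin : ∀ s : ℕ, 0 < s → s < t → s • r ∉ H) (hXH : X + H = rseq H r b (L + 1)) (hLt : L < t)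
    (hfull : ∀ s : ℕ, s + 1 ≤ L → (b + s • r) +ᵥ H ⊆ X) : IsFringedSeq H r X := by
  have hX' : ((-b) +ᵥ X) + H = rseq H r 0 (L + 1) := by
    rw [vadd_add_assoc, hXH, vadd_rseq, neg_add_cancel]
  have hfull' : ∀ s : ℕ, s + 1 ≤ L → (s • r) +ᵥ H ⊆ (-b) +ᵥ X := by
    intro s hs
    have := vadd_finset_subset_vadd_finset (a := -b) (hfull s hs)
    rwa [vadd_vadd, neg_add_cancel_left] at this
  have := (isFringedSeq_of_head_full hH hmin hX' hLt hfull').vadd b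
  rwa [vadd_neg_vadd] at this

/-- The negative of a fringed `R`-sequence is a fringed `R`-sequence (head and tail exchange).
[cite: BoothbyDevosMontejano2013, Def 7.2] -/
theorem IsFringedSeq.neg (hH : IsSubgroupCarrier H) (hgen : IsCyclicQuotGen H r) (ht : 0 < t)
    (htH : t • r ∈ H) (hmin : ∀ s : ℕ, 0 < s → s < t → s • r ∉ H) (h : IsFringedSeq H r X) :
    IsFringedSeq H r (-X) := by
  obtain ⟨b, n, hn, hnt, hX, halt⟩ := h.normal_form hH hgen ht htH
  obtain ⟨L, rfl⟩ : ∃ L, n = L + 1 := ⟨n - 1, by omega⟩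
  have hfull := full_cosets_of_fringed hH hmin hn hnt hX halt
  have hXH : (-X) + H = rseq H r (-b - L • r) (L + 1) := by
    rw [← hH.neg_eq, ← neg_add_rev, add_comm, hH.neg_eq, hX, neg_rseq hH, Nat.add_sub_cancel]
  -- coset `b + jR` of `X` becomes coset `(−b − L r) + (L − j)R` of `−X`
  have hneg : ∀ j : ℕ, j ≤ L → (b + j • r) +ᵥ H ⊆ X →
      (-b - L • r + (L - j) • r) +ᵥ H ⊆ -X := by
    intro j hj hsub y hy
    rw [mem_neg']
    apply hsub
    rw [hH.mem_coset_iff] at hy ⊢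
    have e1 : (L - j) • r + j • r = L • r := by rw [← add_nsmul, Nat.sub_add_cancel hj]
    have e : -y - (b + j • r) = -(y - (-b - L • r + (L - j) • r)) := by rw [← e1]; abel
    rw [e]; exact hH.neg_mem hy
  rcases hfull with h1 | h2
  · -- cosets `1 ≤ j ≤ L` of `X` full ⇒ cosets `0 ≤ L − j ≤ L − 1` of `−X` full
    refine isFringedSeq_of_head_full' hH hmin hXH (by omega) fun s hs => ?_
    have := hneg (L - s) (by omega) (h1 (L - s) (by omega) (by omega))
    rwa [show L - (L - s) = s by omega] at this
  · refine isFringedSeq_of_tail_full' hH hmin hXH (by omega) fun s hs1 hs2 => ?_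
    have := hneg (L - s) (by omega) (h2 (L - s) (by omega))
    rwa [show L - (L - s) = s by omega] at this

/-- The complement of a fringed `R`-sequence (when nonempty) is a fringed `R`-sequence: the cosets
outside the hull together with the exceptional end coset form an `R`-sequence, full except at that
end. [cite: BoothbyDevosMontejano2013, Def 7.2] -/
theorem IsFringedSeq.compl (hH : IsSubgroupCarrier H) (hgen : IsCyclicQuotGen H r) (ht : 0 < t)
    (htH : t • r ∈ H) (hmin : ∀ s : ℕ, 0 < s → s < t → s • r ∉ H) (h : IsFringedSeq H r X)
    (hne : Xᶜ.Nonempty) : IsFringedSeq H r Xᶜ := by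
  obtain ⟨b, n, hn, hnt, hX, halt⟩ := h.normal_form hH hgen ht htH
  obtain ⟨L, rfl⟩ : ∃ L, n = L + 1 := ⟨n - 1, by omega⟩
  have hfull := full_cosets_of_fringed hH hmin hn hnt hX halt
  have hXsub : X ⊆ rseq H r b (L + 1) := by rw [← hX]; exact hH.subset_add X
  -- the block outside the hull
  have hout : (rseq H r b (L + 1))ᶜ = rseq H r (b + (L + 1) • r) (t - (L + 1)) :=
    compl_rseq hH hgen ht htH hmin b hnt
  rcases hfull with h1 | h2
  · -- exceptional coset = head `E = b + H`; `Xᶜ = (E ∖ X) ∪ block`, hull `(b + (L+1)r) + [0, t−L)R`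
    -- whose tail is `b + t r + H = b + H`
    have hdec : Xᶜ = ((b +ᵥ H) \ X) ∪ rseq H r (b + (L + 1) • r) (t - (L + 1)) := by
      ext y
      rw [mem_compl, mem_union, mem_sdiff, ← hout, mem_compl]
      constructor
      · intro hy
        by_cases hyr : y ∈ rseq H r b (L + 1)
        · left
          refine ⟨?_, hy⟩
          rw [mem_rseq] at hyr
          obtain ⟨j, hj, hyj⟩ := hyr
          rcases Nat.eq_zero_or_pos j with rfl | hjpos
          · rwa [zero_nsmul, add_zero] at hyj
          · exact (hy (h1 j hjpos hj hyj)).elim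
        · right; exact hyr
      · rintro (⟨-, hy⟩ | hy)
        · exact hy
        · exact fun hyX => hy (hXsub hyX)
    by_cases hE : (b +ᵥ H) \ X = ∅
    · -- `X` is the full sequence; complement is the block
      rw [hE, empty_union] at hdec
      rw [hdec]
      have : 1 ≤ t - (L + 1) := by
        by_contra h0
        rw [hdec, show t - (L + 1) = 0 by omega, rseq_zero] at hne
        exact hne.ne_empty rfl
      exact rseq_isFringedSeq hH r _ this
    · have hEne : ((b +ᵥ H) \ X).Nonempty := nonempty_iff_ne_empty.2 hE
      -- hull of `Xᶜ`
      have hhull : Xᶜ + H = rseq H r (b + (L + 1) • r) (t - (L + 1) + 1) := by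
        rw [hdec, union_add, rseq_add hH]
        have h3 : (b +ᵥ H) \ X + H = b +ᵥ H := by
          refine Subset.antisymm ?_ ?_
          · calc (b +ᵥ H) \ X + H ⊆ (b +ᵥ H) + H := add_subset_add_right sdiff_subset
              _ = b +ᵥ H := hH.coset_add b
          · obtain ⟨e, he⟩ := hEne
            intro y hy
            have h' := (hH.mem_coset_iff).1 hy
            have h'' := (hH.mem_coset_iff).1 (mem_sdiff.1 he).1
            refine mem_add.2 ⟨e, he, y - e, ?_, by abel⟩
            have e2 : y - e = (y - b) - (e - b) := by abel
            rw [e2]; exact hH.sub_mem h' h''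
        rw [h3]
        -- `b + H` is the term of index `t − (L+1)` of the new sequence
        ext y
        rw [mem_union, mem_rseq, mem_rseq]
        constructor
        · rintro (hy | ⟨i, hi, hyi⟩)
          · refine ⟨t - (L + 1), by omega, ?_⟩
            rw [hH.mem_coset_iff] at hy ⊢
            have e1 : (L + 1) • r + (t - (L + 1)) • r = t • r := by
              rw [← add_nsmul]; congr 1; omega
            have e : y - (b + (L + 1) • r + (t - (L + 1)) • r) = (y - b) - t • r := by
              rw [add_assoc, e1]; abel
            rw [e]; exact hH.sub_mem hy htH
          · exact ⟨i, by omega, hyi⟩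
        · rintro ⟨i, hi, hyi⟩
          rcases Nat.lt_or_ge i (t - (L + 1)) with hlt | hge
          · right; exact ⟨i, hlt, hyi⟩
          · left
            have : i = t - (L + 1) := by omega
            subst this
            rw [hH.mem_coset_iff] at hyi ⊢
            have e1 : (L + 1) • r + (t - (L + 1)) • r = t • r := by
              rw [← add_nsmul]; congr 1; omega
            have e : y - b = (y - (b + (L + 1) • r + (t - (L + 1)) • r)) + t • r := by
              rw [add_assoc, e1]; abel
            rw [e]; exact hH.add_mem hyi htH
      refine ⟨b + (L + 1) • r, t - (L + 1) + 1, by omega, hhull, Or.inr ?_⟩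
      -- `Xᶜ ∖ tail = block`, `H`-stable
      rw [Nat.add_sub_cancel]
      have htail : (b + (L + 1) • r + (t - (L + 1)) • r) +ᵥ H = b +ᵥ H := by
        have e1 : (L + 1) • r + (t - (L + 1)) • r = t • r := by
          rw [← add_nsmul]; congr 1; omega
        rw [add_assoc, e1]
        refine hH.coset_eq_of_mem ?_
        rw [hH.mem_coset_iff, add_sub_cancel_left]; exact htH
      rw [htail]
      have hsd : Xᶜ \ (b +ᵥ H) = rseq H r (b + (L + 1) • r) (t - (L + 1)) := by
        rw [hdec, union_sdiff_distrib, sdiff_eq_empty_iff_subset.2 sdiff_subset, empty_union]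
        refine sdiff_eq_self_of_disjoint ?_
        rw [← hout]
        exact disjoint_compl_left.mono_right ((coset_subset_rseq H r b (i := 0) (by omega)).trans'
          (by rw [zero_nsmul, add_zero]))
      rw [hsd]; exact rseq_add hH r _ _
  · -- exceptional coset = tail `E = b + L r + H`; `Xᶜ = (E ∖ X) ∪ block`, hull with head `E`
    have hdec : Xᶜ = (((b + L • r) +ᵥ H) \ X) ∪ rseq H r (b + (L + 1) • r) (t - (L + 1)) := by
      ext y
      rw [mem_compl, mem_union, mem_sdiff, ← hout, mem_compl]
      constructor
      · intro hy
        by_cases hyr : y ∈ rseq H r b (L + 1)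
        · left
          refine ⟨?_, hy⟩
          rw [mem_rseq] at hyr
          obtain ⟨j, hj, hyj⟩ := hyr
          rcases Nat.lt_or_ge (j + 1) (L + 1) with hjL | hjL
          · exact (hy (h2 j hjL hyj)).elim
          · have : j = L := by omega
            rwa [this] at hyj
        · right; exact hyr
      · rintro (⟨-, hy⟩ | hy)
        · exact hy
        · exact fun hyX => hy (hXsub hyX)
    by_cases hE : ((b + L • r) +ᵥ H) \ X = ∅
    · rw [hE, empty_union] at hdec
      rw [hdec]
      have : 1 ≤ t - (L + 1) := by
        by_contra h0
        rw [hdec, show t - (L + 1) = 0 by omega, rseq_zero] at hne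
        exact hne.ne_empty rfl
      exact rseq_isFringedSeq hH r _ this
    · have hEne : (((b + L • r) +ᵥ H) \ X).Nonempty := nonempty_iff_ne_empty.2 hE
      have h3 : ((b + L • r) +ᵥ H) \ X + H = (b + L • r) +ᵥ H := by
        refine Subset.antisymm ?_ ?_
        · calc ((b + L • r) +ᵥ H) \ X + H ⊆ ((b + L • r) +ᵥ H) + H :=
              add_subset_add_right sdiff_subset
            _ = (b + L • r) +ᵥ H := hH.coset_add _
        · obtain ⟨e, he⟩ := hEne
          intro y hy
          have h' := (hH.mem_coset_iff).1 hy
          have h'' := (hH.mem_coset_iff).1 (mem_sdiff.1 he).1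
          refine mem_add.2 ⟨e, he, y - e, ?_, by abel⟩
          have e2 : y - e = (y - (b + L • r)) - (e - (b + L • r)) := by abel
          rw [e2]; exact hH.sub_mem h' h''
      -- hull: head `E = b + L r + H`, then the block: `rseq (b + L r) (t − L)`
      have hhull : Xᶜ + H = rseq H r (b + L • r) (t - (L + 1) + 1) := by
        rw [hdec, union_add, rseq_add hH, h3]
        ext y
        rw [mem_union, mem_rseq, mem_rseq]
        constructor
        · rintro (hy | ⟨i, hi, hyi⟩)
          · exact ⟨0, by omega, by rwa [zero_nsmul, add_zero]⟩
          · refine ⟨i + 1, by omega, ?_⟩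
            have e : L • r + (i + 1) • r = (L + 1) • r + i • r := by
              rw [← add_nsmul, ← add_nsmul]; congr 1; omega
            rw [add_assoc, e, ← add_assoc]; exact hyi
        · rintro ⟨i, hi, hyi⟩
          rcases Nat.eq_zero_or_pos i with rfl | hipos
          · left; rwa [zero_nsmul, add_zero] at hyi
          · right
            refine ⟨i - 1, by omega, ?_⟩
            have e : (L + 1) • r + (i - 1) • r = L • r + i • r := by
              rw [← add_nsmul, ← add_nsmul]; congr 1; omega
            rw [add_assoc, e, ← add_assoc]; exact hyi
      refine ⟨b + L • r, t - (L + 1) + 1, by omega, hhull, Or.inl ?_⟩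
      have hsd : Xᶜ \ ((b + L • r) +ᵥ H) = rseq H r (b + (L + 1) • r) (t - (L + 1)) := by
        rw [hdec, union_sdiff_distrib, sdiff_eq_empty_iff_subset.2 sdiff_subset, empty_union]
        refine sdiff_eq_self_of_disjoint ?_
        rw [← hout]
        exact disjoint_compl_left.mono_right (coset_subset_rseq H r b (i := L) (by omega))
      rw [hsd]; exact rseq_add hH r _ _

end SeqCalc

/-! ## Tools for Lemma 7.4: near sequence plus fringed set, `A`-closure, partial cosets -/

section L74Tools

variable [Fintype G] {H A B C X : Finset G} {r b s : G} {n ℓ t : ℕ}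

omit [Fintype G] in
/-- A near sequence `A` (hull `H ∪ … ∪ ℓR`, every coset met) plus a set `X` containing the cosets
`b + jR`, `1 ≤ j < n` (`n ≥ 2`), contains the cosets `b + kR`, `1 ≤ k < ℓ + n` ("the maximality of
`B` implies …" bookkeeping). [cite: BoothbyDevosMontejano2013, Lemma 7.4 (proof)] -/
theorem coset_subset_add_of_tail_full (hH : IsSubgroupCarrier H)
    (hAH : A + H = rseq H r 0 (ℓ + 1)) (hn : 2 ≤ n)
    (hfull : ∀ j : ℕ, 1 ≤ j → j < n → (b + j • r) +ᵥ H ⊆ X) :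
    ∀ k : ℕ, 1 ≤ k → k < ℓ + n → (b + k • r) +ᵥ H ⊆ A + X := by
  intro k hk1 hk2
  obtain ⟨j, hj1, hjn, hjk, hkj⟩ : ∃ j, 1 ≤ j ∧ j < n ∧ j ≤ k ∧ k - j ≤ ℓ := by
    rcases Nat.lt_or_ge ℓ k with h | h
    · exact ⟨k - ℓ, by omega, by omega, by omega, by omega⟩
    · exact ⟨1, le_rfl, by omega, hk1, by omega⟩
  obtain ⟨a, ha⟩ := inter_coset_nonempty_of_add_eq hH hAH (i := k - j) hkj
  rw [mem_inter] at ha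
  have ha2 := (hH.mem_coset_iff).1 ha.2
  have hcos : (b + k • r) +ᵥ H = a +ᵥ ((b + j • r) +ᵥ H) := by
    rw [vadd_vadd]
    refine hH.coset_eq_of_mem ?_
    rw [hH.mem_coset_iff]
    have e1 : (k - j) • r + j • r = k • r := by rw [← add_nsmul, Nat.sub_add_cancel hjk]
    have e : b + k • r - (a + (b + j • r)) = -(a - (k - j) • r) := by rw [← e1]; abel
    rw [e]; exact hH.neg_mem ha2
  rw [hcos]
  exact (vadd_finset_subset_vadd_finset (hfull j hj1 hjn)).trans (vadd_finset_subset_add ha.1)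

omit [Fintype G] in
/-- Head-side version: cosets `b + jR`, `j + 1 < n` (`n ≥ 2`), of `X` full give cosets `b + kR`,
`k + 1 < ℓ + n`, of `A + X`. [cite: BoothbyDevosMontejano2013, Lemma 7.4 (proof)] -/
theorem coset_subset_add_of_head_full (hH : IsSubgroupCarrier H)
    (hAH : A + H = rseq H r 0 (ℓ + 1)) (hn : 2 ≤ n)
    (hfull : ∀ j : ℕ, j + 1 < n → (b + j • r) +ᵥ H ⊆ X) :
    ∀ k : ℕ, k + 1 < ℓ + n → (b + k • r) +ᵥ H ⊆ A + X := by
  intro k hk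
  obtain ⟨j, hjn, hjk, hkj⟩ : ∃ j, j + 1 < n ∧ j ≤ k ∧ k - j ≤ ℓ := by
    rcases Nat.lt_or_ge (n - 2) k with h | h
    · exact ⟨n - 2, by omega, by omega, by omega⟩
    · exact ⟨k, by omega, le_rfl, by omega⟩
  obtain ⟨a, ha⟩ := inter_coset_nonempty_of_add_eq hH hAH (i := k - j) hkj
  rw [mem_inter] at ha
  have ha2 := (hH.mem_coset_iff).1 ha.2
  have hcos : (b + k • r) +ᵥ H = a +ᵥ ((b + j • r) +ᵥ H) := by
    rw [vadd_vadd]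
    refine hH.coset_eq_of_mem ?_
    rw [hH.mem_coset_iff]
    have e1 : (k - j) • r + j • r = k • r := by rw [← add_nsmul, Nat.sub_add_cancel hjk]
    have e : b + k • r - (a + (b + j • r)) = -(a - (k - j) • r) := by rw [← e1]; abel
    rw [e]; exact hH.neg_mem ha2
  rw [hcos]
  exact (vadd_finset_subset_vadd_finset (hfull j hjn)).trans (vadd_finset_subset_add ha.1)

/-- "The maximality of `B` implies that `B` is a fringed `R`-sequence": if `B = third A C`,
`C = third A B`, and `A + B` contains the cosets `b + kR`, `1 ≤ k < ℓ + n`, then `B` contains the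
cosets `b + jR`, `1 ≤ j < n`. [cite: BoothbyDevosMontejano2013, Lemma 7.4 (proof, Claim 4)] -/
theorem coset_subset_of_maximal_tail (hH : IsSubgroupCarrier H) (hA : A ⊆ rseq H r 0 (ℓ + 1))
    (hBmax : B = third A C) (hCmax : C = third A B)
    (hfull : ∀ k : ℕ, 1 ≤ k → k < ℓ + n → (b + k • r) +ᵥ H ⊆ A + B) :
    ∀ j : ℕ, 1 ≤ j → j < n → (b + j • r) +ᵥ H ⊆ B := by
  intro j hj1 hjn x hx
  rw [hBmax, mem_third]
  intro hneg
  obtain ⟨a, ha, c, hc, hac⟩ := mem_add.1 hneg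
  have ha' := hA ha
  rw [mem_rseq] at ha'
  obtain ⟨i, hi, hai⟩ := ha'
  rw [zero_add] at hai
  rw [hCmax, mem_third] at hc
  apply hc
  have e : -c = a + x := by
    have : x = -(a + c) := by rw [hac, neg_neg]
    rw [this]; abel
  rw [e]
  apply hfull (i + j) (by omega) (by omega)
  rw [hH.mem_coset_iff] at hai hx ⊢
  have e2 : a + x - (b + (i + j) • r) = (a - i • r) + (x - (b + j • r)) := by rw [add_nsmul]; abel
  rw [e2]; exact hH.add_mem hai hx

/-- Head-side version of the previous lemma. [cite: BoothbyDevosMontejano2013, Lemma 7.4 (proof, Claim 4)] -/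
theorem coset_subset_of_maximal_head (hH : IsSubgroupCarrier H) (hA : A ⊆ rseq H r 0 (ℓ + 1))
    (hBmax : B = third A C) (hCmax : C = third A B)
    (hfull : ∀ k : ℕ, k + 1 < ℓ + n → (b + k • r) +ᵥ H ⊆ A + B) :
    ∀ j : ℕ, j + 1 < n → (b + j • r) +ᵥ H ⊆ B := by
  intro j hjn x hx
  rw [hBmax, mem_third]
  intro hneg
  obtain ⟨a, ha, c, hc, hac⟩ := mem_add.1 hneg
  have ha' := hA ha
  rw [mem_rseq] at ha'
  obtain ⟨i, hi, hai⟩ := ha'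
  rw [zero_add] at hai
  rw [hCmax, mem_third] at hc
  apply hc
  have e : -c = a + x := by
    have : x = -(a + c) := by rw [hac, neg_neg]
    rw [this]; abel
  rw [e]
  apply hfull (i + j) (by omega)
  rw [hH.mem_coset_iff] at hai hx ⊢
  have e2 : a + x - (b + (i + j) • r) = (a - i • r) + (x - (b + j • r)) := by rw [add_nsmul]; abel
  rw [e2]; exact hH.add_mem hai hx

/-- The third set of `A` and one coset `s + H`: `third A (s + H) = (r − s) + [0, t − ℓ − 1)R` (an
`R`-sequence of `t − ℓ − 1` cosets). [cite: BoothbyDevosMontejano2013, Lemma 7.4 (proof, Claim 5)] -/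
theorem third_coset_eq (hH : IsSubgroupCarrier H) (hgen : IsCyclicQuotGen H r) (ht : 0 < t)
    (htH : t • r ∈ H) (hmin : ∀ s : ℕ, 0 < s → s < t → s • r ∉ H)
    (hAH : A + H = rseq H r 0 (ℓ + 1)) (hlt : ℓ + 1 < t) (s : G) :
    third A (s +ᵥ H) = rseq H r (r - s) (t - (ℓ + 1)) := by
  rw [third, Grynkiewicz.add_vadd_finset, hAH, vadd_rseq, add_zero]
  exact compl_neg_rseq hH hgen ht htH hmin s (by omega) hlt

omit [Fintype G] [DecidableEq G] in
/-- `A`-CLOSURE: every trio `(A, B', C')` lies in a trio `(A, B'', C'')` which is maximal for fixed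
`A`, i.e. `C'' = third A B''` and `B'' = third A C''` (take `C'' = third A B'`, `B'' = third A C''`).
[cite: BoothbyDevosMontejano2013, Lemma 7.4 (proof)] -/
theorem exists_closure [Fintype G] [DecidableEq G] {B' C' : Finset G} (h : IsTrio A B' C') :
    ∃ B'' C'' : Finset G, B' ⊆ B'' ∧ C' ⊆ C'' ∧ C'' = third A B'' ∧ B'' = third A C'' ∧
      IsTrio A B'' C'' := by
  refine ⟨third A (third A B'), third A B', ?_, isTrio_iff_subset_third.1 h, ?_, rfl, ?_⟩
  · exact isTrio_iff_subset_third.1 (isTrio_third A B').swap_right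
  · refine Subset.antisymm ?_ (third_mono Subset.rfl
      (isTrio_iff_subset_third.1 (isTrio_third A B').swap_right))
    exact isTrio_iff_subset_third.1 (isTrio_third A (third A B')).swap_right
  · exact (isTrio_third A (third A B')).swap_right

/-- The PARTIAL COSETS of `X`: indices `j < t` with `∅ ≠ X ∩ (jr + H) ≠ jr + H` (the quantity
`|{S ∈ G/H : ∅ ≠ S ∩ B ≠ S}|` minimised in the proof of Lemma 7.4).
[cite: BoothbyDevosMontejano2013, Lemma 7.4 (proof)] -/
def partialCosets (H : Finset G) (r : G) (t : ℕ) (X : Finset G) : Finset ℕ :=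
  (range t).filter fun j => (X ∩ ((j • r) +ᵥ H)).Nonempty ∧ ¬ (j • r) +ᵥ H ⊆ X

omit [Fintype G] in
/-- Unfolding lemma. [cite: BoothbyDevosMontejano2013, Lemma 7.4 (proof)] -/
theorem mem_partialCosets {j : ℕ} : j ∈ partialCosets H r t X ↔
    j < t ∧ (X ∩ ((j • r) +ᵥ H)).Nonempty ∧ ¬ (j • r) +ᵥ H ⊆ X := by
  rw [partialCosets, mem_filter, mem_range]

omit [Fintype G] in
/-- There are at most `t` partial cosets. [cite: BoothbyDevosMontejano2013, Lemma 7.4 (proof)] -/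
theorem card_partialCosets_le : #(partialCosets H r t X) ≤ t :=
  (card_filter_le _ _).trans (card_range t).le

omit [Fintype G] in
/-- Filling a partial coset `j₀` of `X` removes it from the partial cosets and changes no other.
[cite: BoothbyDevosMontejano2013, Lemma 7.4 (proof)] -/
theorem card_partialCosets_union_lt (hH : IsSubgroupCarrier H)
    (hmin : ∀ s : ℕ, 0 < s → s < t → s • r ∉ H) {j₀ : ℕ} (hj₀ : j₀ ∈ partialCosets H r t X) :
    #(partialCosets H r t (X ∪ ((j₀ • r) +ᵥ H))) < #(partialCosets H r t X) := by
  have hsub : partialCosets H r t (X ∪ ((j₀ • r) +ᵥ H)) ⊆ (partialCosets H r t X).erase j₀ := by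
    intro j hj
    rw [mem_partialCosets] at hj
    obtain ⟨hjt, hne, hns⟩ := hj
    have hjj : j ≠ j₀ := by rintro rfl; exact hns subset_union_right
    rw [mem_erase, mem_partialCosets]
    have hdis : Disjoint ((j • r) +ᵥ H) ((j₀ • r) +ᵥ H) := by
      rcases Nat.lt_or_gt_of_ne hjj with hlt | hlt
      · have := disjoint_coset_of_lt hH hmin 0 hlt (mem_partialCosets.1 hj₀).1
        rwa [zero_add, zero_add] at this
      · have := disjoint_coset_of_lt hH hmin 0 hlt hjt
        rw [zero_add, zero_add] at this; exact this.symm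
    refine ⟨hjj, hjt, ?_, fun h => hns (h.trans subset_union_left)⟩
    obtain ⟨y, hy⟩ := hne
    rw [mem_inter, mem_union] at hy
    rcases hy.1 with hyX | hyS
    · exact ⟨y, mem_inter.2 ⟨hyX, hy.2⟩⟩
    · exact (disjoint_left.1 hdis hy.2 hyS).elim
  exact (card_le_card hsub).trans_lt (card_erase_lt_of_mem hj₀)

omit [Fintype G] in
/-- Intersecting with an `H`-stable set does not create partial cosets.
[cite: BoothbyDevosMontejano2013, Lemma 7.4 (proof)] -/
theorem partialCosets_inter_subset (hH : IsSubgroupCarrier H) {Y : Finset G} (hY : Y + H = Y) :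
    partialCosets H r t (X ∩ Y) ⊆ partialCosets H r t X := by
  intro j hj
  rw [mem_partialCosets] at hj ⊢
  obtain ⟨hjt, ⟨y, hy⟩, hns⟩ := hj
  rw [mem_inter, mem_inter] at hy
  refine ⟨hjt, ⟨y, mem_inter.2 ⟨hy.1.1, hy.2⟩⟩, fun h => hns (subset_inter h ?_)⟩
  have := hH.coset_subset_of_stable hY hy.1.2
  rwa [hH.coset_eq_of_mem hy.2] at this

end L74Tools

/-! ## Lemma 7.3 with its concrete output (hull of `B`, full cosets of `A + B`) for normalised `A` -/

section Lemma73Concrete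

variable [Fintype G] {H A B : Finset G} {r b : G} {n ℓ t : ℕ}

/-- Lemma 7.3 for `A` in normal position and `B` arbitrary, with the data its proof produces: the hull
`B + H = b₀ + [0, m+1)R` (`m ≥ 1`, `ℓ + m + 1 < t`) and the full cosets of `A + B` (all of
`b₀ + kR`, `1 ≤ k ≤ ℓ + m`, or all of `b₀ + kR`, `0 ≤ k ≤ ℓ + m − 1`).
[cite: BoothbyDevosMontejano2013, Lemma 7.3] -/
theorem hull_and_full_of_critical (hH : IsSubgroupCarrier H) (hgen : IsCyclicQuotGen H r)
    (ht : 0 < t) (htH : t • r ∈ H) (hmin : ∀ s : ℕ, 0 < s → s < t → s • r ∉ H)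
    (hAH : A + H = rseq H r 0 (ℓ + 1)) (hnear : #((A + H) \ A) < #H) (hℓ : 1 ≤ ℓ)
    (hBc : ∀ c : G, ¬ B ⊆ c +ᵥ H) (hBs : B ⊆ rseq H r b n) (hABs : A + rseq H r b n ≠ univ)
    (hcrit : #(A + B) < #A + #B) :
    ∃ b₀ : G, ∃ m : ℕ, 1 ≤ m ∧ ℓ + m + 1 < t ∧ B + H = rseq H r b₀ (m + 1) ∧
      ((∀ k : ℕ, 1 ≤ k → k ≤ ℓ + m → (b₀ + k • r) +ᵥ H ⊆ A + B) ∨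
        (∀ k : ℕ, k + 1 ≤ ℓ + m → (b₀ + k • r) +ᵥ H ⊆ A + B)) := by
  have hBne : B.Nonempty := by
    rw [nonempty_iff_ne_empty]; rintro rfl; exact hBc 0 (empty_subset _)
  have hn1 : 1 ≤ n := by
    by_contra h0
    have : n = 0 := by omega
    rw [this, rseq_zero] at hBs
    exact hBne.ne_empty (subset_empty.1 hBs)
  have hsum : A + rseq H r b n = rseq H r b (ℓ + 1 + n - 1) := by
    have : A + rseq H r b n = (A + H) + rseq H r b n := by
      rw [add_assoc, add_comm H, rseq_add hH]
    rw [this, hAH, rseq_add_rseq hH r 0 b (by omega) hn1, zero_add]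
  have hlt : ℓ + 1 + n - 1 < t := lt_of_rseq_ne_univ hH hgen ht htH (hsum ▸ hABs)
  set J := (range n).filter fun j => (B ∩ ((b + j • r) +ᵥ H)).Nonempty with hJdef
  have hmemJ : ∀ x ∈ B, ∃ j ∈ J, x ∈ (b + j • r) +ᵥ H := by
    intro x hx
    have hx' := hBs hx
    rw [mem_rseq] at hx'
    obtain ⟨j, hj, hxj⟩ := hx'
    exact ⟨j, mem_filter.2 ⟨mem_range.2 hj, x, mem_inter.2 ⟨hx, hxj⟩⟩, hxj⟩
  have hJne : J.Nonempty := by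
    obtain ⟨x, hx⟩ := hBne
    obtain ⟨j, hj, -⟩ := hmemJ x hx
    exact ⟨j, hj⟩
  set j₀ := J.min' hJne with hj₀def
  set j₁ := J.max' hJne with hj₁def
  have hj₀J : j₀ ∈ J := min'_mem _ _
  have hj₁J : j₁ ∈ J := max'_mem _ _
  have hj₀₁ : j₀ ≤ j₁ := min'_le _ _ hj₁J
  have hj₁n : j₁ < n := mem_range.1 (mem_filter.1 hj₁J).1
  have hm : 1 ≤ j₁ - j₀ := by
    by_contra h0
    apply hBc (b + j₀ • r)
    intro x hx
    obtain ⟨j, hj, hxj⟩ := hmemJ x hx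
    have h1 : j₀ ≤ j := min'_le _ _ hj
    have h2 : j ≤ j₁ := le_max' _ _ hj
    have : j = j₀ := by omega
    rwa [this] at hxj
  set gB : G := -(b + j₀ • r) with hgB
  have hB'sub : gB +ᵥ B ⊆ rseq H r 0 (j₁ - j₀ + 1) := by
    intro y hy
    rw [mem_vadd_finset] at hy
    obtain ⟨x, hx, rfl⟩ := hy
    obtain ⟨j, hj, hxj⟩ := hmemJ x hx
    have h1 : j₀ ≤ j := min'_le _ _ hj
    have h2 : j ≤ j₁ := le_max' _ _ hj
    rw [mem_rseq]
    refine ⟨j - j₀, by omega, ?_⟩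
    rw [hH.mem_coset_iff] at hxj ⊢
    have e : (gB +ᵥ x) - (0 + (j - j₀) • r) = x - (b + j • r) := by
      rw [hgB, vadd_eq_add, zero_add]
      have : j₀ • r + (j - j₀) • r = j • r := by rw [← add_nsmul, Nat.add_sub_cancel' h1]
      rw [← this]; abel
    rw [e]; exact hxj
  have hB'0 : ((gB +ᵥ B) ∩ H).Nonempty := by
    obtain ⟨x, hx⟩ := (mem_filter.1 hj₀J).2
    rw [mem_inter] at hx
    refine ⟨gB +ᵥ x, mem_inter.2 ⟨vadd_mem_vadd_finset hx.1, ?_⟩⟩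
    have := (hH.mem_coset_iff).1 hx.2
    have e : gB +ᵥ x = x - (b + j₀ • r) := by rw [hgB, vadd_eq_add]; abel
    rw [e]; exact this
  have hB'm : ((gB +ᵥ B) ∩ (((j₁ - j₀) • r) +ᵥ H)).Nonempty := by
    obtain ⟨x, hx⟩ := (mem_filter.1 hj₁J).2
    rw [mem_inter] at hx
    refine ⟨gB +ᵥ x, mem_inter.2 ⟨vadd_mem_vadd_finset hx.1, ?_⟩⟩
    have := (hH.mem_coset_iff).1 hx.2
    rw [hH.mem_coset_iff]
    have e : (gB +ᵥ x) - (j₁ - j₀) • r = x - (b + j₁ • r) := by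
      rw [hgB, vadd_eq_add]
      have : j₀ • r + (j₁ - j₀) • r = j₁ • r := by rw [← add_nsmul, Nat.add_sub_cancel' hj₀₁]
      rw [← this]; abel
    rw [e]; exact this
  have hAB' : A + (gB +ᵥ B) = gB +ᵥ (A + B) := Grynkiewicz.add_vadd_finset A B gB
  have hcrit' : #(A + (gB +ᵥ B)) < #A + #(gB +ᵥ B) := by
    rw [hAB', card_vadd_finset, card_vadd_finset]; exact hcrit
  have hcore := head_or_tail_full_of_critical hH hmin hAH hnear hℓ (gB +ᵥ B) (j₁ - j₀) hB'sub hB'0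
    hB'm hm (by omega) hcrit'
  have hBi := forall_inter_coset_nonempty_of_critical hH hmin hAH hnear hℓ hB'sub hB'0 hB'm
    (by omega) hcrit'
  -- hull of `B`
  have hBH : B + H = rseq H r (b + j₀ • r) (j₁ - j₀ + 1) := by
    have h1 : (gB +ᵥ B) + H = rseq H r 0 (j₁ - j₀ + 1) := by
      refine Subset.antisymm ?_ ?_
      · calc (gB +ᵥ B) + H ⊆ rseq H r 0 (j₁ - j₀ + 1) + H := add_subset_add_right hB'sub
          _ = _ := rseq_add hH r 0 _
      · intro x hx
        rw [mem_rseq] at hx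
        obtain ⟨i, hi, hxi⟩ := hx
        rw [zero_add] at hxi
        obtain ⟨y, hy⟩ := hBi i (by omega)
        rw [mem_inter] at hy
        have e1 := (hH.mem_coset_iff).1 hxi
        have e2 := (hH.mem_coset_iff).1 hy.2
        refine mem_add.2 ⟨y, hy.1, x - y, ?_, by abel⟩
        have e : x - y = (x - i • r) - (y - i • r) := by abel
        rw [e]; exact hH.sub_mem e1 e2
    have h2 : B + H = (-gB) +ᵥ ((gB +ᵥ B) + H) := by
      rw [vadd_add_assoc, neg_vadd_vadd]
    rw [h2, h1, vadd_rseq, add_zero, hgB, neg_neg]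
  refine ⟨b + j₀ • r, j₁ - j₀, hm, by omega, hBH, ?_⟩
  -- translate the full cosets back
  have hback : ∀ k : ℕ, (k • r) +ᵥ H ⊆ A + (gB +ᵥ B) → (b + j₀ • r + k • r) +ᵥ H ⊆ A + B := by
    intro k hk
    rw [hAB'] at hk
    have := vadd_finset_subset_vadd_finset (a := -gB) hk
    rwa [neg_vadd_vadd, vadd_vadd, hgB, neg_neg] at this
  rcases hcore with h | h
  · left; intro k hk1 hk2; exact hback k (h k hk1 hk2)
  · right; intro k hk; exact hback k (h k hk)

end Lemma73Concrete

/-! ## Lemma 7.4 -/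

section Lemma74

variable [Fintype G] {H A B C X : Finset G} {r b c : G} {ℓ t : ℕ}

omit [Fintype G] in
/-- Outside its head coset `b + H`, everything lies in `(b + r) + [0, t−1)R`. [cite: BoothbyDevosMontejano2013, §4] -/
theorem mem_rseq_of_not_mem_head (hH : IsSubgroupCarrier H) (hgen : IsCyclicQuotGen H r)
    (ht : 0 < t) (htH : t • r ∈ H) {y : G} (hy : y ∉ b +ᵥ H) : y ∈ rseq H r (b + r) (t - 1) := by
  obtain ⟨j, hjt, hj⟩ := exists_index_lt hH hgen ht htH (-b + y)
  have hj' := (hH.mem_coset_iff).1 hj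
  have hj0 : j ≠ 0 := by
    rintro rfl
    apply hy
    rw [hH.mem_coset_iff]
    rw [zero_nsmul, sub_zero] at hj'
    have e : y - b = -b + y := by abel
    rw [e]; exact hj'
  rw [mem_rseq]
  refine ⟨j - 1, by omega, ?_⟩
  rw [hH.mem_coset_iff]
  have e1 : r + (j - 1) • r = j • r := by rw [add_comm, ← succ_nsmul, Nat.sub_add_cancel (by omega)]
  have e : y - (b + r + (j - 1) • r) = -b + y - j • r := by rw [add_assoc, e1]; abel
  rw [e]; exact hj'

omit [Fintype G] in
/-- Outside the coset `b + (t−1)r + H`, everything lies in `b + [0, t−1)R`. [cite: BoothbyDevosMontejano2013, §4] -/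
theorem mem_rseq_of_not_mem_tail (hH : IsSubgroupCarrier H) (hgen : IsCyclicQuotGen H r)
    (ht : 0 < t) (htH : t • r ∈ H) {y : G} (hy : y ∉ (b + (t - 1) • r) +ᵥ H) :
    y ∈ rseq H r b (t - 1) := by
  obtain ⟨j, hjt, hj⟩ := exists_index_lt hH hgen ht htH (-b + y)
  have hj' := (hH.mem_coset_iff).1 hj
  have hjt' : j ≠ t - 1 := by
    rintro rfl
    apply hy
    rw [hH.mem_coset_iff]
    have e : y - (b + (t - 1) • r) = -b + y - (t - 1) • r := by abel
    rw [e]; exact hj'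
  rw [mem_rseq]
  refine ⟨j, by omega, ?_⟩
  rw [hH.mem_coset_iff]
  have e : y - (b + j • r) = -b + y - j • r := by abel
  rw [e]; exact hj'

omit [Fintype G] [DecidableEq G] in
/-- Union in the middle slot of two trios with the same outer members. [cite: BoothbyDevosMontejano2013, §3] -/
theorem IsTrio.union_left [DecidableEq G] {B₁ B₂ : Finset G} (h₁ : IsTrio A B₁ C)
    (h₂ : IsTrio A B₂ C) : IsTrio A (B₁ ∪ B₂) C := by
  unfold IsTrio at *
  rw [add_union, union_add, mem_union, not_or]
  exact ⟨h₁, h₂⟩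

/-- For a trio `(A, X, C')`: `δ(A, X, C') ≤ δ(A, C') = |A| + |C'| − |A + C'|`.
[cite: BoothbyDevosMontejano2013, Lemma 7.4 (proof)] -/
theorem IsTrio.trioDeficiency_le_pair {C' : Finset G} (h : IsTrio A X C') :
    trioDeficiency A X C' ≤ (#A : ℤ) + #C' - #(A + C') := by
  have h1 := card_le_card (isTrio_iff_subset_third.1 h.swap_right)
  have h2 := card_third_add_card_add A C'
  unfold trioDeficiency
  omega

omit [Fintype G] in
/-- Lemma 6.2 in translated form: for `∅ ≠ C' ⊆ c + H` and `(A, H)` critical,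
`δ(A, C') ≤ δ(A, H)`. [cite: BoothbyDevosMontejano2013, Lemma 6.2] -/
theorem pair_le_of_subset_coset (hH : IsSubgroupCarrier H) (hcritH : #(A + H) < #A + #H)
    (hA : A.Nonempty) (hX : X.Nonempty) (hXc : X ⊆ c +ᵥ H) :
    (#A : ℤ) + #X - #(A + X) ≤ #A + #H - #(A + H) := by
  have hsub : (-c) +ᵥ X ⊆ H := by
    intro y hy
    rw [mem_vadd_finset] at hy
    obtain ⟨x, hx, rfl⟩ := hy
    have := (hH.mem_coset_iff).1 (hXc hx)
    rw [vadd_eq_add]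
    have e : -c + x = x - c := by abel
    rw [e]; exact this
  have := card_add_card_add_le_of_subset_carrier hH hcritH hA (hX.vadd_finset (a := -c)) hsub
  rw [card_vadd_finset, Grynkiewicz.add_vadd_finset, card_vadd_finset] at this
  omega

/-- The MEASURE of the double-extremal choice in the proof of Lemma 7.4: first `δ(A,B,C)` maximal
(i.e. `|G| − |B| − |C|` minimal), then the number of partial cosets of `B` and `C` minimal.
[cite: BoothbyDevosMontejano2013, Lemma 7.4 (proof)] -/
def l74Measure (H : Finset G) (r : G) (t : ℕ) (B C : Finset G) : ℕ :=
  (Fintype.card G - #B - #C) * (2 * t + 1) + #(partialCosets H r t B) + #(partialCosets H r t C)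

/-- Unfolding lemma. [cite: BoothbyDevosMontejano2013, Lemma 7.4 (proof)] -/
theorem l74Measure_def (B C : Finset G) : l74Measure H r t B C =
    (Fintype.card G - #B - #C) * (2 * t + 1) + #(partialCosets H r t B) +
      #(partialCosets H r t C) := rfl

/-- The measure decreases when the trio grows (`|B₁| + |C₁| > |B| + |C|`), or keeps its size and
loses partial cosets. [cite: BoothbyDevosMontejano2013, Lemma 7.4 (proof)] -/
theorem l74Measure_lt {B₁ C₁ : Finset G} (hG : #B₁ + #C₁ ≤ Fintype.card G)
    (h : #B + #C < #B₁ + #C₁ ∨ (#B + #C ≤ #B₁ + #C₁ ∧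
      #(partialCosets H r t B₁) + #(partialCosets H r t C₁) <
        #(partialCosets H r t B) + #(partialCosets H r t C))) :
    l74Measure H r t B₁ C₁ < l74Measure H r t B C := by
  rw [l74Measure_def, l74Measure_def]
  have hp1 := card_partialCosets_le (H := H) (r := r) (t := t) (X := B₁)
  have hp2 := card_partialCosets_le (H := H) (r := r) (t := t) (X := C₁)
  rcases h with h | ⟨h1, h2⟩
  · have h3 : Fintype.card G - #B₁ - #C₁ + 1 ≤ Fintype.card G - #B - #C := by omega
    have h4 := Nat.mul_le_mul_right (2 * t + 1) h3
    rw [Nat.add_mul, one_mul] at h4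
    omega
  · have h3 : Fintype.card G - #B₁ - #C₁ ≤ Fintype.card G - #B - #C := by omega
    have h4 := Nat.mul_le_mul_right (2 * t + 1) h3
    omega

/-- The exit of the proof of Lemma 7.4 through Lemma 7.3 (the situation excluded by Claim 4): if
`B` lies in an `R`-sequence `D` with `A + D ≠ G`, then `A + B` is fringed (Lemma 7.3), hence `B` is
fringed "by the maximality of `B`", and `C = \overline{−(A+B)}` is fringed.
[cite: BoothbyDevosMontejano2013, Lemma 7.4 (proof, Claim 4)] -/
theorem l74_of_subset_rseq (hH : IsSubgroupCarrier H) (hgen : IsCyclicQuotGen H r) (ht : 0 < t)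
    (htH : t • r ∈ H) (hmin : ∀ s : ℕ, 0 < s → s < t → s • r ∉ H)
    (hAH : A + H = rseq H r 0 (ℓ + 1)) (hnear : #((A + H) \ A) < #H) (hℓ : 1 ≤ ℓ)
    (htrio : IsTrio A B C) (hδ : 0 < trioDeficiency A B C) (hCmax : C = third A B)
    (hBmax : B = third A C) (hBc : ∀ c : G, ¬ B ⊆ c +ᵥ H) (hCne : C.Nonempty) {n : ℕ}
    (hBs : B ⊆ rseq H r b n) (hABs : A + rseq H r b n ≠ univ) :
    IsFringedSeq H r B ∧ IsFringedSeq H r C := by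
  have hAsub : A ⊆ rseq H r 0 (ℓ + 1) := by rw [← hAH]; exact hH.subset_add A
  have hcrit : #(A + B) < #A + #B := by
    have h1 := card_le_card (isTrio_iff_subset_third.1 htrio)
    have h2 := card_third_add_card_add A B
    unfold trioDeficiency at hδ; omega
  obtain ⟨b₀, m, hm, hlmt, hBH, hfull⟩ :=
    hull_and_full_of_critical hH hgen ht htH hmin hAH hnear hℓ hBc hBs hABs hcrit
  have hABH : (A + B) + H = rseq H r b₀ (ℓ + m + 1) := by
    rw [add_assoc, hBH]
    have : A + rseq H r b₀ (m + 1) = (A + H) + rseq H r b₀ (m + 1) := by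
      rw [add_assoc, add_comm H, rseq_add hH]
    rw [this, hAH, rseq_add_rseq hH r 0 b₀ (by omega) (by omega), zero_add,
      show ℓ + 1 + (m + 1) - 1 = ℓ + m + 1 by omega]
  have hCeq : C = (-(A + B))ᶜ := by rw [hCmax, third]
  have hCfr : IsFringedSeq H r (A + B) → IsFringedSeq H r C := fun h => by
    rw [hCeq]
    refine (h.neg hH hgen ht htH hmin).compl hH hgen ht htH hmin ?_
    rw [← hCeq]; exact hCne
  rcases hfull with h | h
  · have hBfull := coset_subset_of_maximal_tail hH hAsub hBmax hCmax (n := m + 1) (b := b₀)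
      (fun k hk1 hk2 => h k hk1 (by omega))
    exact ⟨isFringedSeq_of_tail_full' hH hmin hBH (by omega) fun s hs1 hs2 => hBfull s hs1 (by omega),
      hCfr (isFringedSeq_of_tail_full' hH hmin hABH (by omega) h)⟩
  · have hBfull := coset_subset_of_maximal_head hH hAsub hBmax hCmax (n := m + 1) (b := b₀)
      (fun k hk => h k (by omega))
    exact ⟨isFringedSeq_of_head_full' hH hmin hBH (by omega) fun s hs => hBfull s (by omega),
      hCfr (isFringedSeq_of_head_full' hH hmin hABH (by omega) h)⟩

/-- THE MAIN STEP of the proof of Lemma 7.4 for `|C| > |H|`, the lemma being known for all pairs of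
smaller measure (Claims 4 and 5, the coset `S`, the trio `(A, B', C')`, its `A`-closure, the coset
`T ⊇ C''`, the cosets `U ⊆ third(A + T)`, the trio `(A, B ∩ third(A+T), C ∪ T)` — as printed).
[cite: BoothbyDevosMontejano2013, Lemma 7.4 (proof)] -/
theorem l74_main (hH : IsSubgroupCarrier H) (hgen : IsCyclicQuotGen H r) (ht : 0 < t)
    (htH : t • r ∈ H) (hmin : ∀ s : ℕ, 0 < s → s < t → s • r ∉ H)
    (hAH : A + H = rseq H r 0 (ℓ + 1)) (hnear : #((A + H) \ A) < #H) (hℓ : 1 ≤ ℓ)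
    (hlt3 : ℓ + 3 ≤ t)
    (htrio : IsTrio A B C) (hδ : 0 < trioDeficiency A B C) (hCmax : C = third A B)
    (hBmax : B = third A C) (hBc : ∀ c : G, ¬ B ⊆ c +ᵥ H) (hCc : ∀ c : G, ¬ C ⊆ c +ᵥ H)
    (hHC : #H < #C)
    (ih : ∀ B₁ C₁ : Finset G, l74Measure H r t B₁ C₁ < l74Measure H r t B C →
      IsTrio A B₁ C₁ → 0 < trioDeficiency A B₁ C₁ → C₁ = third A B₁ → B₁ = third A C₁ →
      (∀ c : G, ¬ B₁ ⊆ c +ᵥ H) → (∀ c : G, ¬ C₁ ⊆ c +ᵥ H) →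
      IsFringedSeq H r B₁ ∧ IsFringedSeq H r C₁) :
    IsFringedSeq H r B ∧ IsFringedSeq H r C := by
  have hHpos := hH.nonempty.card_pos
  have hsucc : ∀ i : ℕ, r + i • r = (i + 1) • r := fun i => by rw [add_nsmul, one_nsmul, add_comm]
  have hA : A.Nonempty := by
    rw [nonempty_iff_ne_empty]; rintro rfl
    rw [empty_add] at hAH
    exact (rseq_nonempty hH r 0 (by omega : 1 ≤ ℓ + 1)).ne_empty hAH.symm
  have hcritH : #(A + H) < #A + #H := by
    have := card_sdiff_add_card_eq_card (hH.subset_add A); omega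
  have hBne : B.Nonempty := by
    rw [nonempty_iff_ne_empty]; rintro rfl; exact hBc 0 (empty_subset _)
  have hCne : C.Nonempty := card_pos.1 (by omega)
  have hGBC : ∀ {B₁ C₁ : Finset G}, IsTrio A B₁ C₁ → #B₁ + #C₁ ≤ Fintype.card G := by
    intro B₁ C₁ h
    have h1 := card_le_card (isTrio_iff_subset_third.1 h)
    have h2 := card_third_add_card_add A B₁
    have h3 : #B₁ ≤ #(A + B₁) := card_le_card_add_left hA
    omega
  -- Claim 4: the exits through Lemma 7.3
  by_cases hDB : ∃ b : G, ∃ n : ℕ, B ⊆ rseq H r b n ∧ A + rseq H r b n ≠ univ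
  · obtain ⟨b, n, h1, h2⟩ := hDB
    exact l74_of_subset_rseq hH hgen ht htH hmin hAH hnear hℓ htrio hδ hCmax hBmax hBc hCne h1 h2
  by_cases hDC : ∃ c : G, ∃ n : ℕ, C ⊆ rseq H r c n ∧ A + rseq H r c n ≠ univ
  · obtain ⟨c, n, h1, h2⟩ := hDC
    have := l74_of_subset_rseq hH hgen ht htH hmin hAH hnear hℓ htrio.swap_right
      (by rwa [trioDeficiency_swap_right]) hBmax hCmax hCc hBne h1 h2
    exact ⟨this.2, this.1⟩
  -- Claim 5: no full coset inside `B` or `C`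
  have hAD : ∀ j : ℕ, A + rseq H r (r - j • r) (t - (ℓ + 1)) ≠ univ := by
    intro j
    have : A + rseq H r (r - j • r) (t - (ℓ + 1)) =
        rseq H r (r - j • r) (ℓ + 1 + (t - (ℓ + 1)) - 1) := by
      have e : A + rseq H r (r - j • r) (t - (ℓ + 1)) =
          (A + H) + rseq H r (r - j • r) (t - (ℓ + 1)) := by
        rw [add_assoc, add_comm H, rseq_add hH]
      rw [e, hAH, rseq_add_rseq hH r 0 _ (by omega) (by omega), zero_add]
    rw [this]
    exact rseq_ne_univ_of_lt hH hgen ht htH hmin _ (by omega)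
  have h5B : ∀ j : ℕ, ¬ (j • r) +ᵥ H ⊆ B := by
    intro j hS
    apply hDC
    refine ⟨r - j • r, t - (ℓ + 1), ?_, hAD j⟩
    rw [hCmax, ← third_coset_eq hH hgen ht htH hmin hAH (by omega) (j • r)]
    exact third_mono Subset.rfl hS
  have h5C : ∀ j : ℕ, ¬ (j • r) +ᵥ H ⊆ C := by
    intro j hS
    apply hDB
    refine ⟨r - j • r, t - (ℓ + 1), ?_, hAD j⟩
    rw [hBmax, ← third_coset_eq hH hgen ht htH hmin hAH (by omega) (j • r)]
    exact third_mono Subset.rfl hS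
  -- a partial coset `S = j₀ r + H` of `B`
  obtain ⟨x₀, hx₀⟩ := hBne
  obtain ⟨j₀, hj₀t, hj₀⟩ := exists_index_lt hH hgen ht htH x₀
  have hSB : (B ∩ ((j₀ • r) +ᵥ H)).Nonempty := ⟨x₀, mem_inter.2 ⟨hx₀, hj₀⟩⟩
  have hj₀p : j₀ ∈ partialCosets H r t B := mem_partialCosets.2 ⟨hj₀t, hSB, h5B j₀⟩
  -- `B' = B ∪ S`, `C' = C ∩ third A S`
  have hpur := htrio.trioDeficiency_le_purify hA hH hcritH (j₀ • r) hSB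
  have htrio' := htrio.union_inter ((j₀ • r) +ᵥ H)
  have hthirdS : third A ((j₀ • r) +ᵥ H) + H = third A ((j₀ • r) +ᵥ H) := by
    rw [third_coset_eq hH hgen ht htH hmin hAH (by omega)]; exact rseq_add hH r _ _
  have hBS : #(B ∪ ((j₀ • r) +ᵥ H)) + 1 ≤ #B + #H := by
    have h1 := card_union_add_card_inter B ((j₀ • r) +ᵥ H)
    have h2 := hSB.card_pos
    rw [card_vadd_finset] at h1; omega
  have hC'ne : (C ∩ third A ((j₀ • r) +ᵥ H)).Nonempty := by
    rw [← card_pos]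
    unfold trioDeficiency at hpur
    omega
  have hδ' : 0 < trioDeficiency A (B ∪ ((j₀ • r) +ᵥ H)) (C ∩ third A ((j₀ • r) +ᵥ H)) :=
    lt_of_lt_of_le hδ hpur
  have hsum' : #B + #C ≤ #(B ∪ ((j₀ • r) +ᵥ H)) + #(C ∩ third A ((j₀ • r) +ᵥ H)) := by
    unfold trioDeficiency at hpur; omega
  obtain ⟨B'', C'', hB'', hC'', hC''max, hB''max, htrio''⟩ := exists_closure htrio'
  have hδ'' : 0 < trioDeficiency A B'' C'' :=
    lt_of_lt_of_le hδ' (trioDeficiency_mono Subset.rfl hB'' hC'')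
  have hB''c : ∀ c : G, ¬ B'' ⊆ c +ᵥ H :=
    fun c h => hBc c ((subset_union_left.trans hB'').trans h)
  have hC''ne : C''.Nonempty := hC'ne.mono hC''
  -- the measure drops
  have hμ : l74Measure H r t B'' C'' < l74Measure H r t B C := by
    refine l74Measure_lt (hGBC htrio'') ?_
    by_cases heq : B'' = B ∪ ((j₀ • r) +ᵥ H) ∧ C'' = C ∩ third A ((j₀ • r) +ᵥ H)
    · obtain ⟨rfl, rfl⟩ := heq
      right
      have h1 := card_partialCosets_union_lt hH hmin hj₀p
      have h2 := card_le_card (partialCosets_inter_subset hH (X := C) (r := r) (t := t) hthirdS)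
      exact ⟨hsum', by omega⟩
    · left
      rcases not_and_or.1 heq with hne | hne
      · have := card_lt_card (hB''.ssubset_of_ne (Ne.symm hne))
        have := card_le_card hC''; omega
      · have := card_lt_card (hC''.ssubset_of_ne (Ne.symm hne))
        have := card_le_card hB''; omega
  by_cases hC''c : ∃ c : G, C'' ⊆ c +ᵥ H
  · ---------------------------------------------------------------- `C'' ⊆ T`, a single coset
    obtain ⟨c, hc⟩ := hC''c
    obtain ⟨jT, hjTt, hjT⟩ := exists_index_lt hH hgen ht htH c
    rw [hH.coset_eq_of_mem hjT] at hc
    have hC'T : C ∩ third A ((j₀ • r) +ᵥ H) ⊆ (jT • r) +ᵥ H := hC''.trans hc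
    have hthirdT : third A ((jT • r) +ᵥ H) = rseq H r (r - jT • r) (t - (ℓ + 1)) :=
      third_coset_eq hH hgen ht htH hmin hAH (by omega) (jT • r)
    have hthirdTst : third A ((jT • r) +ᵥ H) + H = third A ((jT • r) +ᵥ H) := by
      rw [hthirdT]; exact rseq_add hH r _ _
    -- every coset `U ⊆ third (A + T)` meets `B`
    have hmeet : ∀ u : G, u +ᵥ H ⊆ third A ((jT • r) +ᵥ H) → (B ∩ (u +ᵥ H)).Nonempty := by
      intro u hu
      by_contra hem
      rw [not_nonempty_iff_eq_empty] at hem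
      have hU : IsTrio A (u +ᵥ H) (C ∩ third A ((j₀ • r) +ᵥ H)) :=
        ((isTrio_iff_subset_third.2 hu).swap_right).mono Subset.rfl Subset.rfl hC'T
      have htrioU := htrio'.union_left hU
      have hdisj : Disjoint (B ∪ ((j₀ • r) +ᵥ H)) (u +ᵥ H) := by
        rw [disjoint_union_left]
        refine ⟨disjoint_iff_inter_eq_empty.2 hem, ?_⟩
        rcases hH.coset_eq_or_disjoint (j₀ • r) u with he | hd
        · exfalso
          have : x₀ ∈ B ∩ (u +ᵥ H) := mem_inter.2 ⟨hx₀, he ▸ hj₀⟩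
          rw [hem] at this; simp at this
        · exact hd
      have hcardU : #(B ∪ ((j₀ • r) +ᵥ H) ∪ (u +ᵥ H)) = #(B ∪ ((j₀ • r) +ᵥ H)) + #H := by
        rw [card_union_of_disjoint hdisj, card_vadd_finset]
      have h1 := htrioU.trioDeficiency_le_pair
      have h2 := pair_le_of_subset_coset hH hcritH hA hC'ne hC'T
      have h3 : #A ≤ #(A + H) := card_le_card (hH.subset_add A)
      unfold trioDeficiency at h1 hδ'
      omega
    -- `C₃ = C ∪ T`, `B₃ = B ∩ third(A + T)`
    have hTC : (C ∩ ((jT • r) +ᵥ H)).Nonempty :=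
      hC'ne.mono (subset_inter inter_subset_left hC'T)
    have hpur3 := htrio.swap_right.trioDeficiency_le_purify hA hH hcritH (jT • r) hTC
    have hpur3' : trioDeficiency A B C ≤
        trioDeficiency A (B ∩ third A ((jT • r) +ᵥ H)) (C ∪ ((jT • r) +ᵥ H)) := by
      rw [← trioDeficiency_swap_right A B C,
        ← trioDeficiency_swap_right A (B ∩ third A ((jT • r) +ᵥ H)) (C ∪ ((jT • r) +ᵥ H))]
      exact hpur3
    have htrio3 : IsTrio A (B ∩ third A ((jT • r) +ᵥ H)) (C ∪ ((jT • r) +ᵥ H)) :=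
      (htrio.swap_right.union_inter ((jT • r) +ᵥ H)).swap_right
    have hU0 : (r - jT • r) +ᵥ H ⊆ third A ((jT • r) +ᵥ H) := by
      rw [hthirdT]
      have := coset_subset_rseq H r (r - jT • r) (i := 0) (n := t - (ℓ + 1)) (by omega)
      rwa [zero_nsmul, add_zero] at this
    have hU1 : (r - jT • r + 1 • r) +ᵥ H ⊆ third A ((jT • r) +ᵥ H) := by
      rw [hthirdT]; exact coset_subset_rseq H r _ (i := 1) (by omega)
    obtain ⟨y0, hy0⟩ := hmeet _ hU0
    obtain ⟨y1, hy1⟩ := hmeet _ hU1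
    rw [mem_inter] at hy0 hy1
    have hB3c : ∀ c' : G, ¬ (B ∩ third A ((jT • r) +ᵥ H)) ⊆ c' +ᵥ H := by
      intro c' hsub
      have h0 : y0 ∈ c' +ᵥ H := hsub (mem_inter.2 ⟨hy0.1, hU0 hy0.2⟩)
      have h1 : y1 ∈ c' +ᵥ H := hsub (mem_inter.2 ⟨hy1.1, hU1 hy1.2⟩)
      have hdis := disjoint_coset_of_lt hH hmin (r - jT • r) (i := 0) (j := 1) zero_lt_one
        (by omega)
      rw [zero_nsmul, add_zero] at hdis
      have e : (r - jT • r) +ᵥ H = (r - jT • r + 1 • r) +ᵥ H := by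
        rw [← hH.coset_eq_of_mem hy0.2, hH.coset_eq_of_mem h0, ← hH.coset_eq_of_mem h1,
          hH.coset_eq_of_mem hy1.2]
      rw [e, disjoint_self, bot_eq_empty] at hdis
      exact (hH.nonempty.vadd_finset (a := r - jT • r + 1 • r)).ne_empty hdis
    have hC3c : ∀ c' : G, ¬ (C ∪ ((jT • r) +ᵥ H)) ⊆ c' +ᵥ H :=
      fun c' h => hCc c' (subset_union_left.trans h)
    have hδ3 : 0 < trioDeficiency A (B ∩ third A ((jT • r) +ᵥ H)) (C ∪ ((jT • r) +ᵥ H)) :=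
      lt_of_lt_of_le hδ hpur3'
    have hsum3 : #B + #C ≤ #(B ∩ third A ((jT • r) +ᵥ H)) + #(C ∪ ((jT • r) +ᵥ H)) := by
      unfold trioDeficiency at hpur3'; omega
    obtain ⟨B4, C4, hB4, hC4, hC4max, hB4max, htrio4⟩ := exists_closure htrio3
    have hδ4 : 0 < trioDeficiency A B4 C4 :=
      lt_of_lt_of_le hδ3 (trioDeficiency_mono Subset.rfl hB4 hC4)
    have hB4c : ∀ c' : G, ¬ B4 ⊆ c' +ᵥ H := fun c' h => hB3c c' (hB4.trans h)
    have hC4c : ∀ c' : G, ¬ C4 ⊆ c' +ᵥ H := fun c' h => hC3c c' (hC4.trans h)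
    have hjTp : jT ∈ partialCosets H r t C := mem_partialCosets.2 ⟨hjTt, hTC, h5C jT⟩
    have hμ4 : l74Measure H r t B4 C4 < l74Measure H r t B C := by
      refine l74Measure_lt (hGBC htrio4) ?_
      by_cases heq : B4 = B ∩ third A ((jT • r) +ᵥ H) ∧ C4 = C ∪ ((jT • r) +ᵥ H)
      · obtain ⟨rfl, rfl⟩ := heq
        right
        have h1 := card_partialCosets_union_lt hH hmin hjTp
        have h2 := card_le_card
          (partialCosets_inter_subset hH (X := B) (r := r) (t := t) hthirdTst)
        exact ⟨hsum3, by omega⟩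
      · left
        rcases not_and_or.1 heq with hne | hne
        · have := card_lt_card (hB4.ssubset_of_ne (Ne.symm hne))
          have := card_le_card hC4; omega
        · have := card_lt_card (hC4.ssubset_of_ne (Ne.symm hne))
          have := card_le_card hB4; omega
    obtain ⟨hB4fr, -⟩ := ih B4 C4 hμ4 htrio4 hδ4 hC4max hB4max hB4c hC4c
    -- the `R`-sequence through `C₄ ⊇ C` contradicting Claim 4
    exfalso
    apply hDC
    obtain ⟨b4, n4, hn4, hn4t, hB4H, halt4⟩ := hB4fr.normal_form hH hgen ht htH
    have hfull4 := full_cosets_of_fringed hH hmin hn4 hn4t hB4H halt4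
    have hn42 : 2 ≤ n4 := by
      by_contra h
      have h1 : n4 = 1 := by omega
      rw [h1, rseq_one] at hB4H
      exact hB4c b4 (by rw [← hB4H]; exact hH.subset_add B4)
    have hC4ne : C4.Nonempty := hCne.mono (subset_union_left.trans hC4)
    have hC4eq : C4 = (-(A + B4))ᶜ := by rw [hC4max, third]
    have hkey : ∀ (x : G) (L : ℕ), rseq H r x L ⊆ A + B4 → L + 1 = ℓ + n4 →
        ∃ c : G, ∃ n : ℕ, C ⊆ rseq H r c n ∧ A + rseq H r c n ≠ univ := by
      intro x L hsubAB hL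
      have hLt : L < t := by
        by_contra hge
        have huniv' : A + B4 = univ := eq_univ_of_forall fun y => hsubAB
          (rseq_mono H r x (by omega : t ≤ L)
            (by rw [rseq_eq_univ hH hgen ht htH]; exact mem_univ _))
        rw [hC4eq, huniv', Finset.neg_univ, compl_univ] at hC4ne
        exact hC4ne.ne_empty rfl
      refine ⟨r - x, t - L, ?_, ?_⟩
      · rw [← compl_neg_rseq hH hgen ht htH hmin x (by omega) hLt]
        refine (subset_union_left.trans hC4).trans ?_
        rw [hC4eq]
        exact compl_subset_compl.2 (neg_subset_neg hsubAB)
      · have : A + rseq H r (r - x) (t - L) = rseq H r (r - x) (ℓ + 1 + (t - L) - 1) := by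
          have e : A + rseq H r (r - x) (t - L) = (A + H) + rseq H r (r - x) (t - L) := by
            rw [add_assoc, add_comm H, rseq_add hH]
          rw [e, hAH, rseq_add_rseq hH r 0 _ (by omega) (by omega), zero_add]
        rw [this]
        exact rseq_ne_univ_of_lt hH hgen ht htH hmin _ (by omega)
    rcases hfull4 with hf | hf
    · have hABfull := coset_subset_add_of_tail_full hH hAH hn42 hf
      refine hkey (b4 + r) (ℓ + n4 - 1) (fun y hy => ?_) (by omega)
      rw [mem_rseq] at hy
      obtain ⟨i, hi, hyi⟩ := hy
      rw [add_assoc, hsucc] at hyi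
      exact hABfull (i + 1) (by omega) (by omega) hyi
    · have hABfull := coset_subset_add_of_head_full hH hAH hn42 hf
      refine hkey b4 (ℓ + n4 - 1) (fun y hy => ?_) (by omega)
      rw [mem_rseq] at hy
      obtain ⟨i, hi, hyi⟩ := hy
      exact hABfull i (by omega) hyi
  · ---------------------------------------------------------------- `C''` in no coset: use the IH
    push Not at hC''c
    obtain ⟨hB''fr, -⟩ := ih B'' C'' hμ htrio'' hδ'' hC''max hB''max hB''c hC''c
    exfalso
    apply hDB
    obtain ⟨b2, n2, hn2, hn2t, hB2H, halt2⟩ := hB''fr.normal_form hH hgen ht htH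
    have hfull2 := full_cosets_of_fringed hH hmin hn2 hn2t hB2H halt2
    have hn22 : 2 ≤ n2 := by
      by_contra h
      have h1 : n2 = 1 := by omega
      rw [h1, rseq_one] at hB2H
      exact hB''c b2 (by rw [← hB2H]; exact hH.subset_add B'')
    have hC''eq : C'' = (-(A + B''))ᶜ := by rw [hC''max, third]
    have hln : ℓ + n2 < t := by
      by_contra hge
      rcases hfull2 with hf | hf
      · have hABfull := coset_subset_add_of_tail_full hH hAH hn22 hf
        apply hC''c (-b2)
        intro y hy
        rw [hC''eq, mem_compl, mem_neg'] at hy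
        by_contra hy'
        apply hy
        have hnot : -y ∉ b2 +ᵥ H := by
          intro h
          apply hy'
          rw [hH.mem_coset_iff] at h ⊢
          have e : y - -b2 = -(-y - b2) := by abel
          rw [e]; exact hH.neg_mem h
        have hmem := mem_rseq_of_not_mem_head hH hgen ht htH (b := b2) hnot
        rw [mem_rseq] at hmem
        obtain ⟨i, hi, hyi⟩ := hmem
        rw [add_assoc, hsucc] at hyi
        exact hABfull (i + 1) (by omega) (by omega) hyi
      · have hABfull := coset_subset_add_of_head_full hH hAH hn22 hf
        apply hC''c (-(b2 + (t - 1) • r))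
        intro y hy
        rw [hC''eq, mem_compl, mem_neg'] at hy
        by_contra hy'
        apply hy
        have hnot : -y ∉ (b2 + (t - 1) • r) +ᵥ H := by
          intro h
          apply hy'
          rw [hH.mem_coset_iff] at h ⊢
          have e : y - -(b2 + (t - 1) • r) = -(-y - (b2 + (t - 1) • r)) := by abel
          rw [e]; exact hH.neg_mem h
        have hmem := mem_rseq_of_not_mem_tail hH hgen ht htH (b := b2) hnot
        rw [mem_rseq] at hmem
        obtain ⟨i, hi, hyi⟩ := hmem
        exact hABfull i (by omega) hyi
    refine ⟨b2, n2, (subset_union_left.trans hB'').trans (by rw [← hB2H]; exact hH.subset_add B''),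
      ?_⟩
    have : A + rseq H r b2 n2 = rseq H r b2 (ℓ + 1 + n2 - 1) := by
      have e : A + rseq H r b2 n2 = (A + H) + rseq H r b2 n2 := by
        rw [add_assoc, add_comm H, rseq_add hH]
      rw [e, hAH, rseq_add_rseq hH r 0 _ (by omega) (by omega), zero_add]
    rw [this]
    exact rseq_ne_univ_of_lt hH hgen ht htH hmin _ (by omega)

/-- **Lemma 7.4, core** (A in normal position, symmetric conclusion).  For a nontrivial critical
trio `(A,B,C)` which is maximal for fixed `A` (`C = third A B`, `B = third A C`), with `A` a
nontrivial proper near `R`-sequence (`A + H = H ∪ … ∪ ℓR`, `|(A + H) ∖ A| < |H|`, `ℓ ≥ 1`,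
`|G ∖ A| ≥ 2|H|`) and neither `B` nor `C` inside an `H`-coset: `B` and `C` are fringed
`R`-sequences.  Proof as printed: induction on the measure `l74Measure` (deficiency up, partial
cosets down), `l74_main` for `|C| > |H|` and, symmetrically, for `|B| > |H|`.
[cite: BoothbyDevosMontejano2013, Lemma 7.4] -/
theorem isFringedSeq_of_maximal_critical (hH : IsSubgroupCarrier H) (hgen : IsCyclicQuotGen H r)
    (ht : 0 < t) (htH : t • r ∈ H) (hmin : ∀ s : ℕ, 0 < s → s < t → s • r ∉ H)
    (hAH : A + H = rseq H r 0 (ℓ + 1)) (hnear : #((A + H) \ A) < #H) (hℓ : 1 ≤ ℓ)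
    (hproper : 2 * #H ≤ #Aᶜ) (htrio : IsTrio A B C) (hδ : 0 < trioDeficiency A B C)
    (hCmax : C = third A B) (hBmax : B = third A C) (hBc : ∀ c : G, ¬ B ⊆ c +ᵥ H)
    (hCc : ∀ c : G, ¬ C ⊆ c +ᵥ H) : IsFringedSeq H r B ∧ IsFringedSeq H r C := by
  have hHpos := hH.nonempty.card_pos
  have huniv := card_univ_eq_of_minimal hH hgen ht htH hmin
  have hcritH : #(A + H) < #A + #H := by
    have := card_sdiff_add_card_eq_card (hH.subset_add A); omega
  have hAc : #Aᶜ + #A = t * #H := by rw [← huniv, card_compl]; have := card_le_univ A; omega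
  -- properness: `ℓ + 3 ≤ t`
  have hlt3 : ℓ + 3 ≤ t := by
    by_contra hlt
    rcases Nat.lt_or_ge ℓ t with h1 | h1
    · have hAH' : #(A + H) = (ℓ + 1) * #H := by rw [hAH]; exact card_rseq hH hmin 0 (by omega)
      have h2 : t * #H ≤ (ℓ + 1) * #H + #H := by
        rw [← Nat.succ_mul]; exact Nat.mul_le_mul_right _ (by omega)
      omega
    · have hAHu : A + H = univ := by
        rw [hAH]
        exact eq_univ_of_forall fun y => rseq_mono H r 0 (by omega : t ≤ ℓ + 1)
          (by rw [rseq_eq_univ hH hgen ht htH]; exact mem_univ _)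
      have hAH' : #(A + H) = t * #H := by rw [hAHu, card_univ, huniv]
      omega
  suffices h : ∀ N : ℕ, ∀ B C : Finset G, l74Measure H r t B C = N → IsTrio A B C →
      0 < trioDeficiency A B C → C = third A B → B = third A C → (∀ c : G, ¬ B ⊆ c +ᵥ H) →
      (∀ c : G, ¬ C ⊆ c +ᵥ H) → IsFringedSeq H r B ∧ IsFringedSeq H r C from
    h _ B C rfl htrio hδ hCmax hBmax hBc hCc
  intro N
  induction N using Nat.strong_induction_on with
  | _ N ihN =>
  intro B C hN htrio hδ hCmax hBmax hBc hCc
  have ih : ∀ B₁ C₁ : Finset G, l74Measure H r t B₁ C₁ < l74Measure H r t B C →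
      IsTrio A B₁ C₁ → 0 < trioDeficiency A B₁ C₁ → C₁ = third A B₁ → B₁ = third A C₁ →
      (∀ c : G, ¬ B₁ ⊆ c +ᵥ H) → (∀ c : G, ¬ C₁ ⊆ c +ᵥ H) →
      IsFringedSeq H r B₁ ∧ IsFringedSeq H r C₁ :=
    fun B₁ C₁ hlt => ihN _ (hN ▸ hlt) B₁ C₁ rfl
  have hBC : 2 * #H < #B + #C := by
    unfold trioDeficiency at hδ
    rw [huniv] at hδ
    omega
  rcases le_or_gt #B #C with hle | hlt
  · exact l74_main hH hgen ht htH hmin hAH hnear hℓ hlt3 htrio hδ hCmax hBmax hBc hCc (by omega) ih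
  · have hsymm : l74Measure H r t C B = l74Measure H r t B C := by
      rw [l74Measure_def, l74Measure_def]
      have : Fintype.card G - #C - #B = Fintype.card G - #B - #C := by omega
      rw [this]; ring
    have ih' : ∀ B₁ C₁ : Finset G, l74Measure H r t B₁ C₁ < l74Measure H r t C B →
        IsTrio A B₁ C₁ → 0 < trioDeficiency A B₁ C₁ → C₁ = third A B₁ → B₁ = third A C₁ →
        (∀ c : G, ¬ B₁ ⊆ c +ᵥ H) → (∀ c : G, ¬ C₁ ⊆ c +ᵥ H) →
        IsFringedSeq H r B₁ ∧ IsFringedSeq H r C₁ := by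
      rw [hsymm]; exact ih
    have := l74_main hH hgen ht htH hmin hAH hnear hℓ hlt3 htrio.swap_right
      (by rwa [trioDeficiency_swap_right]) hBmax hCmax hCc hBc (by omega) ih'
    exact ⟨this.2, this.1⟩

/-- **Lemma 7.4** (as printed, `A` in normal position).  "Let `(A,B,C)` be a nontrivial critical
trio with `A, B` finite, and assume that every supertrio `(A, B*, C*) ⊇ (A,B,C)` has
`(A,B,C) = (A,B*,C*)`.  Let `H < G`, let `R ∈ G/H` and assume `A` is a nontrivial proper near
`R`-sequence.  If neither `B` nor `C` is contained in an `H`-coset, then `B` and `\overline{C}` are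
fringed `R`-sequences."  The maximality hypothesis is `C = third A B ∧ B = third A C`; `A` is
normalised to `A + H = H ∪ R ∪ … ∪ ℓR` (the general case follows by translating the trio to
`(A − a, B + a, C)`); "nontrivial" = `ℓ ≥ 1`, "proper" = `2|H| ≤ |G ∖ A|`.
[cite: BoothbyDevosMontejano2013, Lemma 7.4] -/
theorem isFringedSeq_and_compl_of_maximal_critical (hH : IsSubgroupCarrier H)
    (hgen : IsCyclicQuotGen H r) (ht : 0 < t) (htH : t • r ∈ H)
    (hmin : ∀ s : ℕ, 0 < s → s < t → s • r ∉ H) (hAH : A + H = rseq H r 0 (ℓ + 1))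
    (hnear : #((A + H) \ A) < #H) (hℓ : 1 ≤ ℓ) (hproper : 2 * #H ≤ #Aᶜ) (htrio : IsTrio A B C)
    (hδ : 0 < trioDeficiency A B C) (hCmax : C = third A B) (hBmax : B = third A C)
    (hBc : ∀ c : G, ¬ B ⊆ c +ᵥ H) (hCc : ∀ c : G, ¬ C ⊆ c +ᵥ H) :
    IsFringedSeq H r B ∧ IsFringedSeq H r Cᶜ := by
  obtain ⟨hB, hC⟩ := isFringedSeq_of_maximal_critical hH hgen ht htH hmin hAH hnear hℓ hproper htrio
    hδ hCmax hBmax hBc hCc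
  refine ⟨hB, hC.compl hH hgen ht htH hmin ?_⟩
  have hA : A.Nonempty := by
    rw [nonempty_iff_ne_empty]; rintro rfl
    rw [empty_add] at hAH
    exact (rseq_nonempty hH r 0 (by omega : 1 ≤ ℓ + 1)).ne_empty hAH.symm
  have hBne : B.Nonempty := by
    rw [nonempty_iff_ne_empty]; rintro rfl; exact hBc 0 (empty_subset _)
  rw [hCmax, third, compl_compl]
  exact (hA.add hBne).neg

end Lemma74

/-! ## Lemma 7.5 (Sequence Stability) -/

section Lemma75

variable [Fintype G] {H A B C : Finset G} {r b : G} {ℓ n t : ℕ}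

omit [Fintype G] in
/-- `H ∪ A = H ∪ R ∪ … ∪ ℓR` when `A ⊆ H ∪ … ∪ ℓR` contains the cosets `R, …, ℓR`.
[cite: BoothbyDevosMontejano2013, §4] -/
theorem union_eq_rseq_of_full (hA : A ⊆ rseq H r 0 (ℓ + 1))
    (hfull : ∀ j : ℕ, 1 ≤ j → j ≤ ℓ → (j • r) +ᵥ H ⊆ A) : H ∪ A = rseq H r 0 (ℓ + 1) := by
  refine Subset.antisymm (union_subset ?_ hA) ?_
  · have := coset_subset_rseq H r 0 (i := 0) (n := ℓ + 1) (by omega)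
    rwa [zero_nsmul, add_zero, zero_vadd] at this
  · intro x hx
    rw [mem_rseq] at hx
    obtain ⟨i, hi, hxi⟩ := hx
    rw [zero_add] at hxi
    rcases Nat.eq_zero_or_pos i with rfl | hpos
    · rw [zero_nsmul, zero_vadd] at hxi; exact mem_union_left _ hxi
    · exact mem_union_right _ (hfull i hpos (by omega) hxi)

omit [Fintype G] in
/-- The hull of such an `A` meeting `H` is `H ∪ R ∪ … ∪ ℓR`. [cite: BoothbyDevosMontejano2013, §4] -/
theorem add_eq_rseq_of_full (hH : IsSubgroupCarrier H) (hA : A ⊆ rseq H r 0 (ℓ + 1))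
    (hfull : ∀ j : ℕ, 1 ≤ j → j ≤ ℓ → (j • r) +ᵥ H ⊆ A) (hA0 : (A ∩ H).Nonempty) :
    A + H = rseq H r 0 (ℓ + 1) := by
  rw [add_eq_union_of_union_eq_rseq hH (union_eq_rseq_of_full hA hfull) hA0]
  exact union_eq_rseq_of_full hA hfull

/-- "By maximality `A` is also a fringed `R`-sequence" (tail side): if `A = third B C`,
`C = third A B`, `B ⊆ b + [0,n)R` and `A + B ⊇ b + kR` for `1 ≤ k < ℓ + n`, then `A ⊇ jR` for
`1 ≤ j ≤ ℓ`. [cite: BoothbyDevosMontejano2013, Lemma 7.5 (proof)] -/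
theorem coset_subset_left_of_maximal_tail (hH : IsSubgroupCarrier H) (hB : B ⊆ rseq H r b n)
    (hAmax : A = third B C) (hCmax : C = third A B)
    (hfull : ∀ k : ℕ, 1 ≤ k → k < ℓ + n → (b + k • r) +ᵥ H ⊆ A + B) :
    ∀ j : ℕ, 1 ≤ j → j ≤ ℓ → (j • r) +ᵥ H ⊆ A := by
  intro j hj1 hjℓ x hx
  rw [hAmax, mem_third]
  intro hneg
  obtain ⟨β, hβ, c, hc, hβc⟩ := mem_add.1 hneg
  have hβ' := hB hβ
  rw [mem_rseq] at hβ'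
  obtain ⟨i, hi, hβi⟩ := hβ'
  rw [hCmax, mem_third] at hc
  apply hc
  have e : -c = x + β := by
    have : x = -(β + c) := by rw [hβc, neg_neg]
    rw [this]; abel
  rw [e]
  apply hfull (j + i) (by omega) (by omega)
  rw [hH.mem_coset_iff] at hβi hx ⊢
  have e2 : x + β - (b + (j + i) • r) = (x - j • r) + (β - (b + i • r)) := by rw [add_nsmul]; abel
  rw [e2]; exact hH.add_mem hx hβi

/-- Head-side version of the previous lemma. [cite: BoothbyDevosMontejano2013, Lemma 7.5 (proof)] -/
theorem coset_subset_left_of_maximal_head (hH : IsSubgroupCarrier H) (hB : B ⊆ rseq H r b n)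
    (hAmax : A = third B C) (hCmax : C = third A B)
    (hfull : ∀ k : ℕ, k + 1 < ℓ + n → (b + k • r) +ᵥ H ⊆ A + B) :
    ∀ j : ℕ, j + 1 ≤ ℓ → (j • r) +ᵥ H ⊆ A := by
  intro j hjℓ x hx
  rw [hAmax, mem_third]
  intro hneg
  obtain ⟨β, hβ, c, hc, hβc⟩ := mem_add.1 hneg
  have hβ' := hB hβ
  rw [mem_rseq] at hβ'
  obtain ⟨i, hi, hβi⟩ := hβ'
  rw [hCmax, mem_third] at hc
  apply hc
  have e : -c = x + β := by
    have : x = -(β + c) := by rw [hβc, neg_neg]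
    rw [this]; abel
  rw [e]
  apply hfull (j + i) (by omega)
  rw [hH.mem_coset_iff] at hβi hx ⊢
  have e2 : x + β - (b + (j + i) • r) = (x - j • r) + (β - (b + i • r)) := by rw [add_nsmul]; abel
  rw [e2]; exact hH.add_mem hx hβi

omit [Fintype G] [DecidableEq G] in
/-- `−R` generates `G/H` when `R` does. [cite: BoothbyDevosMontejano2013, §4] -/
theorem IsCyclicQuotGen.neg [DecidableEq G] (hH : IsSubgroupCarrier H) (hgen : IsCyclicQuotGen H r)
    (ht : 0 < t) (htH : t • r ∈ H) : IsCyclicQuotGen H (-r) := by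
  intro x
  obtain ⟨j, hjt, hj⟩ := exists_index_lt hH hgen ht htH x
  refine ⟨t - j, ?_⟩
  rw [hH.mem_coset_iff] at hj ⊢
  have e1 : (t - j) • r + j • r = t • r := by rw [← add_nsmul, Nat.sub_add_cancel hjt.le]
  have e : x - (t - j) • (-r) = (x - j • r) + t • r := by rw [neg_nsmul, ← e1]; abel
  rw [e]; exact hH.add_mem hj htH

omit [Fintype G] [DecidableEq G] in
/-- The similarity `(A, B, C) ~ (g₁ + A, g₂ + B, −g₁ − g₂ + C)`. [cite: BoothbyDevosMontejano2013, §4] -/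
theorem Similar.translate₃ [DecidableEq G] (A B C : Finset G) (g₁ g₂ : G) :
    Similar (A, B, C) (g₁ +ᵥ A, g₂ +ᵥ B, (-g₁ - g₂) +ᵥ C) := by
  have h1 : Similar (A, B, C) (g₁ +ᵥ A, -g₁ +ᵥ B, C) := Similar.translate g₁ (Similar.refl _)
  have h2 : Similar (A, B, C) (-g₁ +ᵥ B, C, g₁ +ᵥ A) := h1.rotate
  have h3 : Similar (A, B, C) ((g₁ + g₂) +ᵥ (-g₁ +ᵥ B), -(g₁ + g₂) +ᵥ C, g₁ +ᵥ A) :=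
    h2.translate (g₁ + g₂)
  have e1 : (g₁ + g₂) +ᵥ (-g₁ +ᵥ B) = g₂ +ᵥ B := by
    rw [vadd_vadd]; congr 1; abel
  have e2 : -(g₁ + g₂) +ᵥ C = (-g₁ - g₂) +ᵥ C := by congr 1; abel
  rw [e1, e2] at h3
  exact h3.rotate.rotate

/-- **Lemma 7.5, core case** (everything in normal position for the generator `R = r + H`): `A` and
`B` basic "tail-full" sets (`A ⊆ H ∪ … ∪ ℓR` containing `R, …, ℓR` and meeting `H`; `B` likewise with
`n`), `(A,B,C)` a maximal trio with `C` in no `H`-coset.  Then `(A,B,C)` is a pure chord (if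
`H ⊆ A + B`: all three sets are full `R`-sequences) or an impure chord (otherwise) in normal position.
[cite: BoothbyDevosMontejano2013, Lemma 7.5 (proof)] -/
theorem pureChordAt_or_impureChordAt (hH : IsSubgroupCarrier H) (hgen : IsCyclicQuotGen H r)
    (ht : 0 < t) (htH : t • r ∈ H) (hmin : ∀ s : ℕ, 0 < s → s < t → s • r ∉ H)
    (hA : A ⊆ rseq H r 0 (ℓ + 1)) (hAfull : ∀ j : ℕ, 1 ≤ j → j ≤ ℓ → (j • r) +ᵥ H ⊆ A)
    (hA0 : (A ∩ H).Nonempty) (hℓ : 1 ≤ ℓ)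
    (hB : B ⊆ rseq H r 0 n) (hBfull : ∀ j : ℕ, 1 ≤ j → j < n → (j • r) +ᵥ H ⊆ B)
    (hB0 : (B ∩ H).Nonempty) (hn : 2 ≤ n)
    (hmax : IsMaximalTrio A B C) (hCc : ∀ c : G, ¬ C ⊆ c +ᵥ H) :
    IsPureChordAt H r A B C ∨ IsImpureChordAt H r A B C := by
  obtain ⟨eC, eB, eA⟩ := isMaximalTrio_iff.1 hmax
  have hAH : A + H = rseq H r 0 (ℓ + 1) := add_eq_rseq_of_full hH hA hAfull hA0
  obtain ⟨n', rfl⟩ : ∃ n', n = n' + 1 := ⟨n - 1, by omega⟩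
  have hBH : B + H = rseq H r 0 (n' + 1) :=
    add_eq_rseq_of_full hH hB (fun j hj1 hj2 => hBfull j hj1 (by omega)) hB0
  have hsucc : ∀ i : ℕ, r + i • r = (i + 1) • r := fun i => by rw [add_nsmul, one_nsmul, add_comm]
  -- `A + B ⊇ R ∪ … ∪ (ℓ + n − 1)R`
  have hABfull := coset_subset_add_of_tail_full hH hAH (b := 0) (X := B) (n := n' + 1) (by omega)
    (fun j hj1 hj2 => by rw [zero_add]; exact hBfull j hj1 hj2)
  have hABsub : A + B ⊆ rseq H r 0 (ℓ + n' + 1) := by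
    have := add_subset_add hA hB
    rwa [rseq_add_rseq hH r 0 0 (by omega) (by omega), add_zero,
      show ℓ + 1 + (n' + 1) - 1 = ℓ + n' + 1 by omega] at this
  have hmid : rseq H r r (ℓ + n') ⊆ A + B := by
    intro y hy
    rw [mem_rseq] at hy
    obtain ⟨i, hi, hyi⟩ := hy
    rw [hsucc] at hyi
    have := hABfull (i + 1) (by omega) (by omega)
    rw [zero_add] at this
    exact this hyi
  -- `ℓ + n < t`: otherwise `C` lies in the coset `H`
  have hlnt : ℓ + n' + 1 < t := by
    by_contra hge
    apply hCc 0
    rw [zero_vadd]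
    intro c hc
    rw [eC, mem_third] at hc
    by_contra hcH
    apply hc
    have hncH : -c ∉ (0 : G) +ᵥ H := by
      rw [zero_vadd]; exact fun h => hcH (by simpa using hH.neg_mem h)
    have hmem := mem_rseq_of_not_mem_head hH hgen ht htH hncH
    rw [zero_add] at hmem
    exact hmid (rseq_mono H r r (by omega) hmem)
  by_cases hfull0 : H ⊆ A + B
  · ---------------------------------------------------------------- pure chord
    left
    have hAB : A + B = rseq H r 0 (ℓ + n' + 1) := by
      refine Subset.antisymm hABsub ?_
      rw [← union_rseq_r]
      exact union_subset hfull0 hmid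
    have hC : C = rseq H r r (t - (ℓ + n' + 1)) := by
      rw [eC, third, hAB, compl_neg_rseq hH hgen ht htH hmin 0 (by omega) hlnt, sub_zero]
    have hAC : A + C = rseq H r r (t - (n' + 1)) := by
      have : A + C = (A + H) + C := by rw [add_assoc, add_comm H, hC, rseq_add hH]
      rw [this, hAH, hC, rseq_add_rseq hH r 0 r (by omega) (by omega), zero_add]
      congr 1; omega
    have hBeq : B = rseq H r 0 (n' + 1) := by
      rw [eB, third, hAC, compl_neg_rseq hH hgen ht htH hmin r (by omega) (by omega), sub_self]
      congr 1; omega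
    have hBC : B + C = rseq H r r (t - (ℓ + 1)) := by
      rw [hBeq, hC, rseq_add_rseq hH r 0 r (by omega) (by omega), zero_add]
      congr 1; omega
    have hAeq : A = rseq H r 0 (ℓ + 1) := by
      rw [eA, third, hBC, compl_neg_rseq hH hgen ht htH hmin r (by omega) (by omega), sub_self]
      congr 1; omega
    exact ⟨hgen, ⟨0, ℓ + 1, by omega, hAeq⟩, ⟨0, n' + 1, by omega, hBeq⟩, eC, hCc⟩
  · ---------------------------------------------------------------- impure chord
    right
    refine ⟨hgen, ⟨ℓ + 1, by omega, union_eq_rseq_of_full hA hAfull⟩,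
      ⟨n' + 1, by omega, union_eq_rseq_of_full hB fun j hj1 hj2 => hBfull j hj1 (by omega)⟩,
      by rw [← eC], ?_, hA0, hB0, ?_⟩
    · -- `C ∖ H ⊇ the cosets outside −(A + B) ⊆ −hull`
      have hr : r ∈ C \ H := by
        rw [mem_sdiff, eC, mem_third]
        refine ⟨fun h => ?_, by have := hmin 1 one_pos (by omega); rwa [one_nsmul] at this⟩
        have h' := hABsub h
        have hidx : -r ∈ ((t - 1) • r) +ᵥ H := by
          have := neg_mem_coset hH htH (j := 1) (x := r) (by omega) (by rw [one_nsmul]; exact hH.mem_coset_self r)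
          exact this
        have := (mem_rseq_zero_iff hH hmin (k := t - 1) (by omega) (by omega) hidx).1 h'
        omega
      exact ⟨r, hr⟩
    · -- `C ∩ H ∋ −h₀` for `h₀ ∈ H ∖ (A + B)`
      obtain ⟨h₀, hh₀H, hh₀⟩ : ∃ h₀ ∈ H, h₀ ∉ A + B := by
        by_contra hall; push Not at hall; exact hfull0 fun h hh => hall h hh
      refine ⟨-h₀, mem_inter.2 ⟨?_, hH.neg_mem hh₀H⟩⟩
      rw [eC, mem_third, neg_neg]; exact hh₀

/-- **Lemma 7.5 (Sequence Stability).**  "Let `(A,B,C)` be a maximal critical trio with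
`[A] = [B] = [C] = G`.  If `A` is a proper near sequence, then `(A,B,C)` is either a pure or an
impure chord."  Here `A` is a nontrivial proper near `R`-sequence in normal position
(`A + H = H ∪ … ∪ ℓR`, `ℓ ≥ 1`, `|(A+H) ∖ A| < |H|`, `2|H| ≤ |G ∖ A|`) and "`[B] = [C] = G`" is used
only as "`B`, `C` lie in no `H`-coset".  Proof as printed: Lemma 7.4 gives `B` fringed; "by
maximality `A` is also a fringed `R`-sequence"; "again using maximality" (the core case
`pureChordAt_or_impureChordAt`, after translating `B` to head `H` and, when the full cosets sit on
the head side, passing to the generator `−R`). [cite: BoothbyDevosMontejano2013, Lemma 7.5] -/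
theorem isPureChord_or_isImpureChord_of_near (hH : IsSubgroupCarrier H) (hgen : IsCyclicQuotGen H r)
    (ht : 0 < t) (htH : t • r ∈ H) (hmin : ∀ s : ℕ, 0 < s → s < t → s • r ∉ H)
    (hAH : A + H = rseq H r 0 (ℓ + 1)) (hnear : #((A + H) \ A) < #H) (hℓ : 1 ≤ ℓ)
    (hproper : 2 * #H ≤ #Aᶜ) (hmax : IsMaximalTrio A B C) (hδ : 0 < trioDeficiency A B C)
    (hBc : ∀ c : G, ¬ B ⊆ c +ᵥ H) (hCc : ∀ c : G, ¬ C ⊆ c +ᵥ H) :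
    IsPureChord H (A, B, C) ∨ IsImpureChord H (A, B, C) := by
  obtain ⟨eC, eB, eA⟩ := isMaximalTrio_iff.1 hmax
  have hAsub : A ⊆ rseq H r 0 (ℓ + 1) := by rw [← hAH]; exact hH.subset_add A
  have hA0 : (A ∩ H).Nonempty := by
    have := inter_coset_nonempty_of_add_eq hH hAH (i := 0) (by omega)
    rwa [zero_nsmul, zero_vadd] at this
  have hAℓ : (A ∩ ((ℓ • r) +ᵥ H)).Nonempty := inter_coset_nonempty_of_add_eq hH hAH le_rfl
  obtain ⟨hBfr, -⟩ := isFringedSeq_of_maximal_critical hH hgen ht htH hmin hAH hnear hℓ hproper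
    hmax.1 hδ eC eB hBc hCc
  obtain ⟨b, n, hn, hnt, hBH, halt⟩ := hBfr.normal_form hH hgen ht htH
  have hBsub : B ⊆ rseq H r b n := by rw [← hBH]; exact hH.subset_add B
  have hn2 : 2 ≤ n := by
    by_contra h
    have h1 : n = 1 := by omega
    rw [h1, rseq_one] at hBH
    exact hBc b (by rw [← hBH]; exact hH.subset_add B)
  have hfc := full_cosets_of_fringed hH hmin hn hnt hBH halt
  obtain ⟨L, rfl⟩ : ∃ L, n = L + 1 := ⟨n - 1, by omega⟩
  have hB0 : (B ∩ (b +ᵥ H)).Nonempty := by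
    have := inter_coset_nonempty_of_add_eq' hH hBH (i := 0) (by omega)
    rwa [zero_nsmul, add_zero] at this
  have hBt : (B ∩ ((b + L • r) +ᵥ H)).Nonempty := inter_coset_nonempty_of_add_eq' hH hBH (i := L) le_rfl
  have eA' : A = third B C := by rw [eA]
  have eC' : C = third A B := eC
  rcases hfc with hBfull | hBfull
  · ---------------------------------------------------------------- tail side full: generator `r`
    have hABfull := coset_subset_add_of_tail_full hH hAH hn2 hBfull
    have hAfull := coset_subset_left_of_maximal_tail hH hBsub eA' eC' hABfull
    -- translate `B` to head `H`: `(A, −b + B, b + C)`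
    have hsim : Similar (A, B, C) (A, (-b) +ᵥ B, b +ᵥ C) := by
      have := Similar.translate₃ A B C 0 (-b)
      rwa [zero_vadd, show -(0 : G) - -b = b by abel] at this
    have hsim' : Similar (A, (-b) +ᵥ B, b +ᵥ C) (A, B, C) := by
      have := Similar.translate₃ A ((-b) +ᵥ B) (b +ᵥ C) 0 b
      rwa [zero_vadd, vadd_neg_vadd, show -(0 : G) - b = -b by abel, neg_vadd_vadd] at this
    have hmax' : IsMaximalTrio A ((-b) +ᵥ B) (b +ᵥ C) := hsim.isMaximalTrio_iff.1 hmax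
    have hB'sub : (-b) +ᵥ B ⊆ rseq H r 0 (L + 1) := by
      have := vadd_finset_subset_vadd_finset (a := -b) hBsub
      rwa [vadd_rseq, neg_add_cancel] at this
    have hB'full : ∀ j : ℕ, 1 ≤ j → j < L + 1 → (j • r) +ᵥ H ⊆ (-b) +ᵥ B := by
      intro j hj1 hj2
      have := vadd_finset_subset_vadd_finset (a := -b) (hBfull j hj1 hj2)
      rwa [vadd_vadd, neg_add_cancel_left] at this
    have hB'0 : (((-b) +ᵥ B) ∩ H).Nonempty := by
      obtain ⟨y, hy⟩ := hB0
      rw [mem_inter] at hy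
      refine ⟨-b + y, mem_inter.2 ⟨vadd_mem_vadd_finset hy.1, ?_⟩⟩
      have := (hH.mem_coset_iff).1 hy.2
      have e : -b + y = y - b := by abel
      rw [e]; exact this
    have hC'c : ∀ c : G, ¬ b +ᵥ C ⊆ c +ᵥ H := by
      intro c h
      apply hCc (-b + c)
      have := vadd_finset_subset_vadd_finset (a := -b) h
      rwa [neg_vadd_vadd, vadd_vadd] at this
    rcases pureChordAt_or_impureChordAt hH hgen ht htH hmin hAsub hAfull hA0 hℓ hB'sub hB'full hB'0
      hn2 hmax' hC'c with h | h
    · exact Or.inl ⟨r, A, (-b) +ᵥ B, b +ᵥ C, h, hsim'⟩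
    · exact Or.inr ⟨r, A, (-b) +ᵥ B, b +ᵥ C, h, hsim'⟩
  · ---------------------------------------------------------------- head side full: generator `−r`
    have hABfull := coset_subset_add_of_head_full hH hAH hn2 hBfull
    have hAfull := coset_subset_left_of_maximal_head hH hBsub eA' eC' hABfull
    -- period data and generation for `−r`
    have hgen' : IsCyclicQuotGen H (-r) := hgen.neg hH ht htH
    have htH' : t • (-r) ∈ H := by rw [neg_nsmul]; exact hH.neg_mem htH
    have hmin' : ∀ s : ℕ, 0 < s → s < t → s • (-r) ∉ H := by
      intro s hs1 hs2 h
      rw [neg_nsmul] at h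
      exact hmin s hs1 hs2 (by simpa using hH.neg_mem h)
    -- translations: `A' = −ℓr + A`, `B' = −(b + (n−1)r) + B`, `C' = (ℓr + b + (n−1)r) + C`
    set gA : G := -(ℓ • r) with hgA
    set gB : G := -(b + L • r) with hgB
    have hsim : Similar (A, B, C) (gA +ᵥ A, gB +ᵥ B, (-gA - gB) +ᵥ C) := Similar.translate₃ A B C gA gB
    have hsim' : Similar (gA +ᵥ A, gB +ᵥ B, (-gA - gB) +ᵥ C) (A, B, C) := by
      have := Similar.translate₃ (gA +ᵥ A) (gB +ᵥ B) ((-gA - gB) +ᵥ C) (-gA) (-gB)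
      rwa [neg_vadd_vadd, neg_vadd_vadd, vadd_vadd, show -(-gA) - -gB + (-gA - gB) = 0 by abel,
        zero_vadd] at this
    have hmax' := hsim.isMaximalTrio_iff.1 hmax
    -- index conversion: the coset `i•r + H` is the coset `(ℓ − i)•(−r) + H` of `−ℓr + A`
    have hconvA : ∀ (i : ℕ) (x : G), i ≤ ℓ → x ∈ (i • r) +ᵥ H → gA + x ∈ ((ℓ - i) • (-r)) +ᵥ H := by
      intro i x hi hx
      rw [hH.mem_coset_iff] at hx ⊢
      have e1 : (ℓ - i) • r + i • r = ℓ • r := by rw [← add_nsmul, Nat.sub_add_cancel hi]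
      have e : gA + x - (ℓ - i) • (-r) = x - i • r := by rw [hgA, neg_nsmul, ← e1]; abel
      rw [e]; exact hx
    have hconvB : ∀ (i : ℕ) (x : G), i ≤ L → x ∈ (b + i • r) +ᵥ H →
        gB + x ∈ ((L - i) • (-r)) +ᵥ H := by
      intro i x hi hx
      rw [hH.mem_coset_iff] at hx ⊢
      have e1 : (L - i) • r + i • r = L • r := by rw [← add_nsmul, Nat.sub_add_cancel hi]
      have e : gB + x - (L - i) • (-r) = x - (b + i • r) := by rw [hgB, neg_nsmul, ← e1]; abel
      rw [e]; exact hx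
    have hA'sub : gA +ᵥ A ⊆ rseq H (-r) 0 (ℓ + 1) := by
      intro y hy
      rw [mem_vadd_finset] at hy
      obtain ⟨x, hx, rfl⟩ := hy
      have hx' := hAsub hx
      rw [mem_rseq] at hx'
      obtain ⟨i, hi, hxi⟩ := hx'
      rw [zero_add] at hxi
      rw [mem_rseq]
      exact ⟨ℓ - i, by omega, by rw [zero_add, vadd_eq_add]; exact hconvA i x (by omega) hxi⟩
    have hA'full : ∀ j : ℕ, 1 ≤ j → j ≤ ℓ → (j • (-r)) +ᵥ H ⊆ gA +ᵥ A := by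
      intro j hj1 hj2 y hy
      -- `y = gA + x` with `x ∈ (ℓ − j)•r + H ⊆ A`
      have hx : -gA + y ∈ ((ℓ - j) • r) +ᵥ H := by
        rw [hH.mem_coset_iff] at hy ⊢
        have e1 : (ℓ - j) • r + j • r = ℓ • r := by rw [← add_nsmul, Nat.sub_add_cancel hj2]
        have e : -gA + y - (ℓ - j) • r = y - j • (-r) := by rw [hgA, neg_nsmul, ← e1]; abel
        rw [e]; exact hy
      have := hAfull (ℓ - j) (by omega) hx
      rw [← neg_vadd_mem_iff]; exact this
    have hA'0 : ((gA +ᵥ A) ∩ H).Nonempty := by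
      obtain ⟨x, hx⟩ := hAℓ
      rw [mem_inter] at hx
      refine ⟨gA + x, mem_inter.2 ⟨vadd_mem_vadd_finset hx.1, ?_⟩⟩
      have := hconvA ℓ x le_rfl hx.2
      rwa [Nat.sub_self, zero_nsmul, zero_vadd] at this
    have hB'sub : gB +ᵥ B ⊆ rseq H (-r) 0 (L + 1) := by
      intro y hy
      rw [mem_vadd_finset] at hy
      obtain ⟨x, hx, rfl⟩ := hy
      have hx' := hBsub hx
      rw [mem_rseq] at hx'
      obtain ⟨i, hi, hxi⟩ := hx'
      rw [mem_rseq]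
      exact ⟨L - i, by omega, by rw [zero_add, vadd_eq_add]; exact hconvB i x (by omega) hxi⟩
    have hB'full : ∀ j : ℕ, 1 ≤ j → j < L + 1 → (j • (-r)) +ᵥ H ⊆ gB +ᵥ B := by
      intro j hj1 hj2 y hy
      have hx : -gB + y ∈ (b + (L - j) • r) +ᵥ H := by
        rw [hH.mem_coset_iff] at hy ⊢
        have e1 : (L - j) • r + j • r = L • r := by rw [← add_nsmul, Nat.sub_add_cancel (by omega)]
        have e : -gB + y - (b + (L - j) • r) = y - j • (-r) := by
          rw [hgB, neg_nsmul, ← e1]; abel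
        rw [e]; exact hy
      have := hBfull (L - j) (by omega) hx
      rw [← neg_vadd_mem_iff]; exact this
    have hB'0 : ((gB +ᵥ B) ∩ H).Nonempty := by
      obtain ⟨x, hx⟩ := hBt
      rw [mem_inter] at hx
      refine ⟨gB + x, mem_inter.2 ⟨vadd_mem_vadd_finset hx.1, ?_⟩⟩
      have := hconvB L x le_rfl hx.2
      rwa [Nat.sub_self, zero_nsmul, zero_vadd] at this
    have hC'c : ∀ c : G, ¬ (-gA - gB) +ᵥ C ⊆ c +ᵥ H := by
      intro c h
      apply hCc (-(-gA - gB) + c)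
      have := vadd_finset_subset_vadd_finset (a := -(-gA - gB)) h
      rwa [neg_vadd_vadd, vadd_vadd] at this
    rcases pureChordAt_or_impureChordAt hH hgen' ht htH' hmin' hA'sub hA'full hA'0 hℓ hB'sub hB'full
      hB'0 hn2 hmax' hC'c with h | h
    · exact Or.inl ⟨-r, _, _, _, h, hsim'⟩
    · exact Or.inr ⟨-r, _, _, _, h, hsim'⟩

end Lemma75

end Literature.Combinatorics.Additive
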